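import Mathlib
import Literature.MathematicalPhysics.QuantumFieldTheory.Dimock2015.AnalyticLipschitz
import Literature.MathematicalPhysics.QuantumFieldTheory.Balaban1983to89.T4OutputRate
import Literature.MathematicalPhysics.QuantumFieldTheory.Balaban1983to89.T4InputCauchyRate

/-!
# T4InputCauchyRateData — the INPUT-INTERPOLATION CAUCHY RATE with the DATA FIXED BEFORE THE INEQUALITIES: two runs of
# ONE analytic step map, the two-margin Cauchy estimate on the interpolating line, and the kernel reduction
# `NE5 ⇐ RecursiveRate ⇐ (representation, one-run envelope, operator rate, insertion rate, damped insertion)`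
# (cell `pub-balaban`, T⁴-continuum fan-out, node U3 / spine estimate NE5, prover seat P1 = "cluster-expansion derivative
# bound: differentiate the convergent expansion in its inputs and bound term-wise (analyticity strip ⇒ Cauchy estimate)";
# v2 of the seat's line, answering the cross-reader's advisory A on `T4InputCauchyRate` v1)

HONEST FRAMING.  The cell's T4 target is rung (B)+1 (existence AND uniqueness of the ε → 0 limit of Bałaban's unit-scale
expectations on a FIXED finite torus T⁴); NOT infinite volume, NOT a mass gap, NOT the Clay problem.  The conditionals of
the spine (BetaPertH, (B), (B^μ)) are untouched by this module and stay explicit wherever the spine composes (`T4OutputRate`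
docstring; T4-DAG §2).  NOTHING printed in the audited papers is asserted here: the structure `StepModel` is
HYPOTHESIS-CARRYING DATA and every `def … : Prop` below is a HYPOTHESIS SHAPE over it and over the ABSTRACT carriers of
`T4OutputRate` (to be ASSUMED by consumers, never cited as a fact); every `theorem` is kernel-checked complex analysis / real
bookkeeping about the shapes, plus a toy instance.  The estimate NE5 itself is NOT PRINTED anywhere in [Balaban1987RG1],
[Balaban1988RG2Cluster], [Balaban1988Convergent] (cell GAPS G-t4-U3-1); this module does not change that.  Value = (i) the
kernel theorem "two-margin Cauchy rate on the interpolating line" (`norm_sub_le_of_two_margins`), the exact abstract form of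
the seat's technique with ONE STRIP WIDTH PER INPUT SPECIES; (ii) the TYPED decomposition of the missing inequality NE5 into
five named hypotheses over data fixed in advance (`recursiveRate_of_stepModel`, `ne5_of_stepModel`), so that the cell's
located items MI-1, MI-3a, MI-3b = G-ne5p1-1′, G-ne5p1-4 are BINDERS, not prose; (iii) non-vacuity; NOT summit progress.

WHY v2 (the cross-read of v1, cell file `b2b-balaban-pv12-g12/XREAD-T4InputCauchyRate-v1.md`, advisory A).  v1's per-domain
block model `T4InputCauchyRate.CauchyBlockStep` chooses the blocks, the functional and BOTH data points existentially AFTER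
the discrepancy is known, and the reader's kernel lemma `cbs_of_ne5_half` shows `NE5(θ, A/2) ⇒ CauchyBlockStep ⇒ NE5(θ, ≥ A)`:
as a Prop about the pair (E^A, E^B) it carries no information beyond NE5.  Here the DATA come first: ONE output map `Out k`
per step, the two runs' operator-data maps `opA`, `opB`, their history-INSERTION maps `insA`, `insB` (earlier-output table ↦
inserted history datum), the one-run admissible class `Base` and the two analyticity MARGINS `rOp`, `rHist`; the runs'
outputs are then the ORBITS of these maps (`RepresentsA/B`; `representsA_ext`: the recursion determines the run), the
step-`k` insertion is blind to scales `≥ k` (`insA_eq_of_agree_below`), and the inequalities are separate named Props none of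
which mentions the discrepancy E^A − E^B.  (No abstract interface can exclude EVERY degenerate instantiation; what the typing
buys is that an instantiation must exhibit maps, margins and a base class on which B13-type statements are checkable one
run at a time.)  The sibling seat P2 (`T4ActivityLipschitz` v2: `ClusterRep.PencilKP`, `PencilBudget`, `ne5_of_pencil`) hosts
the same move at the ACTIVITY level inside a cluster representation; this module stays at the INPUT level (operators +
history insertion + margins) and supplies what an activity-level pencil budget `radius ≤ cθ^k` cannot get from NE2 ∧ NE3
alone: the step-`k` history radius carries `Σ_{j<k} ω^{k−j}D_j`, which is `θ^k`-small only through the induction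
(`T4InputCauchyRate.RecursiveRate`, the common currency of P1/P2 compositions).

FILE v2 (generation 3 of the seat, 2026-08-19; ADDITIVE — every file-v1 declaration byte-identical; DOCFIX of the header and
of ONE docstring).  (K0) DOCFIX: the p. 20 quotation «(L + 2)⁴O(1)ε₂ ≤ ½» (file v1 carried «¼»; cross-read `b2b-balaban-ref6`
generation 30, REFEREE6 E124; re-read on the render p020 by this seat).  (K1) §4: the wall MI-3a SPLIT into the printed
STRUCTURE "the insertion is affine in the table" (`InsAffine`) and the one-run size bound with per-scale levels
(`SizeDamped`), `insertionDamped_of_affine`.  (K2) §5: the PRINTED age normalisation (newest scale undamped) with the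
smallness in the form `ω + 4Gc < θ` (`ne5_of_stepModel_nat`), and the corrected census NUMBERS (file v2) below, which
WITHDRAWS the file-v1 sentence on the size of the history gain; the docstring of `ne5_of_stepModel` corrected accordingly.
(K3) §6: the toy in structural form.  The junction with seat P2's activity-level recursion is P2's module
`T4ActivityRecursion` (journal claim T4-U3.E-NE5-PROVE-P2c) and is not duplicated here.

FILE v3 (generation 4 of the seat, 2026-08-19; ADDITIVE — every file-v2.1 declaration byte-identical; header: this paragraph,
the §7–§8 entry of "What is PROVED", NUMBERS (d) and the provenance sentence).  (K) §7 THE NEAR REGIME: the two-margin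
Cauchy rate with the EXACT constant `Gρ/(1 − ρ)` for every relative discrepancy `ρ < 1` (`norm_sub_le_of_line_lt_one`; the
`2G` of `norm_sub_le_of_line` is the `ρ = 1/2` worst case and the `4G` of `norm_sub_le_of_two_margins` adds the merging with
the far regime), and the recursion of §2 re-run in an A-PRIORI near regime: the one-run decay bounds cap every inherited
discrepancy level by `EA₀ + E₀`, so from a scale `k₀` on the relative displacement of the two runs' data is
`≤ ρ₀ := (δ + δ′)θ^{k₀} + c(EA₀ + E₀)ω/(1 − ω) < 1` and the recursion constants become `G/(1 − ρ₀)` in place of `4G`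
(`recursiveRate_of_stepModel_near`; `ne5_of_stepModel_near`; `ne5_of_stepModel_near_nat` with the smallness
`ω + Gc/(1 − ρ₀) < θ` in the printed age normalisation; §8 toy `toy_ne5Data_near`, threshold `7/64` instead of `13/64`).
Census consequence: NUMBERS (d).

FILE v4 (generation 5 of the seat, 2026-08-19; ADDITIVE — every file-v3 declaration byte-identical except the docstring of
`ne5_of_stepModel_near_nat` (DOCFIX); header: this paragraph, the §9–§10 entry of "What is PROVED", one DICTIONARY clause,
the provenance sentence, and the DOCFIX «K′ ≈ 1.23 at λ = 11» (v3 printed «≈ 1.25»; 11/(10·(1 − 0.107)) = 1.23; cross-read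
`b2b-balaban-ref5` generation 31, REFEREE5 #150, advisory R1) in NUMBERS (d) and in that docstring).  (K1) §9 SCALE
RESOLUTION: the wall G-ne5p1-3a′ (`SizeDampedNat`: the one-run size bound of the table-driven part of the insertion with a
level PER SCALE, summed over the scales — NOT PRINTED as parametrised) is SPLIT into printed STRUCTURE — `InsBlind` (the
step-`k` insertion reads only scales `< k`), `InsAffine` (§4) and `InsHomog` (real homogeneity of the table-driven part;
with `InsAffine`: ℝ-linearity, B13 (1.33)) — and the DISPLAYED SINGLE-SCALE TERM `InsScaleBound κ E₁ c ω` (a table supported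
on ONE scale `j < k` at ONE reference level `E₁` displaces the inserted history by `≤ c·ω^{k−1−j}·E₁` margins: the `j`-th
term of B13 (1.24) / p. 8, B12 (0.29)–(0.30), (3.54), BEFORE the sum over `j`) = the residual G-ne5p1-3a″; kernel:
`belowScale_eq_sum_sliceAt` (a table truncated below `k` is the sum of its scale slices), `insAffine_map_sum`,
`sizeDampedNat_of_scaleBoundLevel`, `insScaleBoundLevel_of_homog`, `sizeDampedNat_of_scaleBound`, and the closures
`ne5_of_stepModel_scaleLevel_near_nat` / `ne5_of_stepModel_scale_near_nat`.  (K2) §9 ANY SLOWER RATE / EXISTENCE OF A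
RATE: `ne5_at_of_recursiveRate`, `ne5_at_of_stepModel_near_nat` (inputs at rate `θ`, NE5 at every `θ′ ∈ [θ, 1]` with
`ω + Gc/(1 − ρ₀) < θ′`) and `exists_rate_of_stepModel_near_nat` (at an input rate `θ < 1`, room `ω + Gc/(1 − ρ₀) < 1` alone
yields some rate `θ′ < 1`) — the kernel form of the census sentences of NUMBERS (c)–(d).  (K3) §10: the toy scale-resolved
(`toy_insBlind`, `toy_insHomog`, `toy_insScaleBound`, `toy_sizeDampedNat_scale`, `toy_ne5Data_scale_near`), at the
slower rate 3/4 (`toy_ne5Data_at`) and with some rate by room (`toy_exists_rate`).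

FILE v5 (generation 6 of the seat, 2026-08-19; ADDITIVE — every file-v4 declaration byte-identical; header: this paragraph,
the §11–§12 entry of "What is PROVED", one DICTIONARY clause, NUMBERS (e), one clause of NOT COVERED, the provenance
sentence).  (K1) §11 LINE / FIBRE RESOLUTION of the one located input gap of node U3 in this typing (`OutputEnvelope`,
G-ne5p1-1′ ≡ G-ne5p2-3: JOINT analyticity of the data ↦ output map on the two-margin box): re-typed in the printed
ONE-PARAMETER form — `OpFibreEnvelope` / `HistFibreEnvelope` (analyticity + the one-run bound along complex affine
deformations of ONE input species within ITS margin, the other species fixed at admissible data; the printed Cauchy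
parameters s(Y₀), t_□, σ(Δ) of [II] p. 5 / p. 7, τ(Y) of [II] p. 15–16 and σ of [I] (3.54) p. 280 are of this kind) — and in
its CONSUMED form `DataLipschitz κ Λ ρ₀` (a two-point Lipschitz bound of the one-step output in MARGIN UNITS near admissible
data); kernel: `norm_sub_le_of_unitDisc` (one-variable Cauchy two-point bound on the unit disc), `opFibreEnvelope_of_outputEnvelope`
/ `histFibreEnvelope_of_outputEnvelope` (joint ⟹ fibrewise), `dataLipschitz_of_fibreEnvelopes` (fibrewise ⟹ Lipschitz with
`Λ = G/(1 − ρ₀)`: ONE unit-disc Cauchy estimate per species along the two legs operators-then-history — the difference "on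
one line" at a time of [King1986] p. 665), `recursiveRate_of_stepModel_lip` (the scale recursion CONSUMES ONLY
`DataLipschitz`: no analyticity, no envelope, no `ρ₀ < 1` among its hypotheses) and the closures `ne5_at_of_stepModel_lip_nat`,
`ne5_at_of_stepModel_fibre_scale_nat` (every wall of the route in its most primitive typed form).  (K2) §12 toys: the EXACT
modulus `Λ = 1` of the toy against Cauchy's `3/(1 − ρ₀)` (`toy_dataLipschitz`, `toy_dataLipschitz_cauchy`); NE5 constant
`31/30` against the true supremum `32/31` (`toy_ne5Data_lip`, `toyRate_div_pow`); the fibre chain jointly satisfiable at the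
slower rate 2/3 (`toy_ne5Data_fibre_at`).  Census consequence: NONE (NUMBERS (e): S-ν′ unchanged; the re-typed wall
G-ne5p1-1″ is NOT PRINTED either).

## The technique and its printed mechanism (CONTEXT, [R] = read on the ×2 journal-page renders by this seat; [analysis] =
## this seat's reading, not a quotation; the Bałaban papers are under adjudication and are quoted as context only)

One cluster-expansion functional produces the one-step outputs — [Balaban1988RG2Cluster] (2.13) p. 14: *"E^{(k+1)}(X) =
Σ_{n≥1} (1/n!) Σ_{(Z₁,…,Zₙ):∪Zᵢ=X} ρᵀ(Z₁,…,Zₙ) H(Z₁)…H(Zₙ)"*, *"In the rest of this section we will prove bounds and discuss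
analyticity properties of the functions (2.13)."* — read at the two runs' INPUT DATA.  OPERATOR data enter through bounds
only: p. 3 (1.5) *"In these equations we can replace the propagators by arbitrary operators having the same regularity
properties and satisfying the same bounds. Only these bounds were important in the analysis of Sect. C, E [15], hence the
solutions D, A₀ can be considered as functionals of these operators"*; the complex, non-symmetric perturbations of the
operators are controlled by (2.16)–(2.17) p. 16 (*"|R₁(b, b′)| ≤ (O(1)e^{−1/3δ₀M} + O(α₀ + α₁))exp(−½δ₀|b₋ − b′₋|)"*) — the
OPERATOR MARGIN `rOp`.  HISTORY data (the earlier actions) enter through the potentials: Lemma 1 p. 9 (1.33) *"The second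
expression in the fluctuation field action in (I.2.13) is represented as the sum E_k(U_k(exp iB′V^{(k)})) − E_k(U_k(V^{(k)})) =
Σ_{Y∈D_k} V′_k(Y, U_{k+1}, B)"* with (1.36) *"|V′_k(Y, U, J, B)| ≤ E₀ε₁C₁M^q exp C₂κ₁ exp(−(1 − 2δ)κd_k(Y))"*, Lemma 2 p. 11
(1.41)–(1.43); and in each term (2.14) p. 15 of an activity H(Z) the potentials appear in the factor
*"exp[Σ_{Y∈D} τ(Y)V_k(Y, B)]"* under *"Π_{Y∈D} ∫₀¹dt(Y) (1/2πi) ∫ dτ(Y)/(τ(Y) − t(Y))²"*, the τ(Y) running on the circles (2.18)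
p. 16 *"1/|τ(Y)| = E₀ε₁C₁α₄^{−1}M^q exp C₂κ₁ exp(−(1 − 3δ)κd_k(Y))"* (*"We assume that ⅛(κ₁ − 1) ≥ (1 − 3δ)κ, C₃ ≤ E₀C₁, and
q ≥ 8."*), bounded in (2.15) through *"Π_{Y∈D} 2/|τ(Y)|"* and *"exp[Σ_{Y∈D}|τ(Y)||V_k(Y, B)|]"*, the last by (2.20)
*"Σ_{Y∈D} |τ(Y)||V_k(Y, B)| ≤ … ≤ ½O(1)α₄Σ_{b⊂Y₀}|B(b)|² + O(1)α₄M^{−4}|Y₀|"*.  [analysis] Hence, for fixed operator data, each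
term — and by the convergence bounds the sums H(Z), E^{(k+1)}(X) — is an analytic function of the potential FAMILY
{V_k(Y, ·)}_Y on a polydisc whose radius at Y is the LEVEL of (1.36)/(1.43) itself (the circle radius |τ(Y)| is the inverse
of that level up to α₄): a RELATIVE margin O(1), uniform in k — the HISTORY MARGIN `rHist`; and the printed bounds use the
potentials only through (1.36), (1.43).  The resulting one-run bounds are Lemma 3 p. 20 *"Under all the above restrictions on
the constants M, κ, κ₁, α₀, α₁, α₄, α₆, γ₂, γ, ε₁, the activity H(Z) for a localization domain Z∈D_{k+1} satisfies the
inequality |H(Z)| ≤ C₃ε₁exp(−(1 − 8δ)½Lκd_{k+1}(Z)). (2.38)"* with *"C₃ = 2(L + 2)⁴O(1)2E₀C₁α₄^{−1}α₆^{−1}M^q exp C₂κ₁"*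
(p. 19: *"ε₂ = 2E₀ε₁C₁α₄^{−1}α₆^{−1}M^q exp C₂κ₁"*, *"We have used the assumption ε₂ ≤ 1"*; p. 20: *"assuming that
(L + 2)⁴O(1)ε₂ ≤ ½"*, *"Assuming that 2(L + 2)⁴O(1)ε₂ exp 5κ ≤ 1"*, *"Of course, we assume that ½(κ₁ − 1) ≥ 2Lκ."*), and
(2.41) p. 21 *"|E^{(k+1)}(X)| ≤ O(1)C₃ε₁exp(−(1 − 10δ)½Lκd_{k+1}(X))"*, *"Next, we assume that O(1)C₃ε₁ ≤ ½E₀."* — the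
ENVELOPE `G·e^{−κd(X)}` (G-ne5p1-1′ asks for exactly these two bounds on the slack box around admissible data; every
ingredient printed, the parametrised statement NOT PRINTED).  The insertion (1.33) is LINEAR in the family of earlier actions
and a scale-j action is damped at step k by irrelevance: p. 7 (1.24) factor (Lʲη)⁵, p. 8 *"This yields (6L)⁴Lʲη, and the sum
over j is bounded by 2(6L)⁴"*, p. 9 *"The first term under the exponential gives also the factor Lʲη, which controls the sum
over j."*; [Balaban1987RG1] p. 258 (0.27) *"and the first exponential can be bounded by an arbitrary positive power of Lʲη,
e.g. by (5!/κ⁵)(Lʲη)⁵"*, (0.29)–(0.30) (net (Lʲη)^α, α > 0, after the volume sums), p. 280 (3.54) *"Because |B| < O(1)Lʲη,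
e.g. |B| < α₁Lʲη, hence we have the required bound."* — [analysis] applied to the DIFFERENCE of the two runs' tables this is
the age-damped Lipschitz gain `c·ω^{k−j}` of `InsertionDamped` (ω = L^{−α}-type since Lʲη ≤ L^{j−k}); NOT PRINTED for
discrepancies (MI-3a).  The PRINTED MODEL of an η-rate obtained by swapping inputs is [King1986] p. 665 (PUBLISHED, outside
the audited series, U(1) Higgs, d = 2, 3): *"If we replace such a propagator in E_φ^{(k+n)}(H̃), the error is the same graph
with a difference or propagators on one line. Using the method presented, this error is bounded, and Proposition 3.8 gives
the desired factor L^{−γk}."* (Prop. 3.9 (3.73): the two-spacing propagator discrepancy with the factor CL^{−γk}).  The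
present module is the NON-PERTURBATIVE, TWO-SPECIES form of "swap the inputs": both input species are moved SIMULTANEOUSLY
along the complex line ζ ↦ d_B + ζ(d_A − d_B), which stays inside (operator margin) × (history margin) for |ζ| ≤ 1/ρ,
ρ = ‖Δop‖/rOp + ‖Δhist‖/rHist, and the one-variable Cauchy estimate `Dimock2015.norm_sub_le_div_of_bound_sphere` on that
disc gives `|ΔE| ≤ 4Gρ·e^{−κd}`: each species enters with (envelope) ÷ (ITS margin).

## What is PROVED (kernel; Mathlib + the three imported modules; no `sorry`, no `axiom`)

§1 [folklore] `line`, `line_mem_prod`, `norm_sub_le_of_line` (Φ complex differentiable on `closedBall x₀ r₁ ×ˢ closedBall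
y₀ r₂` in a product of complex normed spaces, values in a complex Banach space, ‖Φ‖ ≤ G there, ρ ≤ 1/2 ⟹
‖Φ(x₁, y₁) − Φ(x₀, y₀)‖ ≤ 2Gρ) and `norm_sub_le_of_two_margins` (second point in the box ⟹ ≤ 4Gρ for every ρ; the large-ρ
regime is the trivial bound).  §2 over `T4OutputRate.Carriers`: the structure `StepModel C Op Hist` (fields `Out, opA, opB,
insA, insB, Base, rOp, rHist`, margins positive); `tableA/B`, `dataA/B`, `box`; the Props `RepresentsA/B`, `InBase`,
`OutputEnvelope κ G`, `OperatorRate δ θ`, `InsertionRate κ E₀ δ′ θ`, `InsertionDamped κ c ω`; `insA_eq_of_agree_below`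
(damped ⟹ blind to scales ≥ k), `representsA_ext` (the recursion determines run A); `recursiveRate_of_stepModel`: the seven
hypotheses + `DecayBound EA W G κ`, `DecayBound EB W E₀ κ`, `E₀ ≤ G`, `0 ≤ ω` ⟹ `T4InputCauchyRate.RecursiveRate EA EB W κ θ ω
(4G(δ + δ′)) (4Gc)`; `ne5_of_stepModel`: additionally `0 ≤ G, δ + δ′, c` and the SMALLNESS `(1 + 4Gc)ω < θ` ⟹
`NE5 EA EB W κ θ (4G(δ + δ′)(θ − ω)/(θ − (1 + 4Gc)ω))` (by v1's `ne5_of_recursiveRate`, i.e. `T4BetaMemory.geom_row_sum`).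
§3 non-vacuity: on v1's `toyCarriers`, the model `toyModel` (`Out(o, h) = o + h`, operator data (1/2)^k vs 0, the SAME
insertion "read the previous scale with gain 1/64" for both runs, base class {o = 0, ‖h‖ ≤ 1}, unit margins) and the run
`toyEA₂(k) = (32/31)(1/2)^k − (1/31)(1/64)^k` (a GENUINE history feed: E_A(k) = (1/2)^k + E_A(k − 1)/64) satisfy all
hypotheses with G = E₀ = 3, δ = 1, δ′ = 0, θ = 1/2, c = 1, ω = 1/64, and `toy_ne5Data : NE5 toyEA₂ toyEB univ 0 (1/2) (372/19)`
(the constant written as the theorem produces it; `= 372/19` by `norm_num`).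
§4 (file v2, ADDITIVE) [folklore] the Props `InsAffine`, `InsLinear` (`insAffine_of_linear`), `SizeDamped κ c ω` (one-run
size bound with PER-SCALE levels on the table-driven part `insA t − insA 0`); `insertionDamped_of_affine : InsAffine →
SizeDamped κ c ω → InsertionDamped κ c ω` (the MI-3a split: SIZE → DISCREPANCY is structural for affine insertions);
`ne5_of_stepModel_affine`.  §5 [folklore] the printed age normalisation: `mul_sum_age_shift`, the Props `InsertionDampedNat
κ c ω`, `SizeDampedNat κ c ω` (weight `ω^{k−1−j}`: newest scale undamped), `insertionDampedNat_of_affine`,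
`insertionDamped_of_nat` / `sizeDamped_of_nat` (natural gain c at damping ω > 0 = model gain c/ω), `insertionDampedNat_mono`,
`ne5_of_stepModel_nat` (smallness `ω + 4Gc < θ`, constant `4G(δ + δ′)(θ − ω)/(θ − (ω + 4Gc))`),
`ne5_of_stepModel_affine_nat`.  §6 [folklore] the toy in structural form: `toy_insLinear`, `toy_insAffine`,
`toy_sizeDampedNat` (natural gain 1/64, damping 0: only the newest scale is read), `toy_insertionDampedNat`,
`toy_ne5Data_nat : NE5 toyEA₂ toyEB univ 0 (1/2) (… = 372/19)` (the same constant as `toy_ne5Data`, as it must be).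
§7 (file v3, ADDITIVE) [folklore] `sum_pow_age_le` (`Σ_{j<k} ω^{k−j} ≤ ω/(1 − ω)` for `0 ≤ ω < 1`);
`norm_sub_le_of_line_lt_one` (the §1 setting with `ρ < 1` ⟹ `‖Φ(x₁, y₁) − Φ(x₀, y₀)‖ ≤ Gρ/(1 − ρ)`) and
`norm_sub_le_of_line_near` (`ρ ≤ ρ₀ < 1` ⟹ `≤ (G/(1 − ρ₀))ρ`); `recursiveRate_of_stepModel_near`: the seven model hypotheses +
`DecayBound EA W EA₀ κ`, `DecayBound EB W E₀ κ` (run A's level decoupled from `G`, no `E₀ ≤ G`), `0 ≤ δ + δ′, θ, c, ω, B`,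
`θ ≤ 1`, `ω < 1`, `ρ₀ < 1`, the NEAR hypothesis `(δ + δ′)θ^{k₀} + c(EA₀ + E₀)ω/(1 − ω) ≤ ρ₀` and the first-scales bound
`EA₀ + E₀ ≤ Bθ^k (k < k₀)` ⟹ `RecursiveRate EA EB W κ θ ω (G(δ + δ′)/(1 − ρ₀) + B) (Gc/(1 − ρ₀))`; `ne5_of_stepModel_near`
(additionally `0 ≤ G` and the smallness `(1 + Gc/(1 − ρ₀))ω < θ` ⟹ NE5 with constant
`(G(δ + δ′)/(1 − ρ₀) + B)(θ − ω)/(θ − (1 + Gc/(1 − ρ₀))ω)`); `ne5_of_stepModel_near_nat` (natural gain `c` at damping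
`ω > 0`: near hypothesis `(δ + δ′)θ^{k₀} + c(EA₀ + E₀)/(1 − ω) ≤ ρ₀`, smallness `ω + Gc/(1 − ρ₀) < θ`, constant
`(G(δ + δ′)/(1 − ρ₀) + B)(θ − ω)/(θ − (ω + Gc/(1 − ρ₀)))`).  §8 [folklore] `toy_ne5Data_near : NE5 toyEA₂ toyEB univ 0 (1/2)
(… = 558/25)` (k₀ = 2, ρ₀ = 1/2, B = 12; the first-scales constant B is crude, the point is the threshold 7/64 < 13/64).
§9 (file v4, ADDITIVE) [folklore] `sliceAt`, `belowScale`, `belowScale_eq_sum_sliceAt` (`t·[scale < k] = Σ_{j<k} t·[scale = j]`);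
the Props `InsBlind`, `InsHomog`, `InsScaleBoundLevel κ c ω`, `InsScaleBound κ E₁ c ω`; `insBlind_of_affine_sizeDampedNat`
(the v2 shapes contained blindness), `insAffine_additive`, `insAffine_map_sum`; `sizeDampedNat_of_scaleBoundLevel :
InsAffine → InsBlind → InsScaleBoundLevel κ c ω → SizeDampedNat κ c ω` (no sign condition on `c`, `ω`);
`insScaleBoundLevel_of_homog : InsHomog → InsScaleBound κ E₁ c ω → 0 < E₁ → InsScaleBoundLevel κ c ω`;
`sizeDampedNat_of_scaleBound`; `ne5_of_stepModel_scaleLevel_near_nat`, `ne5_of_stepModel_scale_near_nat` (the hypotheses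
of `ne5_of_stepModel_near_nat` with `InsertionDampedNat` replaced by the structural shapes + the single-scale term; same
smallness `ω + Gc/(1 − ρ₀) < θ`, same constant); `ne5_at_of_recursiveRate` (`RecursiveRate` at rate `θ`, `0 ≤ A, b, ω, θ`,
`θ ≤ θ′`, `(1 + b)ω < θ′` ⟹ NE5 at `θ′` with constant `A(θ′ − ω)/(θ′ − (1 + b)ω)`), `ne5_at_of_stepModel_near_nat`
(`θ ≤ θ′ ≤ 1`, smallness `ω + Gc/(1 − ρ₀) < θ′`), `exists_rate_of_stepModel_near_nat` (`θ < 1` and `ω + Gc/(1 − ρ₀) < 1`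
⟹ `∃ θ′ < 1, ∃ C₅, NE5 EA EB W κ θ′ C₅`).  §10 [folklore] `toy_insBlind`, `toy_insHomog`, `toy_insScaleBound` (reference
level 3, natural gain 1/64, every `ω ≥ 0`), `toy_insScaleBoundLevel`, `toy_sizeDampedNat_scale` (`SizeDampedNat univ 0
(1/64) (1/64)` by scale resolution), `toy_ne5Data_scale_near : NE5 toyEA₂ toyEB univ 0 (1/2) (… = 558/25)`,
`toy_ne5Data_at : NE5 toyEA₂ toyEB univ 0 (3/4) (… = 846/41)` (inputs at rate 1/2), `toy_exists_rate`.
§11 (file v5, ADDITIVE) [folklore] `norm_sub_le_of_unitDisc` (`f : ℂ → F` complex differentiable on the closed unit disc,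
`‖f‖ ≤ G` there, `0 ≤ ρ < 1` ⟹ `‖f ρ − f 0‖ ≤ Gρ/(1 − ρ)`; `Dimock2015.norm_sub_le_div_of_bound_sphere` on the disc of radius
`1/ρ`), `norm_sub_le_of_unitDisc_near` (`ρ ≤ ρ₀ < 1` ⟹ `≤ (G/(1 − ρ₀))ρ`); the Props `OpFibreEnvelope κ G`, `HistFibreEnvelope
κ G`, `DataLipschitz κ Λ ρ₀`; `opFibreEnvelope_of_outputEnvelope`, `histFibreEnvelope_of_outputEnvelope` (joint ⟹ fibrewise:
coordinate lines stay in the box); `dataLipschitz_of_fibreEnvelopes : OpFibreEnvelope κ G → HistFibreEnvelope κ G → ρ₀ < 1 →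
DataLipschitz κ (G/(1 − ρ₀)) ρ₀`, `dataLipschitz_of_outputEnvelope`; `recursiveRate_of_stepModel_lip` (the hypotheses of
`recursiveRate_of_stepModel_near` with `OutputEnvelope κ G` REPLACED by `DataLipschitz κ Λ ρ₀` + `0 ≤ Λ` and WITHOUT
`ρ₀ < 1` ⟹ `RecursiveRate EA EB W κ θ ω (Λ(δ + δ′) + B) (Λc)`); `ne5_at_of_stepModel_lip_nat` (natural gain `c` at damping
`ω > 0`, `θ ≤ θ′ ≤ 1`, near hypothesis `(δ + δ′)θ^{k₀} + c(EA₀ + E₀)/(1 − ω) ≤ ρ₀`, smallness `ω + Λc < θ′` ⟹ NE5 at `θ′`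
with constant `(Λ(δ + δ′) + B)(θ′ − ω)/(θ′ − (ω + Λc))`); `ne5_at_of_stepModel_fibre_scale_nat` (the two fibre envelopes
+ `InsAffine`, `InsBlind`, `InsHomog`, `InsScaleBound κ E₁ c ω` + `OperatorRate`, `InsertionRate` — every wall in its most
primitive typed form; `Λ = G/(1 − ρ₀)`, the smallness and constant of `ne5_at_of_stepModel_near_nat`).  §12 [folklore]
`toy_opFibreEnvelope`, `toy_histFibreEnvelope` (`G = 3`), `toy_dataLipschitz_cauchy` (`Λ = 3/(1 − ρ₀)` by Cauchy),
`toy_dataLipschitz` (the EXACT modulus `Λ = 1` of `o + h`, every reach `ρ₀`), `toy_ne5Data_lip : NE5 toyEA₂ toyEB univ 0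
(1/2) (… = 31/30)` (`ρ₀ = 2`, `k₀ = 0`, `B = 0`: with the exact modulus no near regime and no first-scales constant is
needed), `toyRate_div_pow` (the true ratio `32/31 − (1/31)(1/32)^k`), `toy_ne5Data_fibre_at : NE5 toyEA₂ toyEB univ 0 (2/3)
(… = 2250/107)` (the fibre chain, inputs at rate 1/2).

## DICTIONARY model ↔ printed objects, and the typed MISSING INEQUALITIES (cell record `t4/T4-EST-NE5-P1.md` §7–§9)

`Out k o h X` ↔ (2.13)–(2.14) read as a function of the step's operator data `o` (H, G̃, H₀ of (1.3)–(1.5) p. 2–3; C^{(k)},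
(C^{(k)})^{1/2}, Δ_k of (2.5)–(2.6) p. 12–13; averaging/minimiser data; kernel norms (1.7) p. 3) and of the inserted history
`h` (the potential family {V′(Y, ·), V(Y, ·)}_Y of (1.33)/(1.41) in the weighted sup norm over the COMPLEX spaces (1.34) — so
`BgB` must be instantiated with the complex analyticity space for the induction to close, MI-3 typing remark of v1).  [analysis]
That BOTH runs are evaluations of ONE map `Out k` is the MODEL: in print the steps at two lattice spacings are the same
formulas over different lattices, and every η-dependence (lattice operators, torus period in lattice units, minimisers,
averaging operators) has to be placed in the DATA (o, h) by an instantiation; an η-dependence of the formula not expressible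
as data inside the margins is outside this module (census item (vi) of the record).  `insA`, `insB` ↔ the runs' OWN
re-expression of their earlier actions as potentials ((1.33): through U_k(·), exp iB′; B14 (2.25) p. 259).  `Base k g U` ↔ the
printed one-run class (operators with the bounds (1.7)/(2.16), potentials obeying (1.36)/(1.43), the restrictions of
p. 16–20).  `rOp k` ↔ (2.16)–(2.17) (how far a complex operator perturbation may go with the bounds intact) — MI-2 of v1;
`rHist k` ↔ [analysis] the (1.36)/(1.43) level ((2.18)/(2.20): relative margin O(1)).  `OutputEnvelope κ G` ↔ Lemma 3 (2.38) +
(2.41) re-run on the slack box — G ↔ O(1)C₃ε₁ ≤ ½E₀, e^{−κd} ↔ exp(−(1 − 10δ)½Lκd_{k+1}) — NOT PRINTED as parametrised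
(G-ne5p1-1′ = MI-3b).  `OperatorRate δ θ` ↔ the two-spacing rate of the runs' OPERATOR DATA at the COMMON transported
background, in MARGIN units = node U1a's NE2/NE2⁺ (unit-lattice forms/covariances (2.5)–(2.6), (2.15)–(2.17); propagators
(1.3)–(1.7) at the canonical background pair) — NOT PRINTED (MI-1 = G-ne5p1-2, RE-BOOKED by the interface cross-read
C-ne5p1-2 of unit pv25-g10, tree `T4OperatorRateLiaison`: NE3 (node U1b) enters this binder ONLY under an instantiation
reading the operators at the runs' own minimisers, via a Lipschitz split, and otherwise feeds `InsertionRate`; file v1/v2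
of this docstring said "↔ NE3 (node U1b)"; King (3.73) is the printed model of such a rate, d ≤ 3, U(1)).
`InsertionRate κ E₀ δ′ θ` ↔ the η-dependence of the re-expression maps at a common table (NE2/NE3-type: minimisers and
averaging operators; may route through `T4OutputRate.LipBackground × BackgroundsClose`) — NOT PRINTED (G-ne5p1-4).  `InsertionDamped κ
c ω` ↔ linearity of (1.33) + the (Lʲη)-power of (1.24)/(0.27)/(0.29)–(0.30)/(3.54) applied to the difference table — NOT
PRINTED for discrepancies (MI-3a); the MARGINAL (β-function) channel has no damping and is NOT in this shape: the coupling
sequence g is COMMON to both runs (node U2 / NE4; MI-4).  (file v4) `InsBlind` ↔ the causality of (1.33)/(1.41) (the fluctuation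
action of the step is assembled from the EARLIER actions only); `InsHomog` ↔ the ℝ-linearity of (1.33) in E_k; `InsScaleBound
κ E₁ c ω` ↔ the `j`-th term of the printed one-run sums ((1.24) p. 7 / p. 8 of [II]; (0.29)–(0.30) p. 258, (3.54) p. 280 of
[I]) at the inductive level `E₁ = E₀`, in margin units — NOT PRINTED as a statement about arbitrary single-scale tables
(G-ne5p1-3a″); the passage "one scale at one level → all scales at all levels" (`SizeDampedNat`, G-ne5p1-3a′) is kernel (§9).
(file v5) `OpFibreEnvelope κ G` ↔ the s(Y₀)/σ(Δ)-analyticity of p. 5 / p. 7 of [II] — complex ONE-PARAMETER deformations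
of the step's OPERATORS under which the constructions stay analytic with their bounds ((1.5) p. 3: the step is a functional
of its operators through their bounds) — read along margin-bounded affine deformations of the operator data; `HistFibreEnvelope
κ G` ↔ the τ(Y)-analyticity of (2.14)–(2.15) p. 15 on the circles (2.18) p. 16 (a complex scaling per potential) read along
affine deformations of the inserted history within the budget, and [I] (3.54) p. 280 (the background moved along one
direction B with a circle parameter σ) — BOTH NOT PRINTED as parametrised statements (together: G-ne5p1-1″, the fibre form of
G-ne5p1-1′; a printed proof re-read with substituted deformations); `DataLipschitz κ Λ ρ₀` ↔ NOTHING printed — it is the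
CONSUMED form (two runs' data, one step; (2.41) p. 21 bounds one run): what any discharge of G-ne5p1-1′/1″ must hand to
the recursion, `Λ ↔ G(λ)/(1 − ρ₀)` on the Cauchy route (NUMBERS (e)).
Numbers: the section NUMBERS (file v2) below; the v1 sentence that stood here («the history gain b = 4Gc is O(1) …
NOT small; … `L^{α − a} > 1 + b` … no condition on ε₁ beyond the printed restrictions») is WITHDRAWN (it read c at the
natural scale inside the model-normalised threshold and took the printed new-term ratio O(1)C₃ε₁/E₀ ≤ ½ as pinned).

## NUMBERS (file v2): age normalisation, the natural history gain, the load-bearing smallness — [analysis] over the [R]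
## loci below; SUPERSEDES the v1 "Numbers" sentence (cell record `t4/T4-EST-NE5-P1.md` v3 §10)

(a) AGE NORMALISATION.  In print the NEWEST previous action enters the fluctuation action of the next step UNDAMPED:
[Balaban1988RG2Cluster] p. 8 [R] *"This yields (6L)⁴Lʲη, and the sum over j is bounded by 2(6L)⁴"* (Σ_{j≤k} Lʲη, the
term j = k has Lᵏη = 1) and [Balaban1987RG1] (0.30) p. 258 [R] *"Σ_{j=1}^{k}O(1)(Lʲη)^α M^{−4}|T₁^{(k)}| ≤
O(1)(1−L^{−α})^{−1}M^{−4}|T₁^{(k)}|"*.  In the model `Out k` creates the scale-`k` outputs from the scales `< k`, the newest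
scale read is `j = k − 1`, and `InsertionDamped κ c ω` weights it `ω^{k−j} = ω¹`: the model's `c` is the NATURAL gain `c♮`
(history margins per unit NEWEST-scale table discrepancy) DIVIDED by ω, and `(1 + 4Gc)ω < θ` is `ω + 4Gc♮ < θ` (§5:
`InsertionDampedNat` with weight `ω^{k−1−j}`, `insertionDamped_of_nat`, `ne5_of_stepModel_nat`).  The homogeneous
recursion `D_k = 4Gc♮·Σ_{j<k} ω^{k−1−j}D_j` is exactly geometric with ratio `ω + 4Gc♮`, so the threshold is SHARP for the
sum-form budget `RecursiveRate`.
(b) THE NATURAL GAIN.  Write `rHist = (λ − 1)·ℓ`, ℓ = the norm of a history at the printed level (1.36)/(1.43), λ > 1 the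
admissible complex scaling of the potential family; by affinity (§4 `InsAffine`) a newest-scale table discrepancy of
relative size D/E₀ displaces the history by ≤ (D/E₀)·ℓ [the one-run size bound with a substituted level, `SizeDampedNat`;
NOT PRINTED as parametrised], so `c♮ ≤ 1/((λ − 1)E₀)`, while G = G(λ) is the envelope over histories of norm ≤ λℓ.  The
potentials enter (2.14) p. 15 [R] as `τ(Y)V_k(Y, B)` with the Cauchy factors *"Π_{Y∈D} 2/|τ(Y)|"* of (2.15) p. 15 [R] on
the circles (2.18) p. 16 [R] *"1/|τ(Y)| = E₀ε₁C₁α₄^{−1}M^q exp C₂κ₁ exp(−(1 − 3δ)κd_k(Y))"*, chosen so that (2.20) [R]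
follows from (1.36)/(1.43); scaling the potential family by λ shrinks the admissible circles by λ and multiplies each factor
2/|τ(Y)| by λ, i.e. `ε₂ ↦ λε₂` in (2.26)–(2.38) (p. 19 [R] *"ε₂ = 2E₀ε₁C₁α₄^{−1}α₆^{−1}M^q exp C₂κ₁"*); the convergence
conditions p. 20 [R] *"assuming that (L + 2)⁴O(1)ε₂ ≤ ½"*, *"Assuming that 2(L + 2)⁴O(1)ε₂ exp 5κ ≤ 1"* then hold with λε₂
iff `λ ≤ λ_max := (2(L + 2)⁴O(1)ε₂e^{5κ})^{−1}` (≥ 1 by the printed restriction; large when ε₂ is smaller than required);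
every activity carries at least one factor ε₂ (p. 20 [R] *"The sum over n ≥ 1 is now bounded by 2(L + 2)⁴O(1)ε₂"*) and
*"C₃ = 2(L + 2)⁴O(1)2E₀C₁α₄^{−1}α₆^{−1}M^q exp C₂κ₁"* (p. 20 [R]; C₃ε₁ = 2(L + 2)⁴O(1)ε₂) is LINEAR in ε₂, so (2.41) p. 21
[R] re-run at λε₂ gives `G(λ) ≤ λ·O(1)C₃ε₁` [the printed proof with a substituted parameter; NOT PRINTED as such — part of
MI-3b].  Hence `4Gc♮ ≤ K·ν`, `K = 4λ/(λ − 1)`, `ν := O(1)C₃ε₁/E₀ = 4(L + 2)⁴O(1)·O(1)·ε₁C₁α₄^{−1}α₆^{−1}M^q e^{C₂κ₁}` —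
E₀-FREE and PROPORTIONAL TO ε₁; print restricts ν only by p. 21 [R] *"Next, we assume that O(1)C₃ε₁ ≤ ½E₀."* (ν ≤ ½: the
closing of (I.1.18) *"with ½E₀ instead of E₀"*).
(c) THE LOAD-BEARING SMALLNESS of this route is therefore `ω + Kν < θ`, K ∈ [1, 4.4]: K ≤ 4.4 for λ = 11 ≤ λ_max (i.e.
once 22(L + 2)⁴O(1)ε₂e^{5κ} ≤ 1) with the kernel's constant 4 (= 2 from `norm_sub_le_of_line` at ρ ≤ ½ × 2 from merging the
two regimes in `recursiveRate_of_stepModel`; the near-regime history coefficient is 2Gc and the optimal Cauchy geometry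
ρ → 0, λ → λ_max gives K → 1 asymptotically in k — not implemented).  With θ = L^{−a} and ω = L^{−ᾱ}, ᾱ = min(1, α) (α > 0
of [Balaban1987RG1] (0.29), printed only as "α > 0"; the (1.24) channel has exponent 1): `a < ᾱ` AND
`ν < (L^{−a} − L^{−ᾱ})/K`.  B13's ν ≤ ½ meets this only for K → 1 and a < log_L(2/(1 + 2L^{−ᾱ})) (≈ 0.2 at L = 16, ᾱ = 1);
a rate exponent comparable to ᾱ needs ν smaller than B13's by the factor ≈ 2(L^{−a} − L^{−ᾱ})/K — an ADDITIONAL restriction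
on ε₁ of the PRINTED KIND ([Balaban1987RG1] p. 280 [R] *"This differentiation yields a factor O(1)α₂^{−1}ε₁, and taking ε₁
sufficiently small we can get the required constant."*), which propagates to the admissible couplings through (1.34) p. 9
[R] *"{B: |B| < ε₁g_k^{−1} on Y}"* and the large-field factor *"exp(−½γ₂(ε₁²/g_k²)|P|)"* of (2.26) p. 17 [R] (smaller ε₁ ⇒
smaller g_k along the whole trajectory).  By `T4InputCauchyRate.recursiveRate_mono_rate` the NE5 rate delivered is
`max(θ_op, ω + Kν + slack)` (θ_op = the rate of `OperatorRate`/`InsertionRate`, i.e. of NE2⁺/NE3).  The v1 reading (b♮ ≈ 2 "O(1), cannot be made small", threshold `L^{ᾱ − a} > 1 + b`) is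
WITHDRAWN: with b♮ = 2 the recursion has NO rate (ratio ω + 2 > 1), and ν is not pinned.  The sibling activity-level
recursion of seat P2 (`RecursiveRate EA EB W κ θ ω (4A(δ + δ′)) (4Ac)`) has the same structure and the same reading of
its `c`.
(d) (file v3) THE NEAR-REGIME CONSTANT.  [analysis] The factor 4 in (c) is the kernel's, not the problem's: §7 replaces the
uniform `4G` by `G/(1 − ρ₀)`, ρ₀ < 1 an A-PRIORI bound on the relative displacement of the two runs' data from a scale k₀
on.  In the bookkeeping of (b) the history part of ρ₀ is `c♮(Ē_A + Ē_B)/(1 − ω)`, where Ē_A, Ē_B are the two runs'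
OUTPUT levels (the constants of the hypotheses `hdA`, `hdB` of §7; in print each run's outputs obey (2.41) p. 21 [R], i.e.
Ē = O(1)C₃ε₁ = νE₀, one run at a time) and `c♮ ≤ 1/((λ − 1)E₀)` (E₀ = the printed inductive level, as in (b)): history part
`≤ 2ν/((λ − 1)(1 − ω))` (= 0.107 at ν = ½, λ = 11, ω = 1/16); the operator part `(δ + δ′)θ^{k₀}` is made small by the
choice of k₀, and the first scales k < k₀ cost the constant B = (Ē_A + Ē_B)θ^{−k₀}, never the rate.
Hence `Gc♮/(1 − ρ₀) ≤ K′ν`, `K′ = λ/((λ − 1)(1 − ρ₀))` (≈ 1.23 at λ = 11; → 1 as λ → ∞, ρ₀ → 0), and the load-bearing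
smallness of (c) reads `ω + K′ν < θ` with K′ ∈ (1, 1.3] (λ ≥ 11) in place of K ∈ [1, 4.4].  CONSEQUENCE: B13's own printed
restriction ν ≤ ½ (p. 21 [R] *"Next, we assume that O(1)C₃ε₁ ≤ ½E₀."*) yields SOME positive rate exponent as soon as the
history-box scaling has room, `ω + K′/2 < 1`, i.e. λ ≳ 5 at L = 16 (a(λ) = log_L(1/(ω + K′ν)) ≈ 0.03 at λ = 5, ≈ 0.14 at
λ = 11, → log_L(2/(1 + 2L^{−ᾱ})) ≈ 0.21 — the K → 1 value announced in (c)); λ ≤ λ_max = (2(L + 2)⁴O(1)ε₂e^{5κ})^{−1} is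
the convergence condition of p. 20 [R] *"Assuming that 2(L + 2)⁴O(1)ε₂ exp 5κ ≤ 1"* strengthened by the constant factor
λ (ε₂ ∝ ε₁: again a restriction of the printed kind, on a printed-unspecified O(1)).  So with the near-regime kernel the
ε₁-restriction of S-ν SIZES the exponent (an `a` comparable to ᾱ still needs ν well below ½, exactly as in (c) with K′
for K); it no longer conditions the EXISTENCE of a rate.  Everything in (d) is constant-tracking over the [R] loci of
(b)–(c) under the hypothesis shapes of §2 — nothing of it is printed as such (cell record §13, smallness S-ν′).
(e) (file v5) THE CONSUMED CURRENCY.  [analysis] The recursion of §2/§7 uses the output envelope ONLY through the two-point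
bound `‖Out(d_A) − Out(d_B)‖ ≤ Λ·ρ·e^{−κd}` for data within relative reach ρ₀ of admissible data, ρ = the relative
displacement in margin units (`DataLipschitz`, §11): `recursiveRate_of_stepModel_lip` has no analyticity, no envelope and no
`ρ₀ < 1` among its hypotheses, and the load-bearing smallness reads `ω + Λc♮ < θ′` — `Λc♮` = the Lipschitz modulus of the
one-step output with respect to the NEWEST previous action (output change, in units of `e^{−κd}`, per unit newest-scale
table discrepancy), a dimensionless number print does not provide (NOT PRINTED; it is not (2.41), which bounds ONE run).
The Cauchy route of (b)–(d) is one way to obtain it: `Λ ≤ G(λ)/(1 − ρ₀)` from fibrewise analyticity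
(`dataLipschitz_of_fibreEnvelopes`), whence `Λc♮ ≤ K′ν` exactly as in (d) — the census line S-ν′ is UNCHANGED by this
reformulation.  The factor `1/(1 − ρ₀)` of (d) (and the `4` of (c)) is the price of converting a SUP bound into a Lipschitz
modulus by the Cauchy estimate, not a feature of the problem: on the §12 toy the exact modulus is `Λ = 1` while Cauchy gives
`3/(1 − ρ₀) = 6`, and the NE5 constant drops from `558/25` (`toy_ne5Data_near`) to `31/30` (`toy_ne5Data_lip`) against the
true supremum `32/31` of `|E_A(k) − E_B(k)|/θ^k` (`toyRate_div_pow`).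

NOT COVERED.  No functional of Bałaban's is constructed, factorised as `Out ∘ (op, ins)`, or shown analytic in anything; no
operator discrepancy (NE2/NE2⁺-type, MI-1), no insertion rate (NE2/NE3-type, G-ne5p1-4), no damping constant, no margin is
derived; no Lipschitz modulus Λ of any actual step map is derived and no fibrewise analyticity is shown (file v5,
G-ne5p1-1″); the boundary/R-terms
member (B14 (2.40)–(2.42), B16 (1.99)) is the sibling module `T4BoundaryCarrier`/seat P3 and is not touched; the
analytic-in-g branch (p. 266 of [I]) is not used; v1 `T4InputCauchyRate` is imported BY NAME and not modified.

CITATION HEADER (lean-in-tree rule 2026-08-18).  T. Bałaban, *Renormalization group approach to lattice gauge field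
theories. II. Cluster expansions*, Commun. Math. Phys. **116**, 1–22 (1988) [Balaban1988RG2Cluster] (cell paper B13 = [II];
held `paper:balaban1988-cmp116-rg-ii-cluster`, journal page = PDF page; renders `b2b-balaban-ref1/pages/1988-cmp116-rg-II-
cluster/…-pNNN-x2.png`, p. 2–3, 5–9, 11–22 read as images by this lineage, p. 9, 11, 14–21 re-read by this seat); T. Bałaban,
*Renormalization group approach to lattice gauge field theories. I*, Commun. Math. Phys. **109**, 249–301 (1987)
[Balaban1987RG1] (B12 = [I]; journal page = PDF page + 248; renders p010, p014, p015, p032); T. Bałaban, *Convergent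
renormalization expansions for lattice gauge theories*, Commun. Math. Phys. **119**, 243–285 (1988) [Balaban1988Convergent]
(B14 = [III]; journal page = PDF page + 242; render p017); C. King, *The U(1) Higgs model. I. The continuum limit*, Commun.
Math. Phys. **102**, 649–677 (1986) [King1986] (PUBLISHED, outside the audited series; render `b2b-balaban-template/king-
renders/1986-cmp102-king-u1-higgs-I-p017-x2.png` = p. 665).  What is reproduced: NOTHING of the papers' mathematics — only
folklore complex analysis (Cauchy estimate on the interpolating line with two margins), real bookkeeping and a toy; the
quotations above are context.  NEW module of unit `b2b-balaban-t4-ne5-p1` (T⁴ fan-out prover P1 for NE5, generation 2;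
journal claim T4-U3.E-NE5-PROVE-P1-v2 2026-08-19T07:36:27Z; file v2 = ADDITIVE §4–§6 + DOCFIX, generation 3, journal
claim T4-U3.E-NE5-PROVE-P1-v3 2026-08-19T08:38:58Z, renders p. 15, 16, 20 re-read as images by generation 3; file v2.1 =
DOCFIX only: the booking of `OperatorRate` (MI-1) re-labelled NE3 → NE2/NE2⁺-at-the-common-background after the interface
cross-read C-ne5p1-2 — no declaration touched; file v3 = ADDITIVE §7–§8 (the near regime: exact Cauchy constant,
a-priori near regime, toy), generation 4, journal claim T4-U3.E-NE5-PROVE-P1-v4 2026-08-19T09:31:57Z, no page re-read, no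
new quotation; file v4 = ADDITIVE §9–§10 (scale resolution of the size bound; NE5 at any slower rate; existence of a rate
by room; toys) + the DOCFIX «1.23», generation 5, journal claim T4-U3.E-NE5-PROVE-P1-v5 2026-08-19T10:12:30Z, no page
re-read, one display of [I] newly quoted in a docstring ((0.29) p. 258, render p010 already read as image by this lineage,
loci file `t4/b2b-balaban-t4-ne5-p1/b13-loci.md` v1.2); file v5 = ADDITIVE §11–§12 (line/fibre resolution of the
output envelope: the printed one-parameter form and the consumed data-Lipschitz form; toys), generation 6, journal
claim T4-U3.E-NE5-PROVE-P1-v6 2026-08-19T11:04:43Z, no page re-read; the [R] strings newly placed in the §11 docstring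
([II] p. 3, 5, 7, 15; [I] (3.54) p. 280) are copied from the loci file v1.3, their renders ([II] p003, p005, p007,
p015; [I] p032) already read as images by this lineage); imports `Dimock2015.AnalyticLipschitz`
(`norm_sub_le_div_of_bound_sphere`), `T4OutputRate` (carriers, `NE5`, `DecayBound`) and `T4InputCauchyRate` (`RecursiveRate`,
`ne5_of_recursiveRate`, `toyCarriers`, `toyEB`) BY NAME and modifies nothing.
-/

noncomputable section

open Metric Set Finset

namespace Literature.MathematicalPhysics.QuantumFieldTheory.Balaban1983to89.T4InputCauchyRateData

open Literature.MathematicalPhysics.QuantumFieldTheory.Dimock2015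
open Literature.MathematicalPhysics.QuantumFieldTheory.Balaban1983to89.T4OutputRate
open Literature.MathematicalPhysics.QuantumFieldTheory.Balaban1983to89.T4InputCauchyRate

/-! ## §1 The two-margin Cauchy rate on the interpolating line (pure complex analysis) -/

section Line

variable {E₁ E₂ F : Type*} [NormedAddCommGroup E₁] [NormedSpace ℂ E₁] [NormedAddCommGroup E₂] [NormedSpace ℂ E₂]
  [NormedAddCommGroup F] [NormedSpace ℂ F]

/-- The complex line through the two data points `(x₀, y₀)` (at `ζ = 0`) and `(x₁, y₁)` (at `ζ = 1`). [folklore] -/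
def line (x₀ x₁ : E₁) (y₀ y₁ : E₂) (ζ : ℂ) : E₁ × E₂ := (x₀ + ζ • (x₁ - x₀), y₀ + ζ • (y₁ - y₀))

/-- The line starts at the first data point. [folklore] -/
theorem line_zero (x₀ x₁ : E₁) (y₀ y₁ : E₂) : line x₀ x₁ y₀ y₁ 0 = (x₀, y₀) := by simp [line]

/-- The line reaches the second data point at `ζ = 1`. [folklore] -/
theorem line_one (x₀ x₁ : E₁) (y₀ y₁ : E₂) : line x₀ x₁ y₀ y₁ 1 = (x₁, y₁) := by simp [line]

/-- The line is an entire (affine) map. [folklore] -/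
theorem differentiable_line (x₀ x₁ : E₁) (y₀ y₁ : E₂) : Differentiable ℂ (line x₀ x₁ y₀ y₁) := by
  unfold line; fun_prop

/-- The line stays in the two-margin box `closedBall x₀ r₁ ×ˢ closedBall y₀ r₂` for `|ζ| ≤ R` as soon as
`R‖x₁ − x₀‖ ≤ r₁` and `R‖y₁ − y₀‖ ≤ r₂`. [folklore] -/
theorem line_mem_prod {x₀ x₁ : E₁} {y₀ y₁ : E₂} {R r₁ r₂ : ℝ} (hx : R * ‖x₁ - x₀‖ ≤ r₁) (hy : R * ‖y₁ - y₀‖ ≤ r₂)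
    {ζ : ℂ} (hζ : ζ ∈ closedBall (0 : ℂ) R) : line x₀ x₁ y₀ y₁ ζ ∈ closedBall x₀ r₁ ×ˢ closedBall y₀ r₂ := by
  rw [mem_closedBall, dist_zero_right] at hζ
  refine ⟨?_, ?_⟩
  · rw [mem_closedBall, dist_eq_norm]
    simp only [line, add_sub_cancel_left, norm_smul]
    exact (mul_le_mul_of_nonneg_right hζ (norm_nonneg _)).trans hx
  · rw [mem_closedBall, dist_eq_norm]
    simp only [line, add_sub_cancel_left, norm_smul]
    exact (mul_le_mul_of_nonneg_right hζ (norm_nonneg _)).trans hy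

/-- **TWO-MARGIN CAUCHY RATE ON THE INTERPOLATING LINE, small-discrepancy regime.**  `Φ` complex differentiable on the
box `closedBall x₀ r₁ ×ˢ closedBall y₀ r₂` of a product of complex normed spaces, `‖Φ‖ ≤ G` there, and the RELATIVE
discrepancy `ρ = ‖x₁ − x₀‖/r₁ + ‖y₁ − y₀‖/r₂ ≤ 1/2`: then the line through the two points stays in the box for
`|ζ| ≤ 1/ρ ≥ 2`, and the one-variable Cauchy estimate (`Dimock2015.norm_sub_le_div_of_bound_sphere`, radius `1/ρ`)
gives `‖Φ(x₁, y₁) − Φ(x₀, y₀)‖ ≤ G/(1/ρ − 1) ≤ 2Gρ`. [folklore] -/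
theorem norm_sub_le_of_line [CompleteSpace F] {Φ : E₁ × E₂ → F} {x₀ x₁ : E₁} {y₀ y₁ : E₂} {r₁ r₂ G : ℝ}
    (hr₁ : 0 < r₁) (hr₂ : 0 < r₂) (hΦ : DifferentiableOn ℂ Φ (closedBall x₀ r₁ ×ˢ closedBall y₀ r₂))
    (hG : ∀ z ∈ closedBall x₀ r₁ ×ˢ closedBall y₀ r₂, ‖Φ z‖ ≤ G)
    (hρ : ‖x₁ - x₀‖ / r₁ + ‖y₁ - y₀‖ / r₂ ≤ 1 / 2) :
    ‖Φ (x₁, y₁) - Φ (x₀, y₀)‖ ≤ 2 * G * (‖x₁ - x₀‖ / r₁ + ‖y₁ - y₀‖ / r₂) := by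
  set ρ := ‖x₁ - x₀‖ / r₁ + ‖y₁ - y₀‖ / r₂ with hρ_def
  have hG0 : 0 ≤ G := (norm_nonneg _).trans (hG (x₀, y₀) ⟨mem_closedBall_self hr₁.le, mem_closedBall_self hr₂.le⟩)
  have ha : 0 ≤ ‖x₁ - x₀‖ / r₁ := by positivity
  have hb : 0 ≤ ‖y₁ - y₀‖ / r₂ := by positivity
  have hρ0 : 0 ≤ ρ := add_nonneg ha hb
  have h1 : ‖x₁ - x₀‖ / r₁ ≤ ρ := le_add_of_nonneg_right hb
  have h2 : ‖y₁ - y₀‖ / r₂ ≤ ρ := le_add_of_nonneg_left ha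
  rcases hρ0.eq_or_lt with hzero | hpos
  · -- ρ = 0: the two data points coincide
    have hx0 : ‖x₁ - x₀‖ / r₁ = 0 := le_antisymm (hzero ▸ h1) ha
    have hy0 : ‖y₁ - y₀‖ / r₂ = 0 := le_antisymm (hzero ▸ h2) hb
    rw [div_eq_zero_iff, norm_eq_zero, sub_eq_zero] at hx0 hy0
    rcases hx0 with hx0 | hx0
    · rcases hy0 with hy0 | hy0
      · subst hx0; subst hy0
        simp only [sub_self, norm_zero]
        positivity
      · exact absurd hy0 hr₂.ne'
    · exact absurd hx0 hr₁.ne'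
  · -- 0 < ρ ≤ 1/2: Cauchy on the circle of radius 1/ρ
    set R := 1 / ρ with hR_def
    have hρR : ρ * R = 1 := by rw [hR_def]; field_simp
    have hR2 : 2 ≤ R := by
      rw [hR_def, le_div_iff₀ hpos]; linarith
    have hR1 : 1 < R := by linarith
    have hxR : R * ‖x₁ - x₀‖ ≤ r₁ := by
      have : ‖x₁ - x₀‖ ≤ ρ * r₁ := by rwa [div_le_iff₀ hr₁] at h1
      calc R * ‖x₁ - x₀‖ ≤ R * (ρ * r₁) := mul_le_mul_of_nonneg_left this (by positivity)
        _ = r₁ := by rw [← mul_assoc, mul_comm R, hρR, one_mul]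
    have hyR : R * ‖y₁ - y₀‖ ≤ r₂ := by
      have : ‖y₁ - y₀‖ ≤ ρ * r₂ := by rwa [div_le_iff₀ hr₂] at h2
      calc R * ‖y₁ - y₀‖ ≤ R * (ρ * r₂) := mul_le_mul_of_nonneg_left this (by positivity)
        _ = r₂ := by rw [← mul_assoc, mul_comm R, hρR, one_mul]
    have hmaps : MapsTo (line x₀ x₁ y₀ y₁) (closedBall (0 : ℂ) R) (closedBall x₀ r₁ ×ˢ closedBall y₀ r₂) :=
      fun ζ hζ => line_mem_prod hxR hyR hζ
    have hf : DifferentiableOn ℂ (fun ζ => Φ (line x₀ x₁ y₀ y₁ ζ)) (closedBall (0 : ℂ) R) :=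
      hΦ.comp (differentiable_line x₀ x₁ y₀ y₁).differentiableOn hmaps
    have hfM : ∀ t ∈ sphere (0 : ℂ) R, ‖(fun ζ => Φ (line x₀ x₁ y₀ y₁ ζ)) t‖ ≤ G :=
      fun t ht => hG _ (hmaps (sphere_subset_closedBall ht))
    have hc := norm_sub_le_div_of_bound_sphere hR1 hf hfM
    simp only [line_one, line_zero] at hc
    have hden : 0 < R - 1 := by linarith
    calc ‖Φ (x₁, y₁) - Φ (x₀, y₀)‖ ≤ G / (R - 1) := hc
      _ ≤ 2 * G * ρ := by
          rw [div_le_iff₀ hden]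
          -- 2Gρ(R − 1) = 2G(1 − ρ) ≥ G since ρ ≤ 1/2
          have : 2 * G * ρ * (R - 1) = 2 * G * (1 - ρ) := by
            calc 2 * G * ρ * (R - 1) = 2 * G * (ρ * R - ρ) := by ring
              _ = 2 * G * (1 - ρ) := by rw [hρR]
          rw [this]
          nlinarith

/-- **TWO-MARGIN CAUCHY RATE, all discrepancies up to the margins.**  Under the same analyticity and bound, if the second
data point lies in the box (`‖x₁ − x₀‖ ≤ r₁`, `‖y₁ − y₀‖ ≤ r₂`), then for EVERY size of the relative discrepancy
`‖Φ(x₁, y₁) − Φ(x₀, y₀)‖ ≤ 4G(‖x₁ − x₀‖/r₁ + ‖y₁ − y₀‖/r₂)`: the small regime is `norm_sub_le_of_line`, the large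
regime (`ρ > 1/2`) is the trivial bound `2G < 4Gρ`.  The constant a datum enters with is (bound) ÷ (ITS margin) —
the "analyticity strip ⇒ Cauchy estimate" form of the technique with one strip width per input species. [folklore] -/
theorem norm_sub_le_of_two_margins [CompleteSpace F] {Φ : E₁ × E₂ → F} {x₀ x₁ : E₁} {y₀ y₁ : E₂} {r₁ r₂ G : ℝ}
    (hr₁ : 0 < r₁) (hr₂ : 0 < r₂) (hΦ : DifferentiableOn ℂ Φ (closedBall x₀ r₁ ×ˢ closedBall y₀ r₂))
    (hG : ∀ z ∈ closedBall x₀ r₁ ×ˢ closedBall y₀ r₂, ‖Φ z‖ ≤ G) (hx : ‖x₁ - x₀‖ ≤ r₁) (hy : ‖y₁ - y₀‖ ≤ r₂) :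
    ‖Φ (x₁, y₁) - Φ (x₀, y₀)‖ ≤ 4 * G * (‖x₁ - x₀‖ / r₁ + ‖y₁ - y₀‖ / r₂) := by
  have hG0 : 0 ≤ G := (norm_nonneg _).trans (hG (x₀, y₀) ⟨mem_closedBall_self hr₁.le, mem_closedBall_self hr₂.le⟩)
  have hρ0 : 0 ≤ ‖x₁ - x₀‖ / r₁ + ‖y₁ - y₀‖ / r₂ := by positivity
  by_cases hρ : ‖x₁ - x₀‖ / r₁ + ‖y₁ - y₀‖ / r₂ ≤ 1 / 2
  · calc ‖Φ (x₁, y₁) - Φ (x₀, y₀)‖ ≤ 2 * G * (‖x₁ - x₀‖ / r₁ + ‖y₁ - y₀‖ / r₂) :=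
          norm_sub_le_of_line hr₁ hr₂ hΦ hG hρ
      _ ≤ 4 * G * (‖x₁ - x₀‖ / r₁ + ‖y₁ - y₀‖ / r₂) := by nlinarith
  · push Not at hρ
    have hA : (x₁, y₁) ∈ closedBall x₀ r₁ ×ˢ closedBall y₀ r₂ :=
      ⟨by rwa [mem_closedBall, dist_eq_norm], by rwa [mem_closedBall, dist_eq_norm]⟩
    have hB : (x₀, y₀) ∈ closedBall x₀ r₁ ×ˢ closedBall y₀ r₂ :=
      ⟨mem_closedBall_self hr₁.le, mem_closedBall_self hr₂.le⟩
    calc ‖Φ (x₁, y₁) - Φ (x₀, y₀)‖ ≤ ‖Φ (x₁, y₁)‖ + ‖Φ (x₀, y₀)‖ := norm_sub_le _ _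
      _ ≤ G + G := add_le_add (hG _ hA) (hG _ hB)
      _ ≤ 4 * G * (‖x₁ - x₀‖ / r₁ + ‖y₁ - y₀‖ / r₂) := by nlinarith

end Line

/-! ## §2 Two runs of ONE analytic step map: the data fixed BEFORE the inequalities (reader's advisory A) -/

section Model

variable {C : Carriers} {Op Hist : Type*} [NormedAddCommGroup Op] [NormedSpace ℂ Op] [NormedAddCommGroup Hist]
  [NormedSpace ℂ Hist]

/-- HYPOTHESIS-CARRYING DATA (no inequality inside): the ONE-STEP MODEL over the carriers `C` with complex normed
operator-data space `Op` and history-data space `Hist`.  `Out k o h X` = the step's output at a domain `X` created at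
step `k` from operator data `o` and inserted history `h` (ONE functional for both runs — B13 (2.13)); `opA`, `opB` = the two
runs' operator data at step `k` as functions of the coupling sequence and the run-B background (run A read at the
transported background); `insA`, `insB` = the two runs' HISTORY INSERTION maps at step `k`, taking the run's table of
earlier outputs `C.Dom → ℝ` (at the given background) to the inserted history datum (B13 (1.33)/(1.41): the fluctuation
action is assembled from the previous actions; B12 (0.29)–(0.30)); `Base k g U` = the printed ONE-RUN class of admissible
data (B13's inductive hypotheses and restrictions); `rOp k`, `rHist k` = the analyticity MARGINS around base data
(operator perturbations (2.16)–(2.17); potential budget (2.18) = inverse (1.43) level, with slack). [folklore] -/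
structure StepModel (C : Carriers) (Op Hist : Type*) [NormedAddCommGroup Op] [NormedSpace ℂ Op]
    [NormedAddCommGroup Hist] [NormedSpace ℂ Hist] where
  /-- the one-step output functional at step `k` -/
  Out : ℕ → Op → Hist → C.Dom → ℂ
  /-- run A's operator data at step `k`, at coupling sequence `g` and (transported) background `U` -/
  opA : (ℕ → ℝ) → C.BgB → ℕ → Op
  /-- run B's operator data -/
  opB : (ℕ → ℝ) → C.BgB → ℕ → Op
  /-- run A's history insertion at step `k`: earlier-output table ↦ inserted history datum -/
  insA : (ℕ → ℝ) → C.BgB → ℕ → (C.Dom → ℝ) → Hist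
  /-- run B's history insertion -/
  insB : (ℕ → ℝ) → C.BgB → ℕ → (C.Dom → ℝ) → Hist
  /-- the one-run admissible class at step `k` -/
  Base : ℕ → (ℕ → ℝ) → C.BgB → Set (Op × Hist)
  /-- operator margin at step `k` -/
  rOp : ℕ → ℝ
  /-- history margin at step `k` -/
  rHist : ℕ → ℝ
  rOp_pos : ∀ k, 0 < rOp k
  rHist_pos : ∀ k, 0 < rHist k

/-- Run A's table of outputs at the transported background (what the history insertion of run A reads). [folklore] -/
def tableA (EA : Functional C C.BgA) (g : ℕ → ℝ) (U : C.BgB) : C.Dom → ℝ := fun Y => EA g (C.transport U) Y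

/-- Run B's table of outputs at background `U`. [folklore] -/
def tableB (EB : Functional C C.BgB) (g : ℕ → ℝ) (U : C.BgB) : C.Dom → ℝ := fun Y => EB g U Y

namespace StepModel

variable (M : StepModel C Op Hist)

/-- Run A's input data point at step `k`. [folklore] -/
def dataA (EA : Functional C C.BgA) (g : ℕ → ℝ) (U : C.BgB) (k : ℕ) : Op × Hist :=
  (M.opA g U k, M.insA g U k (tableA EA g U))

/-- Run B's input data point at step `k`. [folklore] -/
def dataB (EB : Functional C C.BgB) (g : ℕ → ℝ) (U : C.BgB) (k : ℕ) : Op × Hist :=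
  (M.opB g U k, M.insB g U k (tableB EB g U))

/-- The two-margin slack box around a data point at step `k`. [folklore] -/
def box (k : ℕ) (p : Op × Hist) : Set (Op × Hist) := closedBall p.1 (M.rOp k) ×ˢ closedBall p.2 (M.rHist k)

/-- HYPOTHESIS SHAPE `RepresentsB` (printed SUPPORT, not a printed statement: B13 (2.13) p. 14 defines E^{(k+1)}(X) as the
cluster functional of the step's operators and of the fluctuation action (1.41), itself assembled from the previous actions):
run B's output at every domain is the step map applied to run B's OWN data (its operators and the insertion of its own
earlier table) — the renormalisation-group recursion of run B. [folklore] -/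
def RepresentsB (EB : Functional C C.BgB) (W : Set (ℕ → ℝ)) : Prop :=
  ∀ g ∈ W, ∀ (U : C.BgB) (X : C.Dom),
    EB g U X = (M.Out (C.scale X) (M.opB g U (C.scale X)) (M.insB g U (C.scale X) (tableB EB g U)) X).re

/-- HYPOTHESIS SHAPE `RepresentsA`: the same recursion for run A, read at transported backgrounds, with run A's operator
data and run A's insertion maps but THE SAME output functional `Out` (B13 (1.5) p. 3: the functional depends on its input
operators only through their bounds; the two lattice spacings differ in the DATA, not in the functional). [folklore] -/
def RepresentsA (EA : Functional C C.BgA) (W : Set (ℕ → ℝ)) : Prop :=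
  ∀ g ∈ W, ∀ (U : C.BgB) (X : C.Dom),
    EA g (C.transport U) X = (M.Out (C.scale X) (M.opA g U (C.scale X)) (M.insA g U (C.scale X) (tableA EA g U)) X).re

/-- HYPOTHESIS SHAPE `InBase` (printed for ONE run: B13 p. 22 closes the inductive hypotheses for the new action): run B's
data at every step lies in the one-run admissible class. [folklore] -/
def InBase (EB : Functional C C.BgB) (W : Set (ℕ → ℝ)) : Prop :=
  ∀ k, ∀ g ∈ W, ∀ (U : C.BgB), M.dataB EB g U k ∈ M.Base k g U

/-- HYPOTHESIS SHAPE `OutputEnvelope` (= cell gap G-ne5p1-1′, NOT PRINTED as a parametrised statement; ingredients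
printed: B13 Lemma 3 (2.38) p. 20 and (2.41) p. 21 for admissible data, (2.14) p. 15 (the potentials enter only through
exp Σ_Y τ(Y)V_k(Y, ·) with τ(Y) on the circle (2.18) p. 16), (2.16)–(2.17) p. 16 (operator perturbations)): around EVERY
base point, on the two-margin slack box, the output at a step-`k` domain `X` is complex differentiable in the data and
bounded by `G·e^{−κ d(X)}`. [folklore] -/
def OutputEnvelope (W : Set (ℕ → ℝ)) (κ G : ℝ) : Prop :=
  ∀ k, ∀ g ∈ W, ∀ (U : C.BgB) (p : Op × Hist), p ∈ M.Base k g U → ∀ X : C.Dom, C.scale X = k →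
    DifferentiableOn ℂ (fun z : Op × Hist => M.Out k z.1 z.2 X) (M.box k p) ∧
      ∀ z ∈ M.box k p, ‖M.Out k z.1 z.2 X‖ ≤ G * Real.exp (-(κ * C.d X))

/-- HYPOTHESIS SHAPE `OperatorRate δ θ` (= MI-1: the two-spacing rate of the runs' OPERATOR DATA at the common transported
background, read in MARGIN UNITS; NOT PRINTED — node U1a's NE2/NE2⁺ in the cell's spine; NE3 (node U1b) only under a
minimiser-reading instantiation via a Lipschitz split — booking per the interface cross-read C-ne5p1-2, file v2.1; v1/v2
said "≡ NE3"): the two runs' operator data at step `k` differ by at most `δθ^k` operator margins. [folklore] -/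
def OperatorRate (W : Set (ℕ → ℝ)) (δ θ : ℝ) : Prop :=
  ∀ k, ∀ g ∈ W, ∀ (U : C.BgB), ‖M.opA g U k - M.opB g U k‖ ≤ δ * θ ^ k * M.rOp k

/-- HYPOTHESIS SHAPE `InsertionRate κ E₀ δ′ θ` (NOT PRINTED; NE2-type: the η-dependence of the RE-EXPRESSION maps — the
averaging operators / minimisers through which an old action is written as a function of the new fields): on every table
obeying the one-run decay bound, the two runs' insertion maps differ by at most `δ′θ^k` history margins. [folklore] -/
def InsertionRate (W : Set (ℕ → ℝ)) (κ E₀ δ' θ : ℝ) : Prop :=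
  ∀ k, ∀ g ∈ W, ∀ (U : C.BgB) (t : C.Dom → ℝ), (∀ Y, |t Y| ≤ E₀ * Real.exp (-(κ * C.d Y))) →
    ‖M.insA g U k t - M.insB g U k t‖ ≤ δ' * θ ^ k * M.rHist k

/-- HYPOTHESIS SHAPE `InsertionDamped κ c ω` (= MI-3a, NOT PRINTED for DISCREPANCIES; printed ingredients: the insertion is
LINEAR in each previous action (B13 (1.33), the t_□/σ-differentiation (1.22)–(1.24) p. 7) and a scale-`j` action enters
step `k` with the age factor Lʲη (p. 9 "the factor Lʲη, which controls the sum over j"; B12 (0.27), (3.54))): run A's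
insertion at step `k` is Lipschitz in the table with gain `c·ω^{k−j}` history margins per unit of scale-`j` discrepancy
(weighted sup norm), and READS ONLY SCALES `< k` (tables agreeing below `k` are inserted identically,
`insA_eq_of_agree_below`).  The marginal (β-function) channel has NO damping and is NOT covered by this shape: it is node
U2's (NE4), i.e. the coupling sequence `g` is common to both runs here (MI-4). [folklore] -/
def InsertionDamped (W : Set (ℕ → ℝ)) (κ c ω : ℝ) : Prop :=
  ∀ k, ∀ g ∈ W, ∀ (U : C.BgB) (t t' : C.Dom → ℝ) (D : ℕ → ℝ), (∀ j < k, 0 ≤ D j) →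
    (∀ Y, C.scale Y < k → |t Y - t' Y| ≤ D (C.scale Y) * Real.exp (-(κ * C.d Y))) →
      ‖M.insA g U k t - M.insA g U k t'‖ ≤ M.rHist k * (c * ∑ j ∈ range k, ω ^ (k - j) * D j)

/-- ANTI-READ-OFF: under `InsertionDamped` the step-`k` insertion is BLIND to the table at scales `≥ k` — so in this typing
the step map must CREATE the scale-`k` outputs from lower-scale outputs and operator data; the degenerate model "input
space = output table, Out = evaluation" of the v1 reading (`cbs_of_ne5_half` of the XREAD certificate) is not an instance.
[folklore] -/
theorem insA_eq_of_agree_below {W : Set (ℕ → ℝ)} {κ c ω : ℝ} (h : M.InsertionDamped W κ c ω) {k : ℕ} {g : ℕ → ℝ}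
    (hg : g ∈ W) (U : C.BgB) {t t' : C.Dom → ℝ} (htt' : ∀ Y, C.scale Y < k → t Y = t' Y) :
    M.insA g U k t = M.insA g U k t' := by
  have := h k g hg U t t' (fun _ => 0) (fun _ _ => le_rfl) (fun Y hY => by simp [htt' Y hY])
  simp only [mul_zero, sum_const_zero] at this
  exact eq_of_sub_eq_zero (norm_le_zero_iff.1 this)

/-- THE RECURSION DETERMINES THE RUN: two run-A functionals represented by the same model (same operator data, same
damped insertion) coincide at every transported background — by strong induction on the creation scale, since the step-`k`
insertion only reads the scales `< k`.  So in this typing run A's outputs are the ORBIT of the data maps, fixed before any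
inequality is stated (the v1 advisory-A degeneracy — data chosen after the discrepancy is known — cannot occur). [folklore] -/
theorem representsA_ext {EA EA' : Functional C C.BgA} {W : Set (ℕ → ℝ)} {κ c ω : ℝ} (hA : M.RepresentsA EA W)
    (hA' : M.RepresentsA EA' W) (hdamp : M.InsertionDamped W κ c ω) :
    ∀ g ∈ W, ∀ (U : C.BgB) (X : C.Dom), EA g (C.transport U) X = EA' g (C.transport U) X := by
  intro g hg U
  suffices h : ∀ (n : ℕ) (X : C.Dom), C.scale X = n → EA g (C.transport U) X = EA' g (C.transport U) X from
    fun X => h _ X rfl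
  intro n
  refine Nat.strong_induction_on n ?_
  intro n ih X hX
  have htab : ∀ Y, C.scale Y < n → tableA EA g U Y = tableA EA' g U Y := fun Y hY => ih _ hY Y rfl
  rw [hA g hg U X, hA' g hg U X, hX, M.insA_eq_of_agree_below hdamp hg U htab]

/-- **THE STEP**: the model hypotheses give v1's RECURSIVE BLOCK BUDGET `RecursiveRate EA EB W κ θ ω (4G(δ + δ′)) (4Gc)`.
At a domain `X` of scale `k`: the operator discrepancy is `≤ δθ^k` margins (`OperatorRate`); the history discrepancy is
`≤ (cΣ_{j<k} ω^{k−j}D_j + δ′θ^k)` margins (`InsertionDamped` on run A's insertion between the two tables — their scale-`j`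
difference is the INHERITED discrepancy `D_j` — plus `InsertionRate` at run B's table); if the relative discrepancy `ρ`
is `≤ 1/2` the interpolating line `ζ ↦ d_B + ζ(d_A − d_B)` stays in the slack box for `|ζ| ≤ 1/ρ` and
`norm_sub_le_of_line` gives `2Gρ·e^{−κd}`; otherwise the one-run bounds give `2G·e^{−κd} < 4Gρ·e^{−κd}`. [folklore] -/
theorem recursiveRate_of_stepModel {EA : Functional C C.BgA} {EB : Functional C C.BgB} {W : Set (ℕ → ℝ)}
    {κ G E₀ δ δ' θ c ω : ℝ} (hrA : M.RepresentsA EA W) (hrB : M.RepresentsB EB W) (hbase : M.InBase EB W)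
    (henv : M.OutputEnvelope W κ G) (hdA : DecayBound EA W G κ) (hdB : DecayBound EB W E₀ κ) (hE₀ : E₀ ≤ G)
    (hop : M.OperatorRate W δ θ) (hins : M.InsertionRate W κ E₀ δ' θ) (hdamp : M.InsertionDamped W κ c ω)
    (hω : 0 ≤ ω) : RecursiveRate EA EB W κ θ ω (4 * G * (δ + δ')) (4 * G * c) := by
  intro k D hD g hg U X hX
  -- the two data points
  set x₀ := M.opB g U k with hx₀
  set x₁ := M.opA g U k with hx₁
  set y₀ := M.insB g U k (tableB EB g U) with hy₀
  set y₁ := M.insA g U k (tableA EA g U) with hy₁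
  have hrOp := M.rOp_pos k
  have hrHist := M.rHist_pos k
  have hexp := Real.exp_pos (-(κ * C.d X))
  have hG0 : 0 ≤ G := by
    by_contra hneg
    have : G * Real.exp (-(κ * C.d X)) < 0 := mul_neg_of_neg_of_pos (not_le.mp hneg) hexp
    linarith [abs_nonneg (EA g (C.transport U) X), hdA g hg (C.transport U) X]
  -- operator discrepancy in margin units (MI-1)
  have hxd : ‖x₁ - x₀‖ ≤ δ * θ ^ k * M.rOp k := hop k g hg U
  -- history discrepancy in margin units: damped insertion of the inherited discrepancies (MI-3a) + insertion rate
  set S := ∑ j ∈ range k, ω ^ (k - j) * D j with hS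
  have hS0 : 0 ≤ S := sum_nonneg fun j hj => mul_nonneg (pow_nonneg hω _) (hD j (mem_range.1 hj)).1
  have htab : ∀ Y, C.scale Y < k →
      |tableA EA g U Y - tableB EB g U Y| ≤ D (C.scale Y) * Real.exp (-(κ * C.d Y)) :=
    fun Y hY => (hD (C.scale Y) hY).2 g hg U Y rfl
  have hdamp' := hdamp k g hg U (tableA EA g U) (tableB EB g U) D (fun j hj => (hD j hj).1) htab
  have hins' := hins k g hg U (tableB EB g U) (fun Y => hdB g hg U Y)
  have hyd : ‖y₁ - y₀‖ ≤ (c * S + δ' * θ ^ k) * M.rHist k :=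
    calc ‖y₁ - y₀‖ ≤ ‖y₁ - M.insA g U k (tableB EB g U)‖ + ‖M.insA g U k (tableB EB g U) - y₀‖ :=
          norm_sub_le_norm_sub_add_norm_sub _ _ _
      _ ≤ M.rHist k * (c * S) + δ' * θ ^ k * M.rHist k := add_le_add hdamp' hins'
      _ = (c * S + δ' * θ ^ k) * M.rHist k := by ring
  -- the relative discrepancy and its budget
  set ρ := ‖x₁ - x₀‖ / M.rOp k + ‖y₁ - y₀‖ / M.rHist k with hρ_def
  have hρ0 : 0 ≤ ρ := by positivity
  have hρβ : ρ ≤ δ * θ ^ k + (c * S + δ' * θ ^ k) := by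
    have h1 : ‖x₁ - x₀‖ / M.rOp k ≤ δ * θ ^ k := by rw [div_le_iff₀ hrOp]; exact hxd
    have h2 : ‖y₁ - y₀‖ / M.rHist k ≤ c * S + δ' * θ ^ k := by rw [div_le_iff₀ hrHist]; exact hyd
    exact add_le_add h1 h2
  -- the output slice at X and its envelope on the slack box around run B's (admissible) data
  have hbox : M.box k (M.dataB EB g U k) = closedBall x₀ (M.rOp k) ×ˢ closedBall y₀ (M.rHist k) := rfl
  obtain ⟨hdiff, hbd⟩ := henv k g hg U _ (hbase k g hg U) X hX
  rw [hbox] at hdiff hbd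
  -- the two runs' outputs are the real parts of the slice at the two data points
  have hdisc : disc EA EB g U X ≤
      ‖(fun z : Op × Hist => M.Out k z.1 z.2 X) (x₁, y₁) - (fun z : Op × Hist => M.Out k z.1 z.2 X) (x₀, y₀)‖ := by
    have eA := hrA g hg U X
    have eB := hrB g hg U X
    rw [hX] at eA eB
    unfold disc
    rw [eA, eB, ← Complex.sub_re]
    exact Complex.abs_re_le_norm _
  -- KEY: disc ≤ 4Gρ·e^{−κd}, by the interpolating line (ρ ≤ 1/2) or the one-run bounds (ρ > 1/2)
  have key : disc EA EB g U X ≤ 4 * G * ρ * Real.exp (-(κ * C.d X)) := by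
    by_cases hρ : ρ ≤ 1 / 2
    · have h2 := norm_sub_le_of_line (Φ := fun z : Op × Hist => M.Out k z.1 z.2 X) (x₁ := x₁) (y₁ := y₁)
        hrOp hrHist hdiff hbd hρ
      calc disc EA EB g U X ≤ _ := hdisc
        _ ≤ 2 * (G * Real.exp (-(κ * C.d X))) * ρ := h2
        _ ≤ 4 * G * ρ * Real.exp (-(κ * C.d X)) := by
            have : 0 ≤ G * Real.exp (-(κ * C.d X)) * ρ := by positivity
            nlinarith
    · push Not at hρ
      calc disc EA EB g U X ≤ |EA g (C.transport U) X| + |EB g U X| := abs_sub _ _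
        _ ≤ G * Real.exp (-(κ * C.d X)) + E₀ * Real.exp (-(κ * C.d X)) :=
            add_le_add (hdA g hg _ X) (hdB g hg U X)
        _ ≤ G * Real.exp (-(κ * C.d X)) + G * Real.exp (-(κ * C.d X)) := by
            have := mul_le_mul_of_nonneg_right hE₀ hexp.le
            linarith
        _ ≤ 4 * G * ρ * Real.exp (-(κ * C.d X)) := by
            have : 0 ≤ G * Real.exp (-(κ * C.d X)) := by positivity
            nlinarith
  -- bookkeeping: 4Gρ ≤ 4G(δ + δ′)θ^k + Σ_j 4Gc·ω^{k−j}D_j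
  have hsum : ∑ j ∈ range k, 4 * G * c * ω ^ (k - j) * D j = 4 * G * c * S := by
    rw [hS, mul_sum]
    exact sum_congr rfl fun j _ => by ring
  calc disc EA EB g U X ≤ 4 * G * ρ * Real.exp (-(κ * C.d X)) := key
    _ ≤ 4 * G * (δ * θ ^ k + (c * S + δ' * θ ^ k)) * Real.exp (-(κ * C.d X)) :=
        mul_le_mul_of_nonneg_right (mul_le_mul_of_nonneg_left hρβ (by linarith)) hexp.le
    _ = (4 * G * (δ + δ') * θ ^ k + ∑ j ∈ range k, 4 * G * c * ω ^ (k - j) * D j) *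
          Real.exp (-(κ * C.d X)) := by rw [hsum]; ring

/-- **NE5 FROM THE MODEL.**  With the smallness `(1 + 4Gc)·ω < θ` (in the MODEL's age normalisation, where the newest
scale read carries `ω¹`; in the PRINTED normalisation — newest scale undamped, natural gain `c♮ = cω` — it reads
`ω + 4Gc♮ < θ`, `ne5_of_stepModel_nat` §5, and it IS an ε₁-smallness of the printed kind beyond B13's `O(1)C₃ε₁ ≤ ½E₀`:
module docstring NUMBERS (file v2); the v1 wording of this docstring, «NOT a small-coupling condition … L^{ᾱ − a} > 1 + b»,
is withdrawn), v1's renewal closure `ne5_of_recursiveRate` gives the scale-uniform constant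
`C₅ = 4G(δ + δ′)(θ − ω)/(θ − (1 + 4Gc)ω)`. [folklore] -/
theorem ne5_of_stepModel {EA : Functional C C.BgA} {EB : Functional C C.BgB} {W : Set (ℕ → ℝ)}
    {κ G E₀ δ δ' θ c ω : ℝ} (hrA : M.RepresentsA EA W) (hrB : M.RepresentsB EB W) (hbase : M.InBase EB W)
    (henv : M.OutputEnvelope W κ G) (hdA : DecayBound EA W G κ) (hdB : DecayBound EB W E₀ κ) (hE₀ : E₀ ≤ G)
    (hop : M.OperatorRate W δ θ) (hins : M.InsertionRate W κ E₀ δ' θ) (hdamp : M.InsertionDamped W κ c ω)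
    (hG : 0 ≤ G) (hδ : 0 ≤ δ + δ') (hc : 0 ≤ c) (hω : 0 ≤ ω) (hsmall : (1 + 4 * G * c) * ω < θ) :
    NE5 EA EB W κ θ (4 * G * (δ + δ') * (θ - ω) / (θ - (1 + 4 * G * c) * ω)) :=
  ne5_of_recursiveRate (by positivity) (by positivity) hω hsmall
    (M.recursiveRate_of_stepModel hrA hrB hbase henv hdA hdB hE₀ hop hins hdamp hω)

end StepModel

end Model

/-! ## §3 Non-vacuity: a toy step map with a genuine history feed on which every hypothesis holds -/

section Toy

/-- The toy run-A outputs: `E_A(k) = (32/31)(1/2)^k − (1/31)(1/64)^k`, the solution of the toy recursion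
`E_A(k) = (1/2)^k + (1/64)·E_A(k − 1)`, `E_A(0) = 1` (operator artifact `(1/2)^k` plus a damped history feed). [folklore] -/
def toyRate (n : ℕ) : ℝ := 32 / 31 * (1 / 2 : ℝ) ^ n - 1 / 31 * (1 / 64 : ℝ) ^ n

/-- The toy recursion, successor form. [folklore] -/
theorem toyRate_succ (n : ℕ) : toyRate (n + 1) = (1 / 2 : ℝ) ^ (n + 1) + 1 / 64 * toyRate n := by
  simp only [toyRate, pow_succ]; ring

/-- The toy recursion in closed form. [folklore] -/
theorem toyRate_step (n : ℕ) : toyRate n = (1 / 2 : ℝ) ^ n + (if n = 0 then 0 else 1 / 64 * toyRate (n - 1)) := by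
  cases n with
  | zero => norm_num [toyRate]
  | succ m => simp [toyRate_succ]

/-- The toy outputs are bounded by 3 (in fact by 32/31). [folklore] -/
theorem abs_toyRate_le (n : ℕ) : |toyRate n| ≤ 3 := by
  have h1 : 0 ≤ (1 / 2 : ℝ) ^ n := by positivity
  have h2 : (1 / 2 : ℝ) ^ n ≤ 1 := pow_le_one₀ (by norm_num) (by norm_num)
  have h3 : 0 ≤ (1 / 64 : ℝ) ^ n := by positivity
  have h4 : (1 / 64 : ℝ) ^ n ≤ 1 := pow_le_one₀ (by norm_num) (by norm_num)
  rw [abs_le, toyRate]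
  constructor <;> linarith

/-- Toy run A (v2) on v1's toy carriers (domains = creation steps, no tree length, trivial backgrounds). [folklore] -/
def toyEA₂ : Functional toyCarriers toyCarriers.BgA := fun _ _ X => toyRate (toyCarriers.scale X)

/-- The toy history insertion at step `k`: read the previous scale of the table with gain `1/64` (nothing at step 0).
[folklore] -/
def toyIns (k : ℕ) (t : toyCarriers.Dom → ℝ) : ℂ := if k = 0 then 0 else ((1 / 64 * t (k - 1) : ℝ) : ℂ)

/-- The toy step model: `Out(o, h) = o + h` (entire), operator data `(1/2)^k` versus `0`, the SAME insertion for both runs,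
base class `{o = 0, ‖h‖ ≤ 1}`, unit margins. [folklore] -/
def toyModel : StepModel toyCarriers ℂ ℂ where
  Out := fun _ o h _ => o + h
  opA := fun _ _ k => (((1 / 2 : ℝ) ^ k : ℝ) : ℂ)
  opB := fun _ _ _ => 0
  insA := fun _ _ k t => toyIns k t
  insB := fun _ _ k t => toyIns k t
  Base := fun _ _ _ => {p | p.1 = 0 ∧ ‖p.2‖ ≤ 1}
  rOp := fun _ => 1
  rHist := fun _ => 1
  rOp_pos := fun _ => one_pos
  rHist_pos := fun _ => one_pos

/-- Toy: run B (≡ 0) is represented (the insertion of the zero table is 0). [folklore] -/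
theorem toy_representsB : toyModel.RepresentsB toyEB Set.univ := by
  intro g _ U X
  simp [toyModel, toyIns, toyEB, tableB]

/-- Toy: run A is represented — this IS the recursion `E_A(k) = (1/2)^k + E_A(k − 1)/64`. [folklore] -/
theorem toy_representsA : toyModel.RepresentsA toyEA₂ Set.univ := by
  intro g _ U X
  show toyRate (toyCarriers.scale X) =
    ((((1 / 2 : ℝ) ^ toyCarriers.scale X : ℝ) : ℂ) +
      (if toyCarriers.scale X = 0 then (0 : ℂ) else ((1 / 64 * toyRate (toyCarriers.scale X - 1) : ℝ) : ℂ))).re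
  generalize toyCarriers.scale X = n
  simp only [Complex.add_re, Complex.ofReal_re, apply_ite Complex.re, Complex.zero_re]
  exact toyRate_step n

/-- Toy: run B's data `(0, 0)` lie in the base class. [folklore] -/
theorem toy_inBase : toyModel.InBase toyEB Set.univ := by
  intro k g _ U
  simp [toyModel, StepModel.dataB, toyIns, tableB, toyEB]

/-- Toy: `o + h` is entire and bounded by 3 on the unit two-margin box around any base point. [folklore] -/
theorem toy_outputEnvelope : toyModel.OutputEnvelope Set.univ 0 3 := by
  intro k g _ U p hp X _
  simp only [toyModel, Set.mem_setOf_eq] at hp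
  refine ⟨?_, ?_⟩
  · show DifferentiableOn ℂ (fun z : ℂ × ℂ => z.1 + z.2) _
    exact (differentiable_fst.add differentiable_snd).differentiableOn
  · intro z hz
    simp only [StepModel.box, Set.mem_prod, mem_closedBall, dist_eq_norm, toyModel] at hz
    show ‖z.1 + z.2‖ ≤ 3 * Real.exp (-(0 * toyCarriers.d X))
    rw [zero_mul, neg_zero, Real.exp_zero, mul_one]
    have h1 : ‖z.1‖ ≤ 1 := by
      have := hz.1
      rwa [hp.1, sub_zero] at this
    have h2 : ‖z.2‖ ≤ 2 :=
      calc ‖z.2‖ = ‖(z.2 - p.2) + p.2‖ := by rw [sub_add_cancel]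
        _ ≤ ‖z.2 - p.2‖ + ‖p.2‖ := norm_add_le _ _
        _ ≤ 1 + 1 := add_le_add hz.2 hp.2
        _ = 2 := by norm_num
    calc ‖z.1 + z.2‖ ≤ ‖z.1‖ + ‖z.2‖ := norm_add_le _ _
      _ ≤ 3 := by linarith

/-- Toy: one-run bound of run A with constant 3. [folklore] -/
theorem toy_decayA : DecayBound toyEA₂ Set.univ 3 0 := by
  intro g _ U X
  simp only [toyEA₂, zero_mul, neg_zero, Real.exp_zero, mul_one]
  exact abs_toyRate_le _

/-- Toy: one-run bound of run B with constant 3. [folklore] -/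
theorem toy_decayB : DecayBound toyEB Set.univ 3 0 := by
  intro g _ U X
  norm_num [toyEB]

/-- Toy: operator discrepancy `(1/2)^k` = one margin times rate `(1/2)^k`. [folklore] -/
theorem toy_operatorRate : toyModel.OperatorRate Set.univ 1 (1 / 2) := by
  intro k g _ U
  show ‖(((1 / 2 : ℝ) ^ k : ℝ) : ℂ) - 0‖ ≤ 1 * (1 / 2) ^ k * 1
  rw [sub_zero, Complex.norm_real, Real.norm_eq_abs, abs_of_nonneg (by positivity)]
  linarith

/-- Toy: the two runs insert identically (`δ′ = 0`). [folklore] -/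
theorem toy_insertionRate : toyModel.InsertionRate Set.univ 0 3 0 (1 / 2) := by
  intro k g _ U t _
  show ‖toyIns k t - toyIns k t‖ ≤ 0 * (1 / 2) ^ k * 1
  simp

/-- Toy: the insertion reads only the previous scale, with gain `1/64 = ω^1 ≤ Σ_j ω^{k−j}D_j / D_{k−1}`. [folklore] -/
theorem toy_insertionDamped : toyModel.InsertionDamped Set.univ 0 1 (1 / 64) := by
  intro k g _ U t t' D hD ht
  show ‖toyIns k t - toyIns k t'‖ ≤ 1 * (1 * ∑ j ∈ range k, (1 / 64 : ℝ) ^ (k - j) * D j)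
  cases k with
  | zero => simp [toyIns]
  | succ n =>
    have hY : |t n - t' n| ≤ D n * Real.exp (-(0 * toyCarriers.d n)) := ht n (Nat.lt_succ_self n)
    rw [zero_mul, neg_zero, Real.exp_zero, mul_one] at hY
    have hterm : (1 / 64 : ℝ) ^ (n + 1 - n) * D n ≤ ∑ j ∈ range (n + 1), (1 / 64 : ℝ) ^ (n + 1 - j) * D j :=
      single_le_sum (f := fun j => (1 / 64 : ℝ) ^ (n + 1 - j) * D j)
        (fun j hj => mul_nonneg (pow_nonneg (by norm_num) _) (hD j (mem_range.1 hj))) (self_mem_range_succ n)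
    rw [Nat.add_sub_cancel_left, pow_one] at hterm
    have hne : n + 1 ≠ 0 := Nat.succ_ne_zero n
    simp only [toyIns, hne, if_false]
    rw [← Complex.ofReal_sub, Complex.norm_real, Real.norm_eq_abs, ← mul_sub, abs_mul,
      abs_of_pos (by norm_num : (0 : ℝ) < 1 / 64)]
    have := mul_le_mul_of_nonneg_left hY (by norm_num : (0 : ℝ) ≤ 1 / 64)
    -- `t (n + 1 - 1)` is `t n` by computation
    show 1 / 64 * |t n - t' n| ≤ 1 * (1 * ∑ j ∈ range (n + 1), (1 / 64 : ℝ) ^ (n + 1 - j) * D j)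
    linarith

/-- **The chain is jointly satisfiable and produces a true NE5**: on the toy model every hypothesis of `ne5_of_stepModel`
holds (`G = 3`, `δ = 1`, `δ′ = 0`, `θ = 1/2`, `c = 1`, `ω = 1/64`, smallness `13/64 < 1/2`), so the toy pair — whose
run A has a GENUINE history feed — satisfies NE5 with rate `1/2` and constant `12·(31/64)/(19/64) = 372/19`. [folklore] -/
theorem toy_ne5Data : NE5 toyEA₂ toyEB (Set.univ : Set (ℕ → ℝ)) 0 (1 / 2)
    (4 * 3 * (1 + 0) * (1 / 2 - 1 / 64) / (1 / 2 - (1 + 4 * 3 * 1) * (1 / 64))) :=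
  toyModel.ne5_of_stepModel toy_representsA toy_representsB toy_inBase toy_outputEnvelope toy_decayA toy_decayB
    le_rfl toy_operatorRate toy_insertionRate toy_insertionDamped (by norm_num) (by norm_num) (by norm_num)
    (by norm_num) (by norm_num)

/-- The toy constant in lowest terms. [folklore] -/
example : (4 * 3 * (1 + 0) * (1 / 2 - 1 / 64) / (1 / 2 - (1 + 4 * 3 * 1) * (1 / 64)) : ℝ) = 372 / 19 := by norm_num

end Toy

/-! ## §4 (file v2, ADDITIVE) Affine insertions: `InsertionDamped` from AFFINITY of the insertion in the table and a
## ONE-RUN size bound with per-scale levels — the typed split of MI-3a ("printed for SIZE, not for DISCREPANCIES") -/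

section Affine

variable {C : Carriers} {Op Hist : Type*} [NormedAddCommGroup Op] [NormedSpace ℂ Op] [NormedAddCommGroup Hist]
  [NormedSpace ℂ Hist]

namespace StepModel

variable (M : StepModel C Op Hist)

/-- HYPOTHESIS SHAPE `InsAffine` (printed STRUCTURE, not a printed inequality): run A's history insertion at every step is
AFFINE in the table of earlier outputs — a table-INDEPENDENT part (`insA … 0`: in print the expansion of the Wilson action,
B13 Lemma 2 (1.41) p. 11 *"P^{(k)}(g_k, U_{k+1}, B) + {…} = Σ_{Y∈D_k} V_k(Y, U_{k+1}, B)"*) plus a part LINEAR in the sum of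
the previous actions (Lemma 1 (1.33) p. 9 *"E_k(U_k(exp iB′V^{(k)})) − E_k(U_k(V^{(k)})) = Σ_{Y∈D_k} V′_k(Y, U_{k+1}, B)"*,
with E_k the SUM of the earlier terms, [Balaban1988Convergent] (2.25) p. 259; every localisation operation of p. 7–9 —
differentiation in t_□ at t_□ = 0, the Cauchy formula in σ(Δ) (1.22)–(1.24), the decoupling expansions — is linear in each
E^{(j)}).  Formally: differences of insertions depend only on the difference of the tables. [folklore] -/
def InsAffine (W : Set (ℕ → ℝ)) : Prop :=
  ∀ k, ∀ g ∈ W, ∀ (U : C.BgB) (t t' : C.Dom → ℝ),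
    M.insA g U k t - M.insA g U k t' = M.insA g U k (t - t') - M.insA g U k 0

/-- HYPOTHESIS SHAPE `InsLinear` (the special case with no table-independent part; the toy's). [folklore] -/
def InsLinear (W : Set (ℕ → ℝ)) : Prop :=
  ∀ k, ∀ g ∈ W, ∀ (U : C.BgB) (t t' : C.Dom → ℝ), M.insA g U k (t - t') = M.insA g U k t - M.insA g U k t'

/-- Linear insertions are affine (`insA 0 = 0`). [folklore] -/
theorem insAffine_of_linear {W : Set (ℕ → ℝ)} (h : M.InsLinear W) : M.InsAffine W := by
  intro k g hg U t t'
  have h0 : M.insA g U k 0 = 0 := by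
    have := h k g hg U 0 0
    rw [sub_self, sub_self] at this
    exact this
  rw [h0, sub_zero, h k g hg U t t']

/-- HYPOTHESIS SHAPE `SizeDamped κ c ω` (ONE-RUN SIZE bound with PER-SCALE LEVELS, in the model's age normalisation:
printed MECHANISM, NOT PRINTED as this parametrised statement — B13 (1.24) p. 7 (factor (Lʲη)⁵), p. 8 *"This yields
(6L)⁴Lʲη, and the sum over j is bounded by 2(6L)⁴"*, (1.36) p. 9; [Balaban1987RG1] (0.27), (0.29)–(0.30) p. 258, (3.54)
p. 280 — all of which bound the inserted history of ONE run from the one-run levels E₀ of ALL earlier scales at once; the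
shape asks for the same bound with an arbitrary level `T j` per scale): the TABLE-DRIVEN part of the step-`k` insertion of a
table whose scale-`j` entries are `≤ T_j·e^{−κd}` (`j < k`) has norm `≤ rHist_k·c·Σ_{j<k} ω^{k−j}T_j`. [folklore] -/
def SizeDamped (W : Set (ℕ → ℝ)) (κ c ω : ℝ) : Prop :=
  ∀ k, ∀ g ∈ W, ∀ (U : C.BgB) (t : C.Dom → ℝ) (T : ℕ → ℝ), (∀ j < k, 0 ≤ T j) →
    (∀ Y, C.scale Y < k → |t Y| ≤ T (C.scale Y) * Real.exp (-(κ * C.d Y))) →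
      ‖M.insA g U k t - M.insA g U k 0‖ ≤ M.rHist k * (c * ∑ j ∈ range k, ω ^ (k - j) * T j)

/-- **MI-3a SPLIT**: an AFFINE insertion obeying the one-run SIZE bound with per-scale levels is damped-Lipschitz in the
table (`InsertionDamped`): the difference of the insertions of two tables is the table-driven part of the insertion of
their difference, whose scale-`j` level is the inherited discrepancy `D_j`.  So of the wall MI-3a only the per-scale-level
form of the printed one-run size bound remains; the passage SIZE → DISCREPANCY is structural. [folklore] -/
theorem insertionDamped_of_affine {W : Set (ℕ → ℝ)} {κ c ω : ℝ} (haff : M.InsAffine W)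
    (hsize : M.SizeDamped W κ c ω) : M.InsertionDamped W κ c ω := by
  intro k g hg U t t' D hD htt'
  rw [haff k g hg U t t']
  exact hsize k g hg U (t - t') D hD fun Y hY => by simpa only [Pi.sub_apply] using htt' Y hY

/-- NE5 from the model with `InsertionDamped` replaced by `InsAffine ∧ SizeDamped`. [folklore] -/
theorem ne5_of_stepModel_affine {EA : Functional C C.BgA} {EB : Functional C C.BgB} {W : Set (ℕ → ℝ)}
    {κ G E₀ δ δ' θ c ω : ℝ} (hrA : M.RepresentsA EA W) (hrB : M.RepresentsB EB W) (hbase : M.InBase EB W)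
    (henv : M.OutputEnvelope W κ G) (hdA : DecayBound EA W G κ) (hdB : DecayBound EB W E₀ κ) (hE₀ : E₀ ≤ G)
    (hop : M.OperatorRate W δ θ) (hins : M.InsertionRate W κ E₀ δ' θ) (haff : M.InsAffine W)
    (hsize : M.SizeDamped W κ c ω) (hG : 0 ≤ G) (hδ : 0 ≤ δ + δ') (hc : 0 ≤ c) (hω : 0 ≤ ω)
    (hsmall : (1 + 4 * G * c) * ω < θ) :
    NE5 EA EB W κ θ (4 * G * (δ + δ') * (θ - ω) / (θ - (1 + 4 * G * c) * ω)) :=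
  M.ne5_of_stepModel hrA hrB hbase henv hdA hdB hE₀ hop hins (M.insertionDamped_of_affine haff hsize) hG hδ hc hω hsmall

end StepModel

end Affine

/-! ## §5 (file v2, ADDITIVE) The PRINTED age normalisation: the newest history scale enters UNDAMPED
## (B13 p. 8: Σ_{j≤k} Lʲη ≤ 2 includes j = k with Lᵏη = 1; [I] (0.30): Σ_{j=1}^{k} (Lʲη)^α), so the smallness reads `ω + 4Gc < θ` -/

section NaturalAge

variable {C : Carriers} {Op Hist : Type*} [NormedAddCommGroup Op] [NormedSpace ℂ Op] [NormedAddCommGroup Hist]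
  [NormedSpace ℂ Hist]

/-- The algebraic age shift: for `ω ≠ 0`, weights `ω^{k−1−j}` with gain `c` are weights `ω^{k−j}` with gain `c/ω`
(`j < k`). [folklore] -/
theorem mul_sum_age_shift {k : ℕ} {ω : ℝ} (hω : ω ≠ 0) (c : ℝ) (D : ℕ → ℝ) :
    c * ∑ j ∈ range k, ω ^ (k - 1 - j) * D j = c / ω * ∑ j ∈ range k, ω ^ (k - j) * D j := by
  rw [mul_sum, mul_sum]
  refine sum_congr rfl fun j hj => ?_
  have hjk := mem_range.1 hj
  obtain ⟨m, hm⟩ : ∃ m, k - j = m + 1 := ⟨k - 1 - j, by omega⟩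
  rw [hm, show k - 1 - j = m by omega, pow_succ]
  field_simp

namespace StepModel

variable (M : StepModel C Op Hist)

/-- HYPOTHESIS SHAPE `InsertionDampedNat κ c ω`: `InsertionDamped` with the PRINTED age exponent — the scale-`j` table
discrepancy enters the step-`k` insertion with weight `ω^{k−1−j}`, so the NEWEST scale the step reads (`j = k − 1`; in
print E_k = Σ_{j≤k} E^{(j)} feeds the step producing E^{(k+1)}, B13 (1.33) p. 9, and the term j = k carries Lᵏη = 1,
p. 8) is UNDAMPED and `c` is the NATURAL history gain (history margins per unit newest-scale discrepancy).  NOT PRINTED for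
discrepancies (MI-3a), exactly as `InsertionDamped`. [folklore] -/
def InsertionDampedNat (W : Set (ℕ → ℝ)) (κ c ω : ℝ) : Prop :=
  ∀ k, ∀ g ∈ W, ∀ (U : C.BgB) (t t' : C.Dom → ℝ) (D : ℕ → ℝ), (∀ j < k, 0 ≤ D j) →
    (∀ Y, C.scale Y < k → |t Y - t' Y| ≤ D (C.scale Y) * Real.exp (-(κ * C.d Y))) →
      ‖M.insA g U k t - M.insA g U k t'‖ ≤ M.rHist k * (c * ∑ j ∈ range k, ω ^ (k - 1 - j) * D j)

/-- HYPOTHESIS SHAPE `SizeDampedNat κ c ω`: `SizeDamped` with the printed age exponent `ω^{k−1−j}`. [folklore] -/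
def SizeDampedNat (W : Set (ℕ → ℝ)) (κ c ω : ℝ) : Prop :=
  ∀ k, ∀ g ∈ W, ∀ (U : C.BgB) (t : C.Dom → ℝ) (T : ℕ → ℝ), (∀ j < k, 0 ≤ T j) →
    (∀ Y, C.scale Y < k → |t Y| ≤ T (C.scale Y) * Real.exp (-(κ * C.d Y))) →
      ‖M.insA g U k t - M.insA g U k 0‖ ≤ M.rHist k * (c * ∑ j ∈ range k, ω ^ (k - 1 - j) * T j)

/-- Affine + natural size bound ⟹ natural damped-Lipschitz bound. [folklore] -/
theorem insertionDampedNat_of_affine {W : Set (ℕ → ℝ)} {κ c ω : ℝ} (haff : M.InsAffine W)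
    (hsize : M.SizeDampedNat W κ c ω) : M.InsertionDampedNat W κ c ω := by
  intro k g hg U t t' D hD htt'
  rw [haff k g hg U t t']
  exact hsize k g hg U (t - t') D hD fun Y hY => by simpa only [Pi.sub_apply] using htt' Y hY

/-- CONVERSION to the model's normalisation: natural gain `c` at damping `ω > 0` is model gain `c/ω`. [folklore] -/
theorem insertionDamped_of_nat {W : Set (ℕ → ℝ)} {κ c ω : ℝ} (h : M.InsertionDampedNat W κ c ω) (hω : 0 < ω) :
    M.InsertionDamped W κ (c / ω) ω := by
  intro k g hg U t t' D hD htt'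
  have := h k g hg U t t' D hD htt'
  rwa [mul_sum_age_shift hω.ne' c D] at this

/-- The same conversion for the size bound. [folklore] -/
theorem sizeDamped_of_nat {W : Set (ℕ → ℝ)} {κ c ω : ℝ} (h : M.SizeDampedNat W κ c ω) (hω : 0 < ω) :
    M.SizeDamped W κ (c / ω) ω := by
  intro k g hg U t T hT ht
  have := h k g hg U t T hT ht
  rwa [mul_sum_age_shift hω.ne' c T] at this

/-- Monotonicity in the damping parameter (a slower damping is a weaker hypothesis); in particular an insertion reading
ONLY the newest scale (`ω = 0`, `0^0 = 1`) satisfies the shape for every `ω′ ≥ 0`. [folklore] -/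
theorem insertionDampedNat_mono {W : Set (ℕ → ℝ)} {κ c ω ω' : ℝ} (h : M.InsertionDampedNat W κ c ω) (hc : 0 ≤ c)
    (hω : 0 ≤ ω) (hωω' : ω ≤ ω') : M.InsertionDampedNat W κ c ω' := by
  intro k g hg U t t' D hD htt'
  refine (h k g hg U t t' D hD htt').trans (mul_le_mul_of_nonneg_left (mul_le_mul_of_nonneg_left
    (sum_le_sum fun j hj => mul_le_mul_of_nonneg_right (pow_le_pow_left₀ hω hωω' _) (hD j (mem_range.1 hj))) hc)
    (M.rHist_pos k).le)

/-- **NE5 FROM THE MODEL IN THE PRINTED AGE NORMALISATION.**  With the natural history gain `c` (history margins per unit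
NEWEST-scale table discrepancy) and damping `ω > 0` per unit of age, the load-bearing smallness is `ω + 4Gc < θ`: the
artifact rate `θ` must beat the history damping `ω` PLUS the output's Lipschitz modulus `4Gc` with respect to the newest
previous action.  [analysis, module docstring "Numbers"] In B13's bookkeeping `4Gc = K·ν`, `ν = O(1)C₃ε₁/E₀` (the printed
new-term/old-term ratio, p. 21, PROPORTIONAL TO ε₁ and E₀-free), `K ∈ [1, 4.4]` by constant-tracking; print fixes only
`ν ≤ ½`, so a rate `θ = L^{−a}` with `a` comparable to the irrelevance exponent needs the ADDITIONAL printed-kind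
restriction `Kν < L^{−a} − ω` on ε₁ (cell record §10, smallness S-ν).  Constant:
`C₅ = 4G(δ + δ′)(θ − ω)/(θ − (ω + 4Gc))`. [folklore] -/
theorem ne5_of_stepModel_nat {EA : Functional C C.BgA} {EB : Functional C C.BgB} {W : Set (ℕ → ℝ)}
    {κ G E₀ δ δ' θ c ω : ℝ} (hrA : M.RepresentsA EA W) (hrB : M.RepresentsB EB W) (hbase : M.InBase EB W)
    (henv : M.OutputEnvelope W κ G) (hdA : DecayBound EA W G κ) (hdB : DecayBound EB W E₀ κ) (hE₀ : E₀ ≤ G)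
    (hop : M.OperatorRate W δ θ) (hins : M.InsertionRate W κ E₀ δ' θ) (hdamp : M.InsertionDampedNat W κ c ω)
    (hG : 0 ≤ G) (hδ : 0 ≤ δ + δ') (hc : 0 ≤ c) (hω : 0 < ω) (hsmall : ω + 4 * G * c < θ) :
    NE5 EA EB W κ θ (4 * G * (δ + δ') * (θ - ω) / (θ - (ω + 4 * G * c))) := by
  have h1 : (1 + 4 * G * (c / ω)) * ω = ω + 4 * G * c := by
    rw [add_mul, one_mul, mul_assoc (4 * G), div_mul_cancel₀ c hω.ne']
  have key := M.ne5_of_stepModel hrA hrB hbase henv hdA hdB hE₀ hop hins (M.insertionDamped_of_nat hdamp hω) hG hδ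
    (div_nonneg hc hω.le) hω.le (by rw [h1]; exact hsmall)
  rwa [h1] at key

/-- The fully structural form: `InsAffine ∧ SizeDampedNat` in place of the damped-Lipschitz hypothesis. [folklore] -/
theorem ne5_of_stepModel_affine_nat {EA : Functional C C.BgA} {EB : Functional C C.BgB} {W : Set (ℕ → ℝ)}
    {κ G E₀ δ δ' θ c ω : ℝ} (hrA : M.RepresentsA EA W) (hrB : M.RepresentsB EB W) (hbase : M.InBase EB W)
    (henv : M.OutputEnvelope W κ G) (hdA : DecayBound EA W G κ) (hdB : DecayBound EB W E₀ κ) (hE₀ : E₀ ≤ G)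
    (hop : M.OperatorRate W δ θ) (hins : M.InsertionRate W κ E₀ δ' θ) (haff : M.InsAffine W)
    (hsize : M.SizeDampedNat W κ c ω) (hG : 0 ≤ G) (hδ : 0 ≤ δ + δ') (hc : 0 ≤ c) (hω : 0 < ω)
    (hsmall : ω + 4 * G * c < θ) :
    NE5 EA EB W κ θ (4 * G * (δ + δ') * (θ - ω) / (θ - (ω + 4 * G * c))) :=
  M.ne5_of_stepModel_nat hrA hrB hbase henv hdA hdB hE₀ hop hins (M.insertionDampedNat_of_affine haff hsize) hG hδ hc
    hω hsmall

end StepModel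

end NaturalAge

/-! ## §6 (file v2, ADDITIVE) The toy in the structural / natural form: linear insertion reading only the newest scale -/

section ToyNat

/-- Toy: the insertion `t ↦ t(k − 1)/64` is linear in the table. [folklore] -/
theorem toy_insLinear : toyModel.InsLinear Set.univ := by
  intro k g _ U t t'
  show toyIns k (t - t') = toyIns k t - toyIns k t'
  unfold toyIns
  split_ifs with h
  · simp
  · simp only [Pi.sub_apply]
    push_cast
    ring

/-- Toy: the insertion is affine. [folklore] -/
theorem toy_insAffine : toyModel.InsAffine Set.univ := toyModel.insAffine_of_linear toy_insLinear

/-- Toy: the one-run SIZE bound with per-scale levels in the natural normalisation — the insertion reads only the newest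
scale (`ω = 0`: weight `0^{k−1−j} = [j = k − 1]`) with natural gain `1/64`. [folklore] -/
theorem toy_sizeDampedNat : toyModel.SizeDampedNat Set.univ 0 (1 / 64) 0 := by
  intro k g _ U t T hT ht
  show ‖toyIns k t - toyIns k 0‖ ≤ 1 * (1 / 64 * ∑ j ∈ range k, (0 : ℝ) ^ (k - 1 - j) * T j)
  cases k with
  | zero => simp [toyIns]
  | succ n =>
    have hY : |t n| ≤ T n * Real.exp (-(0 * toyCarriers.d n)) := ht n (Nat.lt_succ_self n)
    rw [zero_mul, neg_zero, Real.exp_zero, mul_one] at hY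
    have hsum : ∑ j ∈ range (n + 1), (0 : ℝ) ^ (n + 1 - 1 - j) * T j = T n := by
      rw [sum_eq_single_of_mem n (self_mem_range_succ n)]
      · simp
      · intro j hj hjn
        have : j < n := lt_of_le_of_ne (Nat.lt_succ_iff.1 (mem_range.1 hj)) hjn
        rw [zero_pow (by omega), zero_mul]
    rw [hsum]
    have hne : n + 1 ≠ 0 := Nat.succ_ne_zero n
    simp only [toyIns, hne, if_false, Pi.zero_apply, mul_zero, Complex.ofReal_zero, sub_zero]
    rw [Complex.norm_real, Real.norm_eq_abs, abs_mul, abs_of_pos (by norm_num : (0 : ℝ) < 1 / 64)]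
    -- `t (n + 1 - 1)` is `t n` by computation
    show 1 / 64 * |t n| ≤ 1 * (1 / 64 * T n)
    linarith

/-- Toy: hence the natural damped-Lipschitz bound at any damping `ω′ ≥ 0`, e.g. `1/64`. [folklore] -/
theorem toy_insertionDampedNat : toyModel.InsertionDampedNat Set.univ 0 (1 / 64) (1 / 64) :=
  toyModel.insertionDampedNat_mono (toyModel.insertionDampedNat_of_affine toy_insAffine toy_sizeDampedNat)
    (by norm_num) le_rfl (by norm_num)

/-- **The structural chain is jointly satisfiable and produces the same true NE5**: natural gain `c = 1/64`, damping
`ω = 1/64`, smallness `ω + 4Gc = 13/64 < 1/2`, constant `12·(31/64)/(19/64) = 372/19` (= `toy_ne5Data`'s, as it must: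
model gain `c/ω = 1`). [folklore] -/
theorem toy_ne5Data_nat : NE5 toyEA₂ toyEB (Set.univ : Set (ℕ → ℝ)) 0 (1 / 2)
    (4 * 3 * (1 + 0) * (1 / 2 - 1 / 64) / (1 / 2 - (1 / 64 + 4 * 3 * (1 / 64)))) :=
  toyModel.ne5_of_stepModel_nat toy_representsA toy_representsB toy_inBase toy_outputEnvelope toy_decayA toy_decayB
    le_rfl toy_operatorRate toy_insertionRate toy_insertionDampedNat (by norm_num) (by norm_num) (by norm_num)
    (by norm_num) (by norm_num)

/-- The constant in lowest terms (the same as `toy_ne5Data`'s). [folklore] -/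
example : (4 * 3 * (1 + 0) * (1 / 2 - 1 / 64) / (1 / 2 - (1 / 64 + 4 * 3 * (1 / 64))) : ℝ) = 372 / 19 := by norm_num

end ToyNat

/-! ## §7 (file v3, ADDITIVE) The NEAR REGIME: the exact Cauchy constant `Gρ/(1 − ρ)` for every `ρ < 1`, and the recursion
## re-run with an A-PRIORI bound `ρ ≤ ρ₀ < 1` from the one-run decay bounds — the constant `4G` of §2 becomes `G/(1 − ρ₀)`
## (cell record `t4/T4-EST-NE5-P1.md` §10.6, §13; module docstring NUMBERS (d)) -/

section NearRegime

variable {E₁ E₂ F : Type*} [NormedAddCommGroup E₁] [NormedSpace ℂ E₁] [NormedAddCommGroup E₂] [NormedSpace ℂ E₂]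
  [NormedAddCommGroup F] [NormedSpace ℂ F]

/-- The geometric AGE SUM of the model normalisation: `Σ_{j<k} ω^{k−j} = ω + ω² + … + ω^k ≤ ω/(1 − ω)` for `0 ≤ ω < 1`.
[folklore] -/
theorem sum_pow_age_le {ω : ℝ} (hω : 0 ≤ ω) (hω1 : ω < 1) (k : ℕ) : ∑ j ∈ range k, ω ^ (k - j) ≤ ω / (1 - ω) := by
  have h1 : 0 < 1 - ω := by linarith
  induction k with
  | zero => simp only [range_zero, sum_empty]; exact div_nonneg hω h1.le
  | succ k ih =>
    rw [sum_range_succ, Nat.add_sub_cancel_left, pow_one]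
    have h : ∑ j ∈ range k, ω ^ (k + 1 - j) = ω * ∑ j ∈ range k, ω ^ (k - j) := by
      rw [mul_sum]
      refine sum_congr rfl fun j hj => ?_
      rw [show k + 1 - j = (k - j) + 1 by have := mem_range.1 hj; omega, pow_succ, mul_comm]
    rw [h]
    calc ω * ∑ j ∈ range k, ω ^ (k - j) + ω ≤ ω * (ω / (1 - ω)) + ω := by gcongr
      _ = ω / (1 - ω) := by field_simp; ring

/-- **TWO-MARGIN CAUCHY RATE ON THE INTERPOLATING LINE WITH THE EXACT CONSTANT.**  Same setting as `norm_sub_le_of_line`,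
for EVERY relative discrepancy `ρ = ‖x₁ − x₀‖/r₁ + ‖y₁ − y₀‖/r₂ < 1`: the line through the two data points stays in the box
for `|ζ| ≤ 1/ρ > 1`, and the one-variable Cauchy estimate on that disc (`Dimock2015.norm_sub_le_div_of_bound_sphere`) gives
`‖Φ(x₁, y₁) − Φ(x₀, y₀)‖ ≤ G/(1/ρ − 1) = Gρ/(1 − ρ)` — constant `G` as `ρ → 0`; the `2G` of `norm_sub_le_of_line` is the
`ρ = 1/2` worst case, the `4G` of `norm_sub_le_of_two_margins` adds the merging with the far regime. [folklore] -/
theorem norm_sub_le_of_line_lt_one [CompleteSpace F] {Φ : E₁ × E₂ → F} {x₀ x₁ : E₁} {y₀ y₁ : E₂} {r₁ r₂ G : ℝ}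
    (hr₁ : 0 < r₁) (hr₂ : 0 < r₂) (hΦ : DifferentiableOn ℂ Φ (closedBall x₀ r₁ ×ˢ closedBall y₀ r₂))
    (hG : ∀ z ∈ closedBall x₀ r₁ ×ˢ closedBall y₀ r₂, ‖Φ z‖ ≤ G) (hρ : ‖x₁ - x₀‖ / r₁ + ‖y₁ - y₀‖ / r₂ < 1) :
    ‖Φ (x₁, y₁) - Φ (x₀, y₀)‖ ≤
      G * (‖x₁ - x₀‖ / r₁ + ‖y₁ - y₀‖ / r₂) / (1 - (‖x₁ - x₀‖ / r₁ + ‖y₁ - y₀‖ / r₂)) := by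
  set ρ := ‖x₁ - x₀‖ / r₁ + ‖y₁ - y₀‖ / r₂ with hρ_def
  have hG0 : 0 ≤ G := (norm_nonneg _).trans (hG (x₀, y₀) ⟨mem_closedBall_self hr₁.le, mem_closedBall_self hr₂.le⟩)
  have ha : 0 ≤ ‖x₁ - x₀‖ / r₁ := by positivity
  have hb : 0 ≤ ‖y₁ - y₀‖ / r₂ := by positivity
  have hρ0 : 0 ≤ ρ := add_nonneg ha hb
  have h1 : ‖x₁ - x₀‖ / r₁ ≤ ρ := le_add_of_nonneg_right hb
  have h2 : ‖y₁ - y₀‖ / r₂ ≤ ρ := le_add_of_nonneg_left ha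
  rcases hρ0.eq_or_lt with hzero | hpos
  · -- ρ = 0: the two data points coincide
    have hx0 : ‖x₁ - x₀‖ / r₁ = 0 := le_antisymm (hzero ▸ h1) ha
    have hy0 : ‖y₁ - y₀‖ / r₂ = 0 := le_antisymm (hzero ▸ h2) hb
    rw [div_eq_zero_iff, norm_eq_zero, sub_eq_zero] at hx0 hy0
    rw [← hzero, mul_zero, zero_div]
    rcases hx0 with hx0 | hx0
    · rcases hy0 with hy0 | hy0
      · simp [hx0, hy0]
      · exact absurd hy0 hr₂.ne'
    · exact absurd hx0 hr₁.ne'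
  · -- 0 < ρ < 1: Cauchy on the circle of radius 1/ρ > 1
    set R := 1 / ρ with hR_def
    have hρR : ρ * R = 1 := by rw [hR_def]; field_simp
    have hR1 : 1 < R := by rw [hR_def, lt_div_iff₀ hpos, one_mul]; exact hρ
    have hxR : R * ‖x₁ - x₀‖ ≤ r₁ := by
      have : ‖x₁ - x₀‖ ≤ ρ * r₁ := by rwa [div_le_iff₀ hr₁] at h1
      calc R * ‖x₁ - x₀‖ ≤ R * (ρ * r₁) := mul_le_mul_of_nonneg_left this (by positivity)
        _ = r₁ := by rw [← mul_assoc, mul_comm R, hρR, one_mul]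
    have hyR : R * ‖y₁ - y₀‖ ≤ r₂ := by
      have : ‖y₁ - y₀‖ ≤ ρ * r₂ := by rwa [div_le_iff₀ hr₂] at h2
      calc R * ‖y₁ - y₀‖ ≤ R * (ρ * r₂) := mul_le_mul_of_nonneg_left this (by positivity)
        _ = r₂ := by rw [← mul_assoc, mul_comm R, hρR, one_mul]
    have hmaps : MapsTo (line x₀ x₁ y₀ y₁) (closedBall (0 : ℂ) R) (closedBall x₀ r₁ ×ˢ closedBall y₀ r₂) :=
      fun ζ hζ => line_mem_prod hxR hyR hζ
    have hf : DifferentiableOn ℂ (fun ζ => Φ (line x₀ x₁ y₀ y₁ ζ)) (closedBall (0 : ℂ) R) :=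
      hΦ.comp (differentiable_line x₀ x₁ y₀ y₁).differentiableOn hmaps
    have hfM : ∀ t ∈ sphere (0 : ℂ) R, ‖(fun ζ => Φ (line x₀ x₁ y₀ y₁ ζ)) t‖ ≤ G :=
      fun t ht => hG _ (hmaps (sphere_subset_closedBall ht))
    have hc := norm_sub_le_div_of_bound_sphere hR1 hf hfM
    simp only [line_one, line_zero] at hc
    have hden : 0 < R - 1 := by linarith
    have h1ρ : 0 < 1 - ρ := by linarith
    calc ‖Φ (x₁, y₁) - Φ (x₀, y₀)‖ ≤ G / (R - 1) := hc
      _ = G * ρ / (1 - ρ) := by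
          rw [div_eq_div_iff hden.ne' h1ρ.ne']
          calc G * (1 - ρ) = G * (ρ * R - ρ) := by rw [hρR]
            _ = G * ρ * (R - 1) := by ring

/-- The NEAR-REGIME form used by the recursion: `ρ ≤ ρ₀ < 1` ⟹ `‖Φ(x₁, y₁) − Φ(x₀, y₀)‖ ≤ (G/(1 − ρ₀))·ρ`. [folklore] -/
theorem norm_sub_le_of_line_near [CompleteSpace F] {Φ : E₁ × E₂ → F} {x₀ x₁ : E₁} {y₀ y₁ : E₂} {r₁ r₂ G ρ₀ : ℝ}
    (hr₁ : 0 < r₁) (hr₂ : 0 < r₂) (hΦ : DifferentiableOn ℂ Φ (closedBall x₀ r₁ ×ˢ closedBall y₀ r₂))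
    (hG : ∀ z ∈ closedBall x₀ r₁ ×ˢ closedBall y₀ r₂, ‖Φ z‖ ≤ G) (hρ₀ : ρ₀ < 1)
    (hρ : ‖x₁ - x₀‖ / r₁ + ‖y₁ - y₀‖ / r₂ ≤ ρ₀) :
    ‖Φ (x₁, y₁) - Φ (x₀, y₀)‖ ≤ G / (1 - ρ₀) * (‖x₁ - x₀‖ / r₁ + ‖y₁ - y₀‖ / r₂) := by
  set ρ := ‖x₁ - x₀‖ / r₁ + ‖y₁ - y₀‖ / r₂ with hρ_def
  have hG0 : 0 ≤ G := (norm_nonneg _).trans (hG (x₀, y₀) ⟨mem_closedBall_self hr₁.le, mem_closedBall_self hr₂.le⟩)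
  have hρ0 : 0 ≤ ρ := by positivity
  have h1ρ₀ : 0 < 1 - ρ₀ := by linarith
  calc ‖Φ (x₁, y₁) - Φ (x₀, y₀)‖ ≤ G * ρ / (1 - ρ) := norm_sub_le_of_line_lt_one hr₁ hr₂ hΦ hG (by linarith)
    _ ≤ G * ρ / (1 - ρ₀) := div_le_div_of_nonneg_left (by positivity) h1ρ₀ (by linarith)
    _ = G / (1 - ρ₀) * ρ := by ring

variable {C : Carriers} {Op Hist : Type*} [NormedAddCommGroup Op] [NormedSpace ℂ Op] [NormedAddCommGroup Hist]
  [NormedSpace ℂ Hist]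

namespace StepModel

variable (M : StepModel C Op Hist)

/-- **THE STEP IN THE NEAR REGIME.**  Same data and hypothesis shapes as `recursiveRate_of_stepModel`, with run A's one-run
level `EA₀` decoupled from the envelope `G` and no comparison `E₀ ≤ G`; the two regimes are in the SCALE, not in `ρ`.
Every inherited discrepancy level may be CAPPED, `D_j ↦ min(D_j, EA₀ + E₀)`, because the one-run decay bounds bound the
table difference outright; so the history displacement at step `k` is
`≤ cΣ_{j<k} ω^{k−j} min(D_j, EA₀ + E₀) + δ′θ^k ≤ c(EA₀ + E₀)ω/(1 − ω) + δ′θ^k` margins (`sum_pow_age_le`), and for `k ≥ k₀`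
the relative displacement is `≤ (δ + δ′)θ^{k₀} + c(EA₀ + E₀)ω/(1 − ω) ≤ ρ₀ < 1` (hypothesis `hnear`), whence
`norm_sub_le_of_line_near`: `disc ≤ (G/(1 − ρ₀))((δ + δ′)θ^k + cΣ_{j<k} ω^{k−j}D_j)e^{−κd}`.  For `k < k₀` the one-run
bounds give `disc ≤ (EA₀ + E₀)e^{−κd} ≤ Bθ^k e^{−κd}` (hypothesis `hfirst`; `k₀ = 0`, `B = 0` is allowed when `δ + δ′` is
already small).  Result: `RecursiveRate EA EB W κ θ ω (G(δ + δ′)/(1 − ρ₀) + B) (Gc/(1 − ρ₀))` — the history constant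
`4Gc` of §2 divided by `4(1 − ρ₀)`; the first scales cost the constant `B`, never the rate. [folklore] -/
theorem recursiveRate_of_stepModel_near {EA : Functional C C.BgA} {EB : Functional C C.BgB} {W : Set (ℕ → ℝ)}
    {κ G EA₀ E₀ δ δ' θ c ω ρ₀ B : ℝ} {k₀ : ℕ} (hrA : M.RepresentsA EA W) (hrB : M.RepresentsB EB W)
    (hbase : M.InBase EB W) (henv : M.OutputEnvelope W κ G) (hdA : DecayBound EA W EA₀ κ)
    (hdB : DecayBound EB W E₀ κ) (hop : M.OperatorRate W δ θ) (hins : M.InsertionRate W κ E₀ δ' θ)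
    (hdamp : M.InsertionDamped W κ c ω) (hδ : 0 ≤ δ + δ') (hθ : 0 ≤ θ) (hθ1 : θ ≤ 1) (hc : 0 ≤ c) (hω : 0 ≤ ω)
    (hω1 : ω < 1) (hρ₀ : ρ₀ < 1) (hnear : (δ + δ') * θ ^ k₀ + c * (EA₀ + E₀) * (ω / (1 - ω)) ≤ ρ₀) (hB : 0 ≤ B)
    (hfirst : ∀ k < k₀, EA₀ + E₀ ≤ B * θ ^ k) :
    RecursiveRate EA EB W κ θ ω (G / (1 - ρ₀) * (δ + δ') + B) (G / (1 - ρ₀) * c) := by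
  intro k D hD g hg U X hX
  -- the two data points
  set x₀ := M.opB g U k with hx₀
  set x₁ := M.opA g U k with hx₁
  set y₀ := M.insB g U k (tableB EB g U) with hy₀
  set y₁ := M.insA g U k (tableA EA g U) with hy₁
  have hrOp := M.rOp_pos k
  have hrHist := M.rHist_pos k
  have hexp := Real.exp_pos (-(κ * C.d X))
  have h1ρ₀ : 0 < 1 - ρ₀ := by linarith
  have hθk : 0 ≤ θ ^ k := pow_nonneg hθ k
  -- the one-run levels are nonnegative (read at the point at hand)
  have hEA₀ : 0 ≤ EA₀ := by
    by_contra hneg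
    have : EA₀ * Real.exp (-(κ * C.d X)) < 0 := mul_neg_of_neg_of_pos (not_le.mp hneg) hexp
    linarith [abs_nonneg (EA g (C.transport U) X), hdA g hg (C.transport U) X]
  have hE₀ : 0 ≤ E₀ := by
    by_contra hneg
    have : E₀ * Real.exp (-(κ * C.d X)) < 0 := mul_neg_of_neg_of_pos (not_le.mp hneg) hexp
    linarith [abs_nonneg (EB g U X), hdB g hg U X]
  -- the output slice at X and its envelope on the slack box around run B's (admissible) data
  have hbox : M.box k (M.dataB EB g U k) = closedBall x₀ (M.rOp k) ×ˢ closedBall y₀ (M.rHist k) := rfl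
  obtain ⟨hdiff, hbd⟩ := henv k g hg U _ (hbase k g hg U) X hX
  rw [hbox] at hdiff hbd
  have hG0 : 0 ≤ G := by
    have h : ‖M.Out k x₀ y₀ X‖ ≤ G * Real.exp (-(κ * C.d X)) :=
      hbd (x₀, y₀) ⟨mem_closedBall_self hrOp.le, mem_closedBall_self hrHist.le⟩
    by_contra hneg
    have : G * Real.exp (-(κ * C.d X)) < 0 := mul_neg_of_neg_of_pos (not_le.mp hneg) hexp
    linarith [norm_nonneg (M.Out k x₀ y₀ X)]
  have hGρ : 0 ≤ G / (1 - ρ₀) := div_nonneg hG0 h1ρ₀.le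
  -- the inherited levels, and the CAPPED levels `min (D j) (EA₀ + E₀)`
  set S := ∑ j ∈ range k, ω ^ (k - j) * D j with hS
  set S' := ∑ j ∈ range k, ω ^ (k - j) * min (D j) (EA₀ + E₀) with hS'
  have hD'0 : ∀ j < k, 0 ≤ min (D j) (EA₀ + E₀) := fun j hj => le_min (hD j hj).1 (add_nonneg hEA₀ hE₀)
  have hS'0 : 0 ≤ S' := sum_nonneg fun j hj => mul_nonneg (pow_nonneg hω _) (hD'0 j (mem_range.1 hj))
  have hS'S : S' ≤ S :=
    sum_le_sum fun j hj => mul_le_mul_of_nonneg_left (min_le_left _ _) (pow_nonneg hω _)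
  have hS'E : S' ≤ (EA₀ + E₀) * (ω / (1 - ω)) :=
    calc S' ≤ ∑ j ∈ range k, ω ^ (k - j) * (EA₀ + E₀) :=
          sum_le_sum fun j hj => mul_le_mul_of_nonneg_left (min_le_right _ _) (pow_nonneg hω _)
      _ = (EA₀ + E₀) * ∑ j ∈ range k, ω ^ (k - j) := by rw [mul_sum]; exact sum_congr rfl fun j _ => mul_comm _ _
      _ ≤ (EA₀ + E₀) * (ω / (1 - ω)) := mul_le_mul_of_nonneg_left (sum_pow_age_le hω hω1 k) (add_nonneg hEA₀ hE₀)
  -- every earlier table discrepancy is bounded by the inherited level AND by the one-run levels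
  have htab : ∀ Y, C.scale Y < k →
      |tableA EA g U Y - tableB EB g U Y| ≤ min (D (C.scale Y)) (EA₀ + E₀) * Real.exp (-(κ * C.d Y)) := by
    intro Y hY
    rw [min_mul_of_nonneg _ _ (Real.exp_pos _).le]
    refine le_min ((hD (C.scale Y) hY).2 g hg U Y rfl) ?_
    calc |tableA EA g U Y - tableB EB g U Y| ≤ |tableA EA g U Y| + |tableB EB g U Y| := abs_sub _ _
      _ ≤ EA₀ * Real.exp (-(κ * C.d Y)) + E₀ * Real.exp (-(κ * C.d Y)) := add_le_add (hdA g hg _ Y) (hdB g hg U Y)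
      _ = (EA₀ + E₀) * Real.exp (-(κ * C.d Y)) := by ring
  -- operator discrepancy in margin units (MI-1); history discrepancy from the CAPPED levels (MI-3a) + insertion rate
  have hxd : ‖x₁ - x₀‖ ≤ δ * θ ^ k * M.rOp k := hop k g hg U
  have hdamp' : ‖y₁ - M.insA g U k (tableB EB g U)‖ ≤ M.rHist k * (c * S') :=
    hdamp k g hg U (tableA EA g U) (tableB EB g U) (fun j => min (D j) (EA₀ + E₀)) hD'0 htab
  have hins' := hins k g hg U (tableB EB g U) (fun Y => hdB g hg U Y)
  have hyd : ‖y₁ - y₀‖ ≤ (c * S' + δ' * θ ^ k) * M.rHist k :=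
    calc ‖y₁ - y₀‖ ≤ ‖y₁ - M.insA g U k (tableB EB g U)‖ + ‖M.insA g U k (tableB EB g U) - y₀‖ :=
          norm_sub_le_norm_sub_add_norm_sub _ _ _
      _ ≤ M.rHist k * (c * S') + δ' * θ ^ k * M.rHist k := add_le_add hdamp' hins'
      _ = (c * S' + δ' * θ ^ k) * M.rHist k := by ring
  -- the relative displacement and its A-PRIORI budget
  set ρ := ‖x₁ - x₀‖ / M.rOp k + ‖y₁ - y₀‖ / M.rHist k with hρ_def
  have hρ0 : 0 ≤ ρ := by positivity
  have hρβ : ρ ≤ (δ + δ') * θ ^ k + c * S' := by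
    have h1 : ‖x₁ - x₀‖ / M.rOp k ≤ δ * θ ^ k := by rw [div_le_iff₀ hrOp]; exact hxd
    have h2 : ‖y₁ - y₀‖ / M.rHist k ≤ c * S' + δ' * θ ^ k := by rw [div_le_iff₀ hrHist]; exact hyd
    linarith
  have hρS : ρ ≤ (δ + δ') * θ ^ k + c * S := hρβ.trans (by nlinarith [mul_le_mul_of_nonneg_left hS'S hc])
  -- the two runs' outputs are the real parts of the slice at the two data points
  have hdisc : disc EA EB g U X ≤
      ‖(fun z : Op × Hist => M.Out k z.1 z.2 X) (x₁, y₁) - (fun z : Op × Hist => M.Out k z.1 z.2 X) (x₀, y₀)‖ := by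
    have eA := hrA g hg U X
    have eB := hrB g hg U X
    rw [hX] at eA eB
    unfold disc
    rw [eA, eB, ← Complex.sub_re]
    exact Complex.abs_re_le_norm _
  -- bookkeeping of the history sum
  have hsum : ∑ j ∈ range k, G / (1 - ρ₀) * c * ω ^ (k - j) * D j = G / (1 - ρ₀) * c * S := by
    rw [hS, mul_sum]
    exact sum_congr rfl fun j _ => by ring
  have hS0 : 0 ≤ S := hS'0.trans hS'S
  by_cases hk : k < k₀
  · -- FIRST SCALES: the one-run bounds, absorbed by the constant B
    calc disc EA EB g U X ≤ |EA g (C.transport U) X| + |EB g U X| := abs_sub _ _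
      _ ≤ EA₀ * Real.exp (-(κ * C.d X)) + E₀ * Real.exp (-(κ * C.d X)) :=
          add_le_add (hdA g hg _ X) (hdB g hg U X)
      _ = (EA₀ + E₀) * Real.exp (-(κ * C.d X)) := by ring
      _ ≤ B * θ ^ k * Real.exp (-(κ * C.d X)) := mul_le_mul_of_nonneg_right (hfirst k hk) hexp.le
      _ ≤ ((G / (1 - ρ₀) * (δ + δ') + B) * θ ^ k + ∑ j ∈ range k, G / (1 - ρ₀) * c * ω ^ (k - j) * D j) *
            Real.exp (-(κ * C.d X)) := by
          rw [hsum]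
          apply mul_le_mul_of_nonneg_right _ hexp.le
          have h1 : 0 ≤ G / (1 - ρ₀) * (δ + δ') * θ ^ k := mul_nonneg (mul_nonneg hGρ hδ) hθk
          have h2 : 0 ≤ G / (1 - ρ₀) * c * S := mul_nonneg (mul_nonneg hGρ hc) hS0
          linarith
  · -- NEAR REGIME k ≥ k₀: the relative displacement is ≤ ρ₀ < 1 a priori
    push Not at hk
    have hθkk₀ : θ ^ k ≤ θ ^ k₀ := pow_le_pow_of_le_one hθ hθ1 hk
    have hρ1 : ρ ≤ ρ₀ :=
      calc ρ ≤ (δ + δ') * θ ^ k + c * S' := hρβ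
        _ ≤ (δ + δ') * θ ^ k₀ + c * ((EA₀ + E₀) * (ω / (1 - ω))) :=
            add_le_add (mul_le_mul_of_nonneg_left hθkk₀ hδ) (mul_le_mul_of_nonneg_left hS'E hc)
        _ = (δ + δ') * θ ^ k₀ + c * (EA₀ + E₀) * (ω / (1 - ω)) := by ring
        _ ≤ ρ₀ := hnear
    have h2 := norm_sub_le_of_line_near (Φ := fun z : Op × Hist => M.Out k z.1 z.2 X) (x₁ := x₁) (y₁ := y₁)
      hrOp hrHist hdiff hbd hρ₀ hρ1
    calc disc EA EB g U X ≤ _ := hdisc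
      _ ≤ G * Real.exp (-(κ * C.d X)) / (1 - ρ₀) * ρ := h2
      _ = G / (1 - ρ₀) * ρ * Real.exp (-(κ * C.d X)) := by ring
      _ ≤ G / (1 - ρ₀) * ((δ + δ') * θ ^ k + c * S) * Real.exp (-(κ * C.d X)) :=
          mul_le_mul_of_nonneg_right (mul_le_mul_of_nonneg_left hρS hGρ) hexp.le
      _ ≤ ((G / (1 - ρ₀) * (δ + δ') + B) * θ ^ k + ∑ j ∈ range k, G / (1 - ρ₀) * c * ω ^ (k - j) * D j) *
            Real.exp (-(κ * C.d X)) := by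
          rw [hsum]
          apply mul_le_mul_of_nonneg_right _ hexp.le
          have h1 : 0 ≤ B * θ ^ k := mul_nonneg hB hθk
          linarith

/-- **NE5 FROM THE MODEL, NEAR REGIME.**  Smallness `(1 + Gc/(1 − ρ₀))ω < θ` (model normalisation; `ω < 1` follows from it
and `θ ≤ 1`) and, by v1's renewal closure `ne5_of_recursiveRate`, the scale-uniform constant
`C₅ = (G(δ + δ′)/(1 − ρ₀) + B)(θ − ω)/(θ − (1 + Gc/(1 − ρ₀))ω)`. [folklore] -/
theorem ne5_of_stepModel_near {EA : Functional C C.BgA} {EB : Functional C C.BgB} {W : Set (ℕ → ℝ)}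
    {κ G EA₀ E₀ δ δ' θ c ω ρ₀ B : ℝ} {k₀ : ℕ} (hrA : M.RepresentsA EA W) (hrB : M.RepresentsB EB W)
    (hbase : M.InBase EB W) (henv : M.OutputEnvelope W κ G) (hdA : DecayBound EA W EA₀ κ)
    (hdB : DecayBound EB W E₀ κ) (hop : M.OperatorRate W δ θ) (hins : M.InsertionRate W κ E₀ δ' θ)
    (hdamp : M.InsertionDamped W κ c ω) (hG : 0 ≤ G) (hδ : 0 ≤ δ + δ') (hθ : 0 ≤ θ) (hθ1 : θ ≤ 1) (hc : 0 ≤ c)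
    (hω : 0 ≤ ω) (hρ₀ : ρ₀ < 1) (hnear : (δ + δ') * θ ^ k₀ + c * (EA₀ + E₀) * (ω / (1 - ω)) ≤ ρ₀) (hB : 0 ≤ B)
    (hfirst : ∀ k < k₀, EA₀ + E₀ ≤ B * θ ^ k) (hsmall : (1 + G / (1 - ρ₀) * c) * ω < θ) :
    NE5 EA EB W κ θ ((G / (1 - ρ₀) * (δ + δ') + B) * (θ - ω) / (θ - (1 + G / (1 - ρ₀) * c) * ω)) := by
  have h1ρ₀ : 0 < 1 - ρ₀ := by linarith
  have hb : 0 ≤ G / (1 - ρ₀) * c := mul_nonneg (div_nonneg hG h1ρ₀.le) hc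
  have hω1 : ω < 1 := by nlinarith [mul_nonneg hb hω]
  exact ne5_of_recursiveRate (add_nonneg (mul_nonneg (div_nonneg hG h1ρ₀.le) hδ) hB) hb hω hsmall
    (M.recursiveRate_of_stepModel_near hrA hrB hbase henv hdA hdB hop hins hdamp hδ hθ hθ1 hc hω hω1 hρ₀ hnear hB
      hfirst)

/-- **NE5 FROM THE MODEL IN THE PRINTED AGE NORMALISATION, NEAR REGIME.**  With the natural history gain `c` (history
margins per unit NEWEST-scale table discrepancy) at damping `ω > 0` per unit of age, the near hypothesis reads
`(δ + δ′)θ^{k₀} + c(EA₀ + E₀)/(1 − ω) ≤ ρ₀ < 1` and the load-bearing smallness is `ω + Gc/(1 − ρ₀) < θ` (against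
`ω + 4Gc < θ` of `ne5_of_stepModel_nat`).  [analysis, module docstring NUMBERS (d)] In B13's bookkeeping
`Gc/(1 − ρ₀) ≤ K′ν` with `K′ = λ/((λ − 1)(1 − ρ₀))` (≈ 1.23 at λ = 11, → 1), against `K = 4λ/(λ − 1) ≤ 4.4`: the printed
`ν ≤ ½` then already yields SOME positive rate exponent once the history-box scaling has room (λ ≳ 5), and the
ε₁-restriction of the cell's smallness item S-ν sizes the exponent instead of conditioning the existence of a rate.
Constant `C₅ = (G(δ + δ′)/(1 − ρ₀) + B)(θ − ω)/(θ − (ω + Gc/(1 − ρ₀)))`. [folklore] -/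
theorem ne5_of_stepModel_near_nat {EA : Functional C C.BgA} {EB : Functional C C.BgB} {W : Set (ℕ → ℝ)}
    {κ G EA₀ E₀ δ δ' θ c ω ρ₀ B : ℝ} {k₀ : ℕ} (hrA : M.RepresentsA EA W) (hrB : M.RepresentsB EB W)
    (hbase : M.InBase EB W) (henv : M.OutputEnvelope W κ G) (hdA : DecayBound EA W EA₀ κ)
    (hdB : DecayBound EB W E₀ κ) (hop : M.OperatorRate W δ θ) (hins : M.InsertionRate W κ E₀ δ' θ)
    (hdamp : M.InsertionDampedNat W κ c ω) (hG : 0 ≤ G) (hδ : 0 ≤ δ + δ') (hθ : 0 ≤ θ) (hθ1 : θ ≤ 1) (hc : 0 ≤ c)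
    (hω : 0 < ω) (hρ₀ : ρ₀ < 1) (hnear : (δ + δ') * θ ^ k₀ + c * (EA₀ + E₀) / (1 - ω) ≤ ρ₀) (hB : 0 ≤ B)
    (hfirst : ∀ k < k₀, EA₀ + E₀ ≤ B * θ ^ k) (hsmall : ω + G / (1 - ρ₀) * c < θ) :
    NE5 EA EB W κ θ ((G / (1 - ρ₀) * (δ + δ') + B) * (θ - ω) / (θ - (ω + G / (1 - ρ₀) * c))) := by
  have h1 : (1 + G / (1 - ρ₀) * (c / ω)) * ω = ω + G / (1 - ρ₀) * c := by
    rw [add_mul, one_mul, mul_assoc (G / (1 - ρ₀)), div_mul_cancel₀ c hω.ne']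
  have h2 : c / ω * (EA₀ + E₀) * (ω / (1 - ω)) = c * (EA₀ + E₀) / (1 - ω) := by
    rw [← mul_div_assoc, div_mul_eq_mul_div, div_mul_cancel₀ _ hω.ne']
  have key := M.ne5_of_stepModel_near hrA hrB hbase henv hdA hdB hop hins (M.insertionDamped_of_nat hdamp hω) hG hδ
    hθ hθ1 (div_nonneg hc hω.le) hω.le hρ₀ (by rw [h2]; exact hnear) hB hfirst (by rw [h1]; exact hsmall)
  rwa [h1] at key

end StepModel

end NearRegime

/-! ## §8 (file v3, ADDITIVE) The toy in the near regime -/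

section ToyNear

/-- **The near-regime chain on the toy**: `G = EA₀ = E₀ = 3`, `δ = 1`, `δ′ = 0`, `θ = 1/2`, `c = 1`, `ω = 1/64`, `k₀ = 2`,
`ρ₀ = 1/2` (near hypothesis `(1 + 0)(1/2)² + 1·(3 + 3)·(1/64)/(63/64) = 29/84 ≤ 1/2`), `B = 12` (`6 ≤ 12·(1/2)^k` for
`k < 2`), smallness `(1 + 6·1)·(1/64) = 7/64 < 1/2` (v2: `13/64`): NE5 with rate `1/2` and constant
`(6 + 12)(31/64)/(25/64) = 558/25`. [folklore] -/
theorem toy_ne5Data_near : NE5 toyEA₂ toyEB (Set.univ : Set (ℕ → ℝ)) 0 (1 / 2)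
    ((3 / (1 - 1 / 2) * (1 + 0) + 12) * (1 / 2 - 1 / 64) / (1 / 2 - (1 + 3 / (1 - 1 / 2) * 1) * (1 / 64))) :=
  toyModel.ne5_of_stepModel_near (ρ₀ := 1 / 2) (B := 12) (k₀ := 2) toy_representsA toy_representsB toy_inBase
    toy_outputEnvelope toy_decayA toy_decayB toy_operatorRate toy_insertionRate toy_insertionDamped (by norm_num)
    (by norm_num) (by norm_num) (by norm_num) (by norm_num) (by norm_num) (by norm_num) (by norm_num) (by norm_num)
    (fun k hk => by interval_cases k <;> norm_num) (by norm_num)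

/-- The near-regime toy constant in lowest terms. [folklore] -/
example : ((3 / (1 - 1 / 2) * (1 + 0) + 12) * (1 / 2 - 1 / 64) / (1 / 2 - (1 + 3 / (1 - 1 / 2) * 1) * (1 / 64)) : ℝ) =
    558 / 25 := by norm_num

end ToyNear

/-! ## §9 (file v4, ADDITIVE) SCALE RESOLUTION: the summed size bound `SizeDampedNat` (wall G-ne5p1-3a′) from printed
## STRUCTURE (affinity, blindness, real homogeneity) + the DISPLAYED SINGLE-SCALE TERM (`InsScaleBound`, G-ne5p1-3a″);
## NE5 at any slower rate, and the existence of a rate from room alone -/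

section ScaleResolution

variable {C : Carriers} {Op Hist : Type*} [NormedAddCommGroup Op] [NormedSpace ℂ Op] [NormedAddCommGroup Hist]
  [NormedSpace ℂ Hist]

/-- The SCALE-`j` SLICE of a table: its entries at the domains created at step `j`, zero elsewhere. [folklore] -/
def sliceAt (j : ℕ) (t : C.Dom → ℝ) : C.Dom → ℝ := fun Y => if C.scale Y = j then t Y else 0

/-- The TRUNCATION of a table below scale `k`: its entries at the domains of scales `< k`, zero elsewhere. [folklore] -/
def belowScale (k : ℕ) (t : C.Dom → ℝ) : C.Dom → ℝ := fun Y => if C.scale Y < k then t Y else 0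

/-- A slice agrees with the table on its scale. [folklore] -/
theorem sliceAt_apply_of_eq {j : ℕ} {t : C.Dom → ℝ} {Y : C.Dom} (h : C.scale Y = j) : sliceAt j t Y = t Y := if_pos h

/-- A slice vanishes off its scale. [folklore] -/
theorem sliceAt_apply_of_ne {j : ℕ} {t : C.Dom → ℝ} {Y : C.Dom} (h : C.scale Y ≠ j) : sliceAt j t Y = 0 := if_neg h

/-- The truncation agrees with the table below `k`. [folklore] -/
theorem belowScale_apply_of_lt {k : ℕ} {t : C.Dom → ℝ} {Y : C.Dom} (h : C.scale Y < k) : belowScale k t Y = t Y :=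
  if_pos h

/-- SCALE RESOLUTION: the truncation below `k` is the sum of the slices at the scales `j < k`. [folklore] -/
theorem belowScale_eq_sum_sliceAt (k : ℕ) (t : C.Dom → ℝ) : belowScale k t = ∑ j ∈ range k, sliceAt j t := by
  funext Y
  rw [Finset.sum_apply]
  simp only [belowScale, sliceAt, Finset.sum_ite_eq, Finset.mem_range]

namespace StepModel

variable (M : StepModel C Op Hist)

/-- HYPOTHESIS SHAPE `InsBlind` (printed STRUCTURE — the causality of the recursion: the step creating the scale-`k` outputs
assembles its history from the EARLIER outputs only, B13 Lemma 1 (1.33) p. 9 (E_k = the sum of the previous actions),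
Lemma 2 (1.41) p. 11; B12 (0.28)–(0.30) p. 258): run A's step-`k` insertion reads only the table entries of scales `< k`.
In files v1–v3 this was a CONSEQUENCE of the summed shapes (`insA_eq_of_agree_below`, `insBlind_of_affine_sizeDampedNat`);
the single-scale shapes below do not contain it, so it is a binder of its own. [folklore] -/
def InsBlind (W : Set (ℕ → ℝ)) : Prop :=
  ∀ k, ∀ g ∈ W, ∀ (U : C.BgB) (t t' : C.Dom → ℝ), (∀ Y, C.scale Y < k → t Y = t' Y) → M.insA g U k t = M.insA g U k t'

/-- HYPOTHESIS SHAPE `InsHomog` (printed STRUCTURE: with `InsAffine`, the table-driven part `insA t − insA 0` of the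
insertion is ℝ-LINEAR in the table — B13 (1.33): the earlier actions enter the fluctuation action linearly, and every
localisation operation (1.22)–(1.24) p. 7 is linear in each E^{(j)}): real homogeneity of the table-driven part (the real
scalar acting on the complex history space through `ℝ ⊂ ℂ`). [folklore] -/
def InsHomog (W : Set (ℕ → ℝ)) : Prop :=
  ∀ k, ∀ g ∈ W, ∀ (U : C.BgB) (a : ℝ) (t : C.Dom → ℝ),
    M.insA g U k (a • t) - M.insA g U k 0 = (a : ℂ) • (M.insA g U k t - M.insA g U k 0)

/-- HYPOTHESIS SHAPE `InsScaleBoundLevel κ c ω` (SINGLE-SCALE one-run size bound with an arbitrary level: the `j`-th TERM of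
the printed one-run sums with a substituted level — NOT PRINTED as parametrised; printed for the actual earlier actions at
the inductive level: B13 (1.24) p. 7 (factor (Lʲη)⁵E₀), p. 8 *"This yields (6L)⁴Lʲη"*, B12 (0.29) p. 258
*"|V^{(j)}(X, U_k)| ≤ O(1)(Lʲη)^{4+α}exp(−κd_j(X))"*, (3.54) p. 280): a table supported on ONE scale `j < k` with entries
`≤ T·e^{−κd}` displaces the step-`k` inserted history by at most `c·ω^{k−1−j}·T` history margins. [folklore] -/
def InsScaleBoundLevel (W : Set (ℕ → ℝ)) (κ c ω : ℝ) : Prop :=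
  ∀ k, ∀ g ∈ W, ∀ (U : C.BgB) (t : C.Dom → ℝ) (j : ℕ) (T : ℝ), j < k → 0 ≤ T →
    (∀ Y, C.scale Y ≠ j → t Y = 0) → (∀ Y, C.scale Y = j → |t Y| ≤ T * Real.exp (-(κ * C.d Y))) →
      ‖M.insA g U k t - M.insA g U k 0‖ ≤ M.rHist k * (c * (ω ^ (k - 1 - j) * T))

/-- HYPOTHESIS SHAPE `InsScaleBound κ E₁ c ω` (= cell gap G-ne5p1-3a″, the residual of MI-3a after file v4: the SINGLE-SCALE
one-run size bound AT ONE REFERENCE LEVEL `E₁` — in print the inductive level E₀ of the earlier actions; the DISPLAYED `j`-th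
term of B13 p. 8 / (1.24), B12 (0.29)–(0.30), (3.54), read in the model where a table is the family of a run's earlier
outputs at a fixed background; NOT PRINTED as a statement about arbitrary single-scale tables): a table supported on ONE
scale `j < k` with entries `≤ E₁·e^{−κd}` displaces the step-`k` inserted history by at most `c·ω^{k−1−j}·E₁` history
margins. [folklore] -/
def InsScaleBound (W : Set (ℕ → ℝ)) (κ E₁ c ω : ℝ) : Prop :=
  ∀ k, ∀ g ∈ W, ∀ (U : C.BgB) (t : C.Dom → ℝ) (j : ℕ), j < k →
    (∀ Y, C.scale Y ≠ j → t Y = 0) → (∀ Y, C.scale Y = j → |t Y| ≤ E₁ * Real.exp (-(κ * C.d Y))) →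
      ‖M.insA g U k t - M.insA g U k 0‖ ≤ M.rHist k * (c * (ω ^ (k - 1 - j) * E₁))

/-- Blindness was implicit in the summed shapes: `InsAffine ∧ SizeDampedNat ⟹ InsBlind` (levels `T = 0`). [folklore] -/
theorem insBlind_of_affine_sizeDampedNat {W : Set (ℕ → ℝ)} {κ c ω : ℝ} (haff : M.InsAffine W)
    (hsize : M.SizeDampedNat W κ c ω) : M.InsBlind W := by
  intro k g hg U t t' htt'
  have h := hsize k g hg U (t - t') (fun _ => 0) (fun _ _ => le_rfl) fun Y hY => by
    rw [Pi.sub_apply, htt' Y hY, sub_self, abs_zero, zero_mul]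
  simp only [mul_zero, sum_const_zero] at h
  have h0 : M.insA g U k (t - t') - M.insA g U k 0 = 0 := norm_le_zero_iff.1 h
  rw [← sub_eq_zero, haff k g hg U t t', h0]

/-- Affine insertions have an ADDITIVE table-driven part. [folklore] -/
theorem insAffine_additive {W : Set (ℕ → ℝ)} (haff : M.InsAffine W) {k : ℕ} {g : ℕ → ℝ} (hg : g ∈ W) (U : C.BgB)
    (a b : C.Dom → ℝ) : M.insA g U k (a + b) - M.insA g U k 0 =
      (M.insA g U k a - M.insA g U k 0) + (M.insA g U k b - M.insA g U k 0) := by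
  have h := haff k g hg U (a + b) b
  rw [add_sub_cancel_right] at h
  rw [← h]
  abel

/-- … hence additive over finite sums of tables. [folklore] -/
theorem insAffine_map_sum {W : Set (ℕ → ℝ)} (haff : M.InsAffine W) {k : ℕ} {g : ℕ → ℝ} (hg : g ∈ W) (U : C.BgB)
    (s : Finset ℕ) (f : ℕ → C.Dom → ℝ) :
    M.insA g U k (∑ j ∈ s, f j) - M.insA g U k 0 = ∑ j ∈ s, (M.insA g U k (f j) - M.insA g U k 0) := by
  classical
  refine Finset.induction_on s (by simp) ?_
  intro j s hj ih
  rw [sum_insert hj, sum_insert hj, M.insAffine_additive haff hg U, ih]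

/-- **SCALE RESOLUTION OF THE SIZE BOUND (the structural half of G-ne5p1-3a′).**  An affine, blind insertion obeying the
SINGLE-SCALE size bound with levels obeys the summed size bound with per-scale levels `SizeDampedNat`: truncate the table
below `k` (blindness), resolve the truncation into its scale slices, push the sum through the additive table-driven part,
and add the single-scale bounds (triangle inequality).  No sign condition on `c`, `ω`. [folklore] -/
theorem sizeDampedNat_of_scaleBoundLevel {W : Set (ℕ → ℝ)} {κ c ω : ℝ} (haff : M.InsAffine W) (hblind : M.InsBlind W)
    (hlevel : M.InsScaleBoundLevel W κ c ω) : M.SizeDampedNat W κ c ω := by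
  intro k g hg U t T hT ht
  have hbelow : M.insA g U k t = M.insA g U k (belowScale k t) :=
    hblind k g hg U t (belowScale k t) fun Y hY => (belowScale_apply_of_lt hY).symm
  rw [hbelow, belowScale_eq_sum_sliceAt, M.insAffine_map_sum haff hg U, mul_sum, mul_sum]
  refine (norm_sum_le _ _).trans (sum_le_sum fun j hj => ?_)
  have hjk : j < k := mem_range.1 hj
  refine hlevel k g hg U (sliceAt j t) j (T j) hjk (hT j hjk) (fun Y hY => sliceAt_apply_of_ne hY) fun Y hY => ?_
  have hYk : C.scale Y < k := by rw [hY]; exact hjk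
  have h := ht Y hYk
  rw [hY] at h
  rwa [sliceAt_apply_of_eq hY]

/-- **LEVELS FROM ONE LEVEL by homogeneity**: a real-homogeneous table-driven part obeying the single-scale bound at ONE
positive reference level `E₁` obeys it at every level `T ≥ 0` (scale the table by `E₁/T`; `T = 0` forces the slice to
vanish). [folklore] -/
theorem insScaleBoundLevel_of_homog {W : Set (ℕ → ℝ)} {κ E₁ c ω : ℝ} (hhom : M.InsHomog W)
    (hunit : M.InsScaleBound W κ E₁ c ω) (hE₁ : 0 < E₁) : M.InsScaleBoundLevel W κ c ω := by
  intro k g hg U t j T hjk hT hsupp hlev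
  rcases hT.eq_or_lt with hT0 | hTpos
  · have ht0 : t = 0 := funext fun Y => by
      by_cases hY : C.scale Y = j
      · have h := hlev Y hY
        rw [← hT0, zero_mul] at h
        exact abs_nonpos_iff.1 h
      · exact hsupp Y hY
    rw [ht0, sub_self, norm_zero, ← hT0, mul_zero, mul_zero, mul_zero]
  · have hq : 0 < T / E₁ := div_pos hTpos hE₁
    have hq' : 0 < E₁ / T := div_pos hE₁ hTpos
    have hone : T / E₁ * (E₁ / T) = 1 := by
      rw [div_mul_div_comm, mul_comm T E₁, div_self (mul_ne_zero hE₁.ne' hTpos.ne')]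
    have hsupp' : ∀ Y, C.scale Y ≠ j → ((E₁ / T) • t) Y = 0 := fun Y hY => by
      rw [Pi.smul_apply, smul_eq_mul, hsupp Y hY, mul_zero]
    have hlev' : ∀ Y, C.scale Y = j → |((E₁ / T) • t) Y| ≤ E₁ * Real.exp (-(κ * C.d Y)) := fun Y hY => by
      rw [Pi.smul_apply, smul_eq_mul, abs_mul, abs_of_pos hq']
      calc E₁ / T * |t Y| ≤ E₁ / T * (T * Real.exp (-(κ * C.d Y))) := mul_le_mul_of_nonneg_left (hlev Y hY) hq'.le
        _ = E₁ * Real.exp (-(κ * C.d Y)) := by rw [← mul_assoc, div_mul_cancel₀ _ hTpos.ne']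
    have hb := hunit k g hg U ((E₁ / T) • t) j hjk hsupp' hlev'
    have hh := hhom k g hg U (T / E₁) ((E₁ / T) • t)
    rw [smul_smul, hone, one_smul] at hh
    rw [hh, norm_smul, Complex.norm_real, Real.norm_eq_abs, abs_of_pos hq]
    calc T / E₁ * ‖M.insA g U k ((E₁ / T) • t) - M.insA g U k 0‖
        ≤ T / E₁ * (M.rHist k * (c * (ω ^ (k - 1 - j) * E₁))) := mul_le_mul_of_nonneg_left hb hq.le
      _ = M.rHist k * (c * (ω ^ (k - 1 - j) * T)) := by
          have hE : T / E₁ * E₁ = T := div_mul_cancel₀ T hE₁.ne'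
          calc T / E₁ * (M.rHist k * (c * (ω ^ (k - 1 - j) * E₁)))
              = T / E₁ * E₁ * (M.rHist k * (c * ω ^ (k - 1 - j))) := by ring
            _ = M.rHist k * (c * (ω ^ (k - 1 - j) * T)) := by rw [hE]; ring

/-- **G-ne5p1-3a′ from printed STRUCTURE + the displayed single-scale term**: `InsAffine ∧ InsBlind ∧ InsHomog ∧
InsScaleBound κ E₁ c ω` (`E₁ > 0`) ⟹ `SizeDampedNat κ c ω`. [folklore] -/
theorem sizeDampedNat_of_scaleBound {W : Set (ℕ → ℝ)} {κ E₁ c ω : ℝ} (haff : M.InsAffine W) (hblind : M.InsBlind W)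
    (hhom : M.InsHomog W) (hunit : M.InsScaleBound W κ E₁ c ω) (hE₁ : 0 < E₁) : M.SizeDampedNat W κ c ω :=
  M.sizeDampedNat_of_scaleBoundLevel haff hblind (M.insScaleBoundLevel_of_homog hhom hunit hE₁)

/-- NE5 (near regime, printed age normalisation) with `InsertionDampedNat` replaced by `InsAffine ∧ InsBlind ∧
InsScaleBoundLevel`. [folklore] -/
theorem ne5_of_stepModel_scaleLevel_near_nat {EA : Functional C C.BgA} {EB : Functional C C.BgB} {W : Set (ℕ → ℝ)}
    {κ G EA₀ E₀ δ δ' θ c ω ρ₀ B : ℝ} {k₀ : ℕ} (hrA : M.RepresentsA EA W) (hrB : M.RepresentsB EB W)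
    (hbase : M.InBase EB W) (henv : M.OutputEnvelope W κ G) (hdA : DecayBound EA W EA₀ κ)
    (hdB : DecayBound EB W E₀ κ) (hop : M.OperatorRate W δ θ) (hins : M.InsertionRate W κ E₀ δ' θ)
    (haff : M.InsAffine W) (hblind : M.InsBlind W) (hlevel : M.InsScaleBoundLevel W κ c ω) (hG : 0 ≤ G)
    (hδ : 0 ≤ δ + δ') (hθ : 0 ≤ θ) (hθ1 : θ ≤ 1) (hc : 0 ≤ c) (hω : 0 < ω) (hρ₀ : ρ₀ < 1)
    (hnear : (δ + δ') * θ ^ k₀ + c * (EA₀ + E₀) / (1 - ω) ≤ ρ₀) (hB : 0 ≤ B) (hfirst : ∀ k < k₀, EA₀ + E₀ ≤ B * θ ^ k)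
    (hsmall : ω + G / (1 - ρ₀) * c < θ) :
    NE5 EA EB W κ θ ((G / (1 - ρ₀) * (δ + δ') + B) * (θ - ω) / (θ - (ω + G / (1 - ρ₀) * c))) :=
  M.ne5_of_stepModel_near_nat hrA hrB hbase henv hdA hdB hop hins
    (M.insertionDampedNat_of_affine haff (M.sizeDampedNat_of_scaleBoundLevel haff hblind hlevel)) hG hδ hθ hθ1 hc hω hρ₀
    hnear hB hfirst hsmall

/-- **NE5 (near regime, printed age normalisation) FROM PRINTED STRUCTURE + THE DISPLAYED SINGLE-SCALE TERM**: the model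
hypotheses of `ne5_of_stepModel_near_nat` with `InsertionDampedNat κ c ω` replaced by `InsAffine ∧ InsBlind ∧ InsHomog ∧
InsScaleBound κ E₁ c ω` (`E₁ > 0`).  Same smallness `ω + Gc/(1 − ρ₀) < θ`, same constant. [folklore] -/
theorem ne5_of_stepModel_scale_near_nat {EA : Functional C C.BgA} {EB : Functional C C.BgB} {W : Set (ℕ → ℝ)}
    {κ G EA₀ E₀ E₁ δ δ' θ c ω ρ₀ B : ℝ} {k₀ : ℕ} (hrA : M.RepresentsA EA W) (hrB : M.RepresentsB EB W)
    (hbase : M.InBase EB W) (henv : M.OutputEnvelope W κ G) (hdA : DecayBound EA W EA₀ κ)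
    (hdB : DecayBound EB W E₀ κ) (hop : M.OperatorRate W δ θ) (hins : M.InsertionRate W κ E₀ δ' θ)
    (haff : M.InsAffine W) (hblind : M.InsBlind W) (hhom : M.InsHomog W) (hunit : M.InsScaleBound W κ E₁ c ω)
    (hE₁ : 0 < E₁) (hG : 0 ≤ G) (hδ : 0 ≤ δ + δ') (hθ : 0 ≤ θ) (hθ1 : θ ≤ 1) (hc : 0 ≤ c) (hω : 0 < ω) (hρ₀ : ρ₀ < 1)
    (hnear : (δ + δ') * θ ^ k₀ + c * (EA₀ + E₀) / (1 - ω) ≤ ρ₀) (hB : 0 ≤ B) (hfirst : ∀ k < k₀, EA₀ + E₀ ≤ B * θ ^ k)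
    (hsmall : ω + G / (1 - ρ₀) * c < θ) :
    NE5 EA EB W κ θ ((G / (1 - ρ₀) * (δ + δ') + B) * (θ - ω) / (θ - (ω + G / (1 - ρ₀) * c))) :=
  M.ne5_of_stepModel_near_nat hrA hrB hbase henv hdA hdB hop hins
    (M.insertionDampedNat_of_affine haff (M.sizeDampedNat_of_scaleBound haff hblind hhom hunit hE₁)) hG hδ hθ hθ1 hc hω
    hρ₀ hnear hB hfirst hsmall

end StepModel

/-- ANY SLOWER RATE (v1 `recursiveRate_mono_rate` + `ne5_of_recursiveRate`): a recursive budget at input rate `θ` closes to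
NE5 at every rate `θ′ ≥ θ` beating the history feedback, `(1 + b)ω < θ′` — the smallness constrains the OUTPUT rate, not the
input rate. [folklore] -/
theorem ne5_at_of_recursiveRate {EA : Functional C C.BgA} {EB : Functional C C.BgB} {W : Set (ℕ → ℝ)}
    {κ θ θ' ω A b : ℝ} (hA : 0 ≤ A) (hb : 0 ≤ b) (hω : 0 ≤ ω) (hθ : 0 ≤ θ) (hθθ' : θ ≤ θ')
    (hsmall : (1 + b) * ω < θ') (h : RecursiveRate EA EB W κ θ ω A b) :
    NE5 EA EB W κ θ' (A * (θ' - ω) / (θ' - (1 + b) * ω)) :=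
  ne5_of_recursiveRate hA hb hω hsmall (recursiveRate_mono_rate hA hθ hθθ' h)

namespace StepModel

variable (M : StepModel C Op Hist)

/-- **NE5 AT ANY SLOWER RATE, near regime, printed age normalisation.**  Inputs (`OperatorRate`, `InsertionRate`, the near
hypothesis, the first scales) at rate `θ`; output NE5 at every `θ′ ∈ [θ, 1]` with `ω + Gc/(1 − ρ₀) < θ′`, constant
`(G(δ + δ′)/(1 − ρ₀) + B)(θ′ − ω)/(θ′ − (ω + Gc/(1 − ρ₀)))`.  [analysis] This is the kernel form of the census sentence
"the NE5 rate delivered is `max(θ_op, ω + K′ν + slack)`" (module docstring NUMBERS (c)–(d)). [folklore] -/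
theorem ne5_at_of_stepModel_near_nat {EA : Functional C C.BgA} {EB : Functional C C.BgB} {W : Set (ℕ → ℝ)}
    {κ G EA₀ E₀ δ δ' θ θ' c ω ρ₀ B : ℝ} {k₀ : ℕ} (hrA : M.RepresentsA EA W) (hrB : M.RepresentsB EB W)
    (hbase : M.InBase EB W) (henv : M.OutputEnvelope W κ G) (hdA : DecayBound EA W EA₀ κ)
    (hdB : DecayBound EB W E₀ κ) (hop : M.OperatorRate W δ θ) (hins : M.InsertionRate W κ E₀ δ' θ)
    (hdamp : M.InsertionDampedNat W κ c ω) (hG : 0 ≤ G) (hδ : 0 ≤ δ + δ') (hθ : 0 ≤ θ) (hθθ' : θ ≤ θ')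
    (hθ'1 : θ' ≤ 1) (hc : 0 ≤ c) (hω : 0 < ω) (hρ₀ : ρ₀ < 1)
    (hnear : (δ + δ') * θ ^ k₀ + c * (EA₀ + E₀) / (1 - ω) ≤ ρ₀) (hB : 0 ≤ B) (hfirst : ∀ k < k₀, EA₀ + E₀ ≤ B * θ ^ k)
    (hsmall : ω + G / (1 - ρ₀) * c < θ') :
    NE5 EA EB W κ θ' ((G / (1 - ρ₀) * (δ + δ') + B) * (θ' - ω) / (θ' - (ω + G / (1 - ρ₀) * c))) := by
  have h1ρ₀ : 0 < 1 - ρ₀ := by linarith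
  have hb : 0 ≤ G / (1 - ρ₀) * c := mul_nonneg (div_nonneg hG h1ρ₀.le) hc
  have hω1 : ω < 1 := by linarith
  have h1 : (1 + G / (1 - ρ₀) * (c / ω)) * ω = ω + G / (1 - ρ₀) * c := by
    rw [add_mul, one_mul, mul_assoc (G / (1 - ρ₀)), div_mul_cancel₀ c hω.ne']
  have h2 : c / ω * (EA₀ + E₀) * (ω / (1 - ω)) = c * (EA₀ + E₀) / (1 - ω) := by
    rw [← mul_div_assoc, div_mul_eq_mul_div, div_mul_cancel₀ _ hω.ne']
  have hrec := M.recursiveRate_of_stepModel_near hrA hrB hbase henv hdA hdB hop hins (M.insertionDamped_of_nat hdamp hω)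
    hδ hθ (hθθ'.trans hθ'1) (div_nonneg hc hω.le) hω.le hω1 hρ₀ (by rw [h2]; exact hnear) hB hfirst
  have key := ne5_at_of_recursiveRate (add_nonneg (mul_nonneg (div_nonneg hG h1ρ₀.le) hδ) hB)
    (mul_nonneg (div_nonneg hG h1ρ₀.le) (div_nonneg hc hω.le)) hω.le hθ hθθ' (by rw [h1]; exact hsmall) hrec
  rwa [h1] at key

/-- **EXISTENCE OF A RATE NEEDS ONLY ROOM**: under the model hypotheses at an input rate `θ < 1`, the single condition
`ω + Gc/(1 − ρ₀) < 1` (history damping plus feedback gain below one — [analysis] in B13's bookkeeping `ω + K′ν < 1`, met by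
the printed `ν ≤ ½` once the history-box scaling λ has room, NUMBERS (d)) yields SOME rate `θ′ < 1` and constant with
`NE5 EA EB W κ θ′ C₅` (witness `θ′ = max(θ, (ω + Gc/(1 − ρ₀) + 1)/2)`).  The SIZE of the exponent is what the cell's
smallness item S-ν′ restricts; its existence is not conditioned by ε₁ beyond room. [folklore] -/
theorem exists_rate_of_stepModel_near_nat {EA : Functional C C.BgA} {EB : Functional C C.BgB} {W : Set (ℕ → ℝ)}
    {κ G EA₀ E₀ δ δ' θ c ω ρ₀ B : ℝ} {k₀ : ℕ} (hrA : M.RepresentsA EA W) (hrB : M.RepresentsB EB W)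
    (hbase : M.InBase EB W) (henv : M.OutputEnvelope W κ G) (hdA : DecayBound EA W EA₀ κ)
    (hdB : DecayBound EB W E₀ κ) (hop : M.OperatorRate W δ θ) (hins : M.InsertionRate W κ E₀ δ' θ)
    (hdamp : M.InsertionDampedNat W κ c ω) (hG : 0 ≤ G) (hδ : 0 ≤ δ + δ') (hθ : 0 ≤ θ) (hθ1 : θ < 1) (hc : 0 ≤ c)
    (hω : 0 < ω) (hρ₀ : ρ₀ < 1) (hnear : (δ + δ') * θ ^ k₀ + c * (EA₀ + E₀) / (1 - ω) ≤ ρ₀) (hB : 0 ≤ B)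
    (hfirst : ∀ k < k₀, EA₀ + E₀ ≤ B * θ ^ k) (hroom : ω + G / (1 - ρ₀) * c < 1) :
    ∃ θ', θ' < 1 ∧ ∃ C₅, NE5 EA EB W κ θ' C₅ :=
  ⟨max θ ((ω + G / (1 - ρ₀) * c + 1) / 2), max_lt hθ1 (by linarith), _,
    M.ne5_at_of_stepModel_near_nat hrA hrB hbase henv hdA hdB hop hins hdamp hG hδ hθ (le_max_left _ _)
      (max_le hθ1.le (by linarith)) hc hω hρ₀ hnear hB hfirst (lt_max_of_lt_right (by linarith))⟩

end StepModel

end ScaleResolution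

/-! ## §10 (file v4, ADDITIVE) The toy, scale-resolved; the toy at a slower rate -/

section ToyScale

/-- Toy: the insertion reads only the previous scale, hence only scales `< k`. [folklore] -/
theorem toy_insBlind : toyModel.InsBlind Set.univ := by
  intro k g _ U t t' htt'
  show toyIns k t = toyIns k t'
  unfold toyIns
  split_ifs with h
  · rfl
  · rw [htt' (k - 1) (by change k - 1 < k; omega)]

/-- Toy: the insertion (linear, `toy_insLinear`) is real-homogeneous. [folklore] -/
theorem toy_insHomog : toyModel.InsHomog Set.univ := by
  intro k g _ U a t
  show toyIns k (a • t) - toyIns k 0 = (a : ℂ) • (toyIns k t - toyIns k 0)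
  unfold toyIns
  split_ifs with h
  · simp
  · simp only [Pi.smul_apply, smul_eq_mul, Pi.zero_apply, mul_zero, Complex.ofReal_zero, sub_zero]
    push_cast
    ring

/-- Toy: the SINGLE-SCALE size bound at the reference level `3` with natural gain `1/64`, at every damping `ω ≥ 0` (the toy
reads only the newest scale `j = k − 1`, weight `ω⁰ = 1`; older slices are not read at all). [folklore] -/
theorem toy_insScaleBound {ω : ℝ} (hω : 0 ≤ ω) : toyModel.InsScaleBound Set.univ 0 3 (1 / 64) ω := by
  intro k g _ U t j hjk hsupp hlev
  show ‖toyIns k t - toyIns k 0‖ ≤ 1 * (1 / 64 * (ω ^ (k - 1 - j) * 3))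
  have hk : k ≠ 0 := by omega
  simp only [toyIns, hk, if_false, Pi.zero_apply, mul_zero, Complex.ofReal_zero, sub_zero]
  rw [Complex.norm_real, Real.norm_eq_abs, abs_mul, abs_of_pos (by norm_num : (0 : ℝ) < 1 / 64), one_mul]
  by_cases hj : j = k - 1
  · subst hj
    have h3 : |t (k - 1)| ≤ 3 * Real.exp (-(0 * toyCarriers.d (k - 1))) := hlev (k - 1) rfl
    rw [zero_mul, neg_zero, Real.exp_zero, mul_one] at h3
    rw [Nat.sub_self, pow_zero, one_mul]
    linarith
  · have h0 : t (k - 1) = 0 := hsupp (k - 1) (by change k - 1 ≠ j; omega)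
    rw [h0, abs_zero, mul_zero]
    exact mul_nonneg (by norm_num) (mul_nonneg (pow_nonneg hω _) (by norm_num))

/-- Toy: hence the single-scale bound at every level (homogeneity). [folklore] -/
theorem toy_insScaleBoundLevel {ω : ℝ} (hω : 0 ≤ ω) : toyModel.InsScaleBoundLevel Set.univ 0 (1 / 64) ω :=
  toyModel.insScaleBoundLevel_of_homog toy_insHomog (toy_insScaleBound hω) (by norm_num)

/-- Toy: the summed size bound `SizeDampedNat` at damping `1/64` RE-DERIVED structurally (scale resolution; §6
`toy_sizeDampedNat` proved the sharper `ω = 0` form by hand). [folklore] -/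
theorem toy_sizeDampedNat_scale : toyModel.SizeDampedNat Set.univ 0 (1 / 64) (1 / 64) :=
  toyModel.sizeDampedNat_of_scaleBound toy_insAffine toy_insBlind toy_insHomog (toy_insScaleBound (by norm_num))
    (by norm_num)

/-- **The scale-resolved structural chain is jointly satisfiable and produces the near-regime NE5** (`G = EA₀ = E₀ = 3`,
reference level `E₁ = 3`, `δ = 1`, `δ′ = 0`, `θ = 1/2`, natural gain `c = 1/64`, `ω = 1/64`, `k₀ = 2`, `ρ₀ = 1/2`, `B = 12`;
smallness `1/64 + 6·(1/64) = 7/64 < 1/2`; constant `= 558/25`, the value of `toy_ne5Data_near`). [folklore] -/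
theorem toy_ne5Data_scale_near : NE5 toyEA₂ toyEB (Set.univ : Set (ℕ → ℝ)) 0 (1 / 2)
    ((3 / (1 - 1 / 2) * (1 + 0) + 12) * (1 / 2 - 1 / 64) / (1 / 2 - (1 / 64 + 3 / (1 - 1 / 2) * (1 / 64)))) :=
  toyModel.ne5_of_stepModel_scale_near_nat (ρ₀ := 1 / 2) (B := 12) (k₀ := 2) toy_representsA toy_representsB toy_inBase
    toy_outputEnvelope toy_decayA toy_decayB toy_operatorRate toy_insertionRate toy_insAffine toy_insBlind toy_insHomog
    (toy_insScaleBound (by norm_num)) (by norm_num) (by norm_num) (by norm_num) (by norm_num) (by norm_num) (by norm_num)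
    (by norm_num) (by norm_num) (by norm_num) (by norm_num) (fun k hk => by interval_cases k <;> norm_num) (by norm_num)

/-- The scale-resolved toy constant in lowest terms. [folklore] -/
example : ((3 / (1 - 1 / 2) * (1 + 0) + 12) * (1 / 2 - 1 / 64) / (1 / 2 - (1 / 64 + 3 / (1 - 1 / 2) * (1 / 64))) : ℝ) =
    558 / 25 := by norm_num

/-- **The toy at a SLOWER rate**: inputs at rate `1/2`, NE5 delivered at rate `3/4` (constant `= 846/41`). [folklore] -/
theorem toy_ne5Data_at : NE5 toyEA₂ toyEB (Set.univ : Set (ℕ → ℝ)) 0 (3 / 4)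
    ((3 / (1 - 1 / 2) * (1 + 0) + 12) * (3 / 4 - 1 / 64) / (3 / 4 - (1 / 64 + 3 / (1 - 1 / 2) * (1 / 64)))) :=
  toyModel.ne5_at_of_stepModel_near_nat (ρ₀ := 1 / 2) (B := 12) (k₀ := 2) toy_representsA toy_representsB toy_inBase
    toy_outputEnvelope toy_decayA toy_decayB toy_operatorRate toy_insertionRate toy_insertionDampedNat (by norm_num)
    (by norm_num) (by norm_num) (by norm_num) (by norm_num) (by norm_num) (by norm_num) (by norm_num) (by norm_num)
    (by norm_num) (fun k hk => by interval_cases k <;> norm_num) (by norm_num)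

/-- The slower-rate toy constant in lowest terms. [folklore] -/
example : ((3 / (1 - 1 / 2) * (1 + 0) + 12) * (3 / 4 - 1 / 64) / (3 / 4 - (1 / 64 + 3 / (1 - 1 / 2) * (1 / 64))) : ℝ) =
    846 / 41 := by norm_num

/-- **The toy has SOME rate by room alone** (`7/64 < 1`). [folklore] -/
theorem toy_exists_rate : ∃ θ', θ' < 1 ∧ ∃ C₅, NE5 toyEA₂ toyEB (Set.univ : Set (ℕ → ℝ)) 0 θ' C₅ :=
  toyModel.exists_rate_of_stepModel_near_nat (ρ₀ := 1 / 2) (B := 12) (k₀ := 2) toy_representsA toy_representsB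
    toy_inBase toy_outputEnvelope toy_decayA toy_decayB toy_operatorRate toy_insertionRate toy_insertionDampedNat
    (by norm_num) (by norm_num) (by norm_num) (by norm_num) (by norm_num) (by norm_num) (by norm_num) (by norm_num)
    (by norm_num) (fun k hk => by interval_cases k <;> norm_num) (by norm_num)

end ToyScale

/-! ## §11 (file v5, ADDITIVE) LINE / FIBRE RESOLUTION of the output envelope: the located input gap of node U3 in the
## printed ONE-PARAMETER form, and the DATA-LIPSCHITZ form the recursion consumes

The one located input gap of node U3 in this typing is `OutputEnvelope κ G` (G-ne5p1-1′ ≡ G-ne5p2-3): JOINT complex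
differentiability of the data ↦ output map on the two-margin box around admissible data, with the (2.41)-type bound there.
Print's own Cauchy parameters are ONE-DIMENSIONAL, one per deformed object: [Balaban1988RG2Cluster] p. 5 [R] *"To estimate
a term in the sum (1.10) we use the Cauchy formula, hence we have to investigate analyticity properties of the functions
E(⋯) with respect to the variables s(Y₀)."*, *"the parameters s(Y₀) are complex valued and satisfy the bound |s(Δ)| ≤ e^{κ₁}
for Δ ⊂ Y₀∖□̃⁴, κ₁ is a sufficiently big positive number."*, *"Thus the function H(s(Y₀))X is an analytic function of the
variables s(Y₀) on the domain |s(Y₀)| ≤ e^{κ₁}, bounded by B₀e^{16κ₁}|X| in all norms of Theorems 3.1.–3.10 [13]."* (the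
operators deformed: p. 3 [R] *"we multiply the term in (1.6) corresponding to ω by s(Δ₁)·…·s(Δ_m). This way the s-dependent
propagators H(s), G̃(s), H₀(s) are defined."*); p. 7 [R] *"We differentiate it with respect to t_□, at t_□ = 0, and we
represent all derivatives by the Cauchy formula."*, *"where the t_□-integration is over the circle (1.22), and the
σ(Δ)-integrations are over the circles |σ(Δ)| = e^{κ₁}."*; p. 15 [R] *"We consider it as an analytic function of (U, J) in
the space U^c_{k+1}(X, α₀, α₁), and of the complex parameters σ(Z), τ."* (the potentials deformed: the factors τ(Y)V_k(Y, B)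
of (2.14) on the circles (2.18) p. 16); and [Balaban1987RG1] p. 280 (3.54) [R] deforms the BACKGROUND along one direction B
with a circle parameter σ: *"sup_{r∈[0,1]}|∮_{|σ|=r}dσ σ^{−6}E^{(j)}(X,U_j(□₀,exp i(τB+σB)))| ≤ E₀α₃^{−5}|B|⁵exp(−κd_j(X))"*.
The PUBLISHED template of the move "interpolate ONE parameter on a complex circle and apply the Cauchy formula to the
difference" is Dimock's (quoted in the citation header of `Dimock2015.AnalyticLipschitz`, whose
`norm_sub_le_div_of_bound_sphere` is the kernel form used below; template literature, outside the audited series).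

[analysis] So the printed mechanism never uses joint (infinite-dimensional) holomorphy as a STATEMENT: per input species it
uses analyticity and the one-run bound ALONG ONE-PARAMETER COMPLEX DEFORMATIONS of admissible data staying inside that
species' margin.  §11 re-types the wall accordingly — `OpFibreEnvelope κ G` (operator data deformed affinely, `o + ζu`,
`|ζ| ≤ 1`, `‖u‖ ≤ rOp`, at a fixed admissible history) and `HistFibreEnvelope κ G` (inserted history deformed affinely,
`h + ζv`, `‖v‖ ≤ rHist`, at fixed admissible operators) — and isolates what the scale recursion CONSUMES: `DataLipschitz κ Λ
ρ₀`, a two-point Lipschitz bound of the one-step output in MARGIN UNITS within relative reach `ρ₀` of admissible data.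
Kernel: joint ⟹ fibrewise (`opFibreEnvelope_of_outputEnvelope`, `histFibreEnvelope_of_outputEnvelope`: coordinate lines
stay in the box); fibrewise ⟹ Lipschitz with `Λ = G/(1 − ρ₀)` (`dataLipschitz_of_fibreEnvelopes`: the two legs
`(o_B, h_B) → (o_A, h_B) → (o_A, h_A)` — [King1986] p. 665, quoted in the module header: the difference "on one line" at a
time — with ONE unit-disc Cauchy estimate `norm_sub_le_of_unitDisc` per leg); Lipschitz ⟹ the recursion
(`recursiveRate_of_stepModel_lip`: the §7 proof with the Cauchy block replaced by the hypothesis — NO analyticity, NO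
envelope, NO `ρ₀ < 1` among its hypotheses) and the closures `ne5_at_of_stepModel_lip_nat`, `ne5_at_of_stepModel_fibre_scale_nat`
(every wall of the route in its most primitive typed form).  STATUS of the re-typed wall: STILL NOT PRINTED as a
parametrised statement (cell item G-ne5p1-1″, the fibre form of G-ne5p1-1′: the one-run bound (2.41) p. 21 is printed AT
admissible data; its persistence, with analyticity, along complex one-parameter deformations of the step's input OPERATORS
within (2.16)–(2.17)-type margins and of the inserted HISTORY within the (2.18) budget is the printed Cauchy mechanism of
p. 5 / p. 7 / p. 15 applied to a SUBSTITUTED deformation — s(Y₀)-interpolation ↦ margin-bounded affine operator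
deformation, τ(Y)-circles ↦ affine history deformation — i.e. a printed proof re-read with substituted variables, which under
the cell's rule is NOT PRINTED); `DataLipschitz` itself corresponds to nothing printed ((2.41) bounds ONE run).  Census
S-ne5p1-ν′ UNCHANGED (module docstring NUMBERS (e)).  The analogous one-parameter pencil at node NE9 (coupling dependence of
the outputs) is the t4-ne4-p1 lineage's `T4HistoryLipschitzOuter` / `T4HistoryLipschitzActivity` (by name; not imported,
not restated). -/

section FibreResolution

variable {F : Type*} [NormedAddCommGroup F] [NormedSpace ℂ F]

/-- **ONE-VARIABLE CAUCHY TWO-POINT BOUND ON THE UNIT DISC.**  `f : ℂ → F` complex differentiable on the closed unit disc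
with `‖f‖ ≤ G` there, `0 ≤ ρ < 1` real: `‖f ρ − f 0‖ ≤ Gρ/(1 − ρ)` — `Dimock2015.norm_sub_le_div_of_bound_sphere` for
`w ↦ f(ρw)` on the disc of radius `1/ρ > 1`.  (The §1/§7 line lemmas are this bound composed with the two-species line; here
it is isolated because §11 deforms ONE species at a time.) [folklore] -/
theorem norm_sub_le_of_unitDisc [CompleteSpace F] {f : ℂ → F} {G ρ : ℝ} (hf : DifferentiableOn ℂ f (closedBall 0 1))
    (hG : ∀ ζ ∈ closedBall (0 : ℂ) 1, ‖f ζ‖ ≤ G) (hρ0 : 0 ≤ ρ) (hρ1 : ρ < 1) :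
    ‖f ρ - f 0‖ ≤ G * ρ / (1 - ρ) := by
  rcases hρ0.eq_or_lt with hzero | hpos
  · subst hzero
    simp
  · set R := 1 / ρ with hR_def
    have hρR : ρ * R = 1 := by rw [hR_def]; field_simp
    have hR1 : 1 < R := by rw [hR_def, lt_div_iff₀ hpos, one_mul]; exact hρ1
    have hmaps : MapsTo (fun w : ℂ => (ρ : ℂ) * w) (closedBall (0 : ℂ) R) (closedBall (0 : ℂ) 1) := by
      intro w hw
      rw [mem_closedBall, dist_zero_right] at hw ⊢
      rw [norm_mul, Complex.norm_real, Real.norm_eq_abs, abs_of_pos hpos]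
      calc ρ * ‖w‖ ≤ ρ * R := mul_le_mul_of_nonneg_left hw hpos.le
        _ = 1 := hρR
    have hg : DifferentiableOn ℂ (fun w : ℂ => f ((ρ : ℂ) * w)) (closedBall (0 : ℂ) R) :=
      hf.comp (by fun_prop) hmaps
    have hgM : ∀ t ∈ sphere (0 : ℂ) R, ‖(fun w : ℂ => f ((ρ : ℂ) * w)) t‖ ≤ G :=
      fun t ht => hG _ (hmaps (sphere_subset_closedBall ht))
    have hc := norm_sub_le_div_of_bound_sphere hR1 hg hgM
    simp only [mul_one, mul_zero] at hc
    have hden : 0 < R - 1 := by linarith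
    have h1ρ : 0 < 1 - ρ := by linarith
    calc ‖f ρ - f 0‖ ≤ G / (R - 1) := hc
      _ = G * ρ / (1 - ρ) := by
          rw [div_eq_div_iff hden.ne' h1ρ.ne']
          calc G * (1 - ρ) = G * (ρ * R - ρ) := by rw [hρR]
            _ = G * ρ * (R - 1) := by ring

/-- The near form: `0 ≤ ρ ≤ ρ₀ < 1` ⟹ `‖f ρ − f 0‖ ≤ (G/(1 − ρ₀))·ρ`. [folklore] -/
theorem norm_sub_le_of_unitDisc_near [CompleteSpace F] {f : ℂ → F} {G ρ ρ₀ : ℝ}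
    (hf : DifferentiableOn ℂ f (closedBall 0 1)) (hG : ∀ ζ ∈ closedBall (0 : ℂ) 1, ‖f ζ‖ ≤ G) (hρ0 : 0 ≤ ρ)
    (hρ₀ : ρ₀ < 1) (hρ : ρ ≤ ρ₀) : ‖f ρ - f 0‖ ≤ G / (1 - ρ₀) * ρ := by
  have hG0 : 0 ≤ G := (norm_nonneg _).trans (hG 0 (mem_closedBall_self zero_le_one))
  have h1ρ₀ : 0 < 1 - ρ₀ := by linarith
  calc ‖f ρ - f 0‖ ≤ G * ρ / (1 - ρ) := norm_sub_le_of_unitDisc hf hG hρ0 (lt_of_le_of_lt hρ hρ₀)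
    _ ≤ G * ρ / (1 - ρ₀) := div_le_div_of_nonneg_left (by positivity) h1ρ₀ (by linarith)
    _ = G / (1 - ρ₀) * ρ := by ring

variable {C : Carriers} {Op Hist : Type*} [NormedAddCommGroup Op] [NormedSpace ℂ Op] [NormedAddCommGroup Hist]
  [NormedSpace ℂ Hist]

namespace StepModel

variable (M : StepModel C Op Hist)

/-- HYPOTHESIS SHAPE `OpFibreEnvelope κ G` (the OPERATOR fibre of G-ne5p1-1′ = cell item G-ne5p1-1″ (operator half); NOT
PRINTED as a parametrised statement; printed mechanism: the s(Y₀)/σ(Δ)-analyticity of [II] p. 5 / p. 7 — complex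
one-parameter deformations OF THE OPERATORS under which the constructions stay analytic with their bounds — and (1.5) p. 3,
the step as a functional of its operators through their bounds; substitution: s-interpolation ↦ margin-bounded affine
deformation): at every base point `p`, for every history datum `h` in the history ball and every operator direction `u`
within the operator margin, the one-parameter function `ζ ↦ Out k (p.1 + ζ•u) h X` is complex differentiable on the closed
unit disc and obeys the one-run envelope `G·e^{−κd(X)}` there. [folklore] -/
def OpFibreEnvelope (W : Set (ℕ → ℝ)) (κ G : ℝ) : Prop :=
  ∀ k, ∀ g ∈ W, ∀ (U : C.BgB) (p : Op × Hist), p ∈ M.Base k g U → ∀ X : C.Dom, C.scale X = k →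
    ∀ h ∈ closedBall p.2 (M.rHist k), ∀ u : Op, ‖u‖ ≤ M.rOp k →
      DifferentiableOn ℂ (fun ζ : ℂ => M.Out k (p.1 + ζ • u) h X) (closedBall 0 1) ∧
        ∀ ζ ∈ closedBall (0 : ℂ) 1, ‖M.Out k (p.1 + ζ • u) h X‖ ≤ G * Real.exp (-(κ * C.d X))

/-- HYPOTHESIS SHAPE `HistFibreEnvelope κ G` (the HISTORY fibre of G-ne5p1-1′ = cell item G-ne5p1-1″ (history half); NOT
PRINTED as a parametrised statement; printed mechanism: the potentials enter each term (2.14) p. 15 of [II] as τ(Y)V_k(Y, B)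
with τ(Y) complex on the circles (2.18) p. 16, bounded through (2.15)/(2.20) — a complex one-parameter SCALING per potential;
substitution: per-Y scaling ↦ an affine deformation of the inserted history in a general direction `v` within the budget):
at every base point `p`, for every operator datum `o` in the operator ball and every history direction `v` within the history
margin, `ζ ↦ Out k o (p.2 + ζ•v) X` is complex differentiable on the closed unit disc and obeys the envelope there.
[folklore] -/
def HistFibreEnvelope (W : Set (ℕ → ℝ)) (κ G : ℝ) : Prop :=
  ∀ k, ∀ g ∈ W, ∀ (U : C.BgB) (p : Op × Hist), p ∈ M.Base k g U → ∀ X : C.Dom, C.scale X = k →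
    ∀ o ∈ closedBall p.1 (M.rOp k), ∀ v : Hist, ‖v‖ ≤ M.rHist k →
      DifferentiableOn ℂ (fun ζ : ℂ => M.Out k o (p.2 + ζ • v) X) (closedBall 0 1) ∧
        ∀ ζ ∈ closedBall (0 : ℂ) 1, ‖M.Out k o (p.2 + ζ • v) X‖ ≤ G * Real.exp (-(κ * C.d X))

/-- HYPOTHESIS SHAPE `DataLipschitz κ Λ ρ₀` — the CONSUMED form of the output wall (what ANY discharge of G-ne5p1-1′/1″ has
to hand to the scale recursion; corresponds to nothing printed: (2.41) p. 21 bounds ONE run, this compares the one step at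
TWO data points): at every base point `p` and every data point `q` within RELATIVE reach `ρ₀` of `p` in each species
(`‖q.1 − p.1‖ ≤ ρ₀·rOp`, `‖q.2 − p.2‖ ≤ ρ₀·rHist`), the outputs at a step-`k` domain differ by at most
`Λ·(‖q.1 − p.1‖/rOp + ‖q.2 − p.2‖/rHist)·e^{−κd(X)}` — Lipschitz modulus `Λ` in MARGIN UNITS, sum convention of §1.
(Not to be confused with the t4-ne4-p1 lineage's `T4HistoryLipschitzOuter.OutputLipschitz`, the NE9-node Lipschitz shape in
the potentials — by name only.) [folklore] -/
def DataLipschitz (W : Set (ℕ → ℝ)) (κ Λ ρ₀ : ℝ) : Prop :=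
  ∀ k, ∀ g ∈ W, ∀ (U : C.BgB) (p : Op × Hist), p ∈ M.Base k g U → ∀ X : C.Dom, C.scale X = k →
    ∀ q : Op × Hist, ‖q.1 - p.1‖ ≤ ρ₀ * M.rOp k → ‖q.2 - p.2‖ ≤ ρ₀ * M.rHist k →
      ‖M.Out k q.1 q.2 X - M.Out k p.1 p.2 X‖ ≤
        Λ * (‖q.1 - p.1‖ / M.rOp k + ‖q.2 - p.2‖ / M.rHist k) * Real.exp (-(κ * C.d X))

/-- JOINT ⟹ OPERATOR FIBRE: the coordinate line `ζ ↦ (p.1 + ζ•u, h)`, `|ζ| ≤ 1`, `‖u‖ ≤ rOp`, `h` in the history ball, stays in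
the two-margin box. [folklore] -/
theorem opFibreEnvelope_of_outputEnvelope {W : Set (ℕ → ℝ)} {κ G : ℝ} (henv : M.OutputEnvelope W κ G) :
    M.OpFibreEnvelope W κ G := by
  intro k g hg U p hp X hX h hh u hu
  obtain ⟨hdiff, hbd⟩ := henv k g hg U p hp X hX
  have hmaps : MapsTo (fun ζ : ℂ => (p.1 + ζ • u, h)) (closedBall (0 : ℂ) 1) (M.box k p) := by
    intro ζ hζ
    rw [mem_closedBall, dist_zero_right] at hζ
    refine Set.mk_mem_prod ?_ hh
    rw [mem_closedBall, dist_eq_norm, add_sub_cancel_left, norm_smul]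
    calc ‖ζ‖ * ‖u‖ ≤ 1 * M.rOp k := mul_le_mul hζ hu (norm_nonneg _) zero_le_one
      _ = M.rOp k := one_mul _
  have hcomp : DifferentiableOn ℂ ((fun z : Op × Hist => M.Out k z.1 z.2 X) ∘ fun ζ : ℂ => (p.1 + ζ • u, h))
      (closedBall (0 : ℂ) 1) := hdiff.comp (by fun_prop) hmaps
  exact ⟨hcomp, fun ζ hζ => hbd _ (hmaps hζ)⟩

/-- JOINT ⟹ HISTORY FIBRE, symmetrically. [folklore] -/
theorem histFibreEnvelope_of_outputEnvelope {W : Set (ℕ → ℝ)} {κ G : ℝ} (henv : M.OutputEnvelope W κ G) :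
    M.HistFibreEnvelope W κ G := by
  intro k g hg U p hp X hX o ho v hv
  obtain ⟨hdiff, hbd⟩ := henv k g hg U p hp X hX
  have hmaps : MapsTo (fun ζ : ℂ => (o, p.2 + ζ • v)) (closedBall (0 : ℂ) 1) (M.box k p) := by
    intro ζ hζ
    rw [mem_closedBall, dist_zero_right] at hζ
    refine Set.mk_mem_prod ho ?_
    rw [mem_closedBall, dist_eq_norm, add_sub_cancel_left, norm_smul]
    calc ‖ζ‖ * ‖v‖ ≤ 1 * M.rHist k := mul_le_mul hζ hv (norm_nonneg _) zero_le_one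
      _ = M.rHist k := one_mul _
  have hcomp : DifferentiableOn ℂ ((fun z : Op × Hist => M.Out k z.1 z.2 X) ∘ fun ζ : ℂ => (o, p.2 + ζ • v))
      (closedBall (0 : ℂ) 1) := hdiff.comp (by fun_prop) hmaps
  exact ⟨hcomp, fun ζ hζ => hbd _ (hmaps hζ)⟩

/-- **FIBREWISE ANALYTICITY ⟹ DATA-LIPSCHITZ WITH `Λ = G/(1 − ρ₀)`** (the two legs, one species at a time: operators moved at
the admissible history `p.2` — direction `u = (q.1 − p.1)/a`, `a = ‖q.1 − p.1‖/rOp ≤ ρ₀`, Cauchy on the unit disc at the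
point `ζ = a` — then the history moved at the reached operators `q.1 ∈ closedBall p.1 rOp` — direction `v = (q.2 − p.2)/b`,
`b = ‖q.2 − p.2‖/rHist ≤ ρ₀`; each leg `≤ (G/(1 − ρ₀))·(its relative displacement)·e^{−κd}`). [folklore] -/
theorem dataLipschitz_of_fibreEnvelopes {W : Set (ℕ → ℝ)} {κ G ρ₀ : ℝ} (hopF : M.OpFibreEnvelope W κ G)
    (hhistF : M.HistFibreEnvelope W κ G) (hρ₀ : ρ₀ < 1) : M.DataLipschitz W κ (G / (1 - ρ₀)) ρ₀ := by
  intro k g hg U p hp X hX q hq1 hq2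
  have hrOp := M.rOp_pos k
  have hrHist := M.rHist_pos k
  set a := ‖q.1 - p.1‖ / M.rOp k with ha_def
  set b := ‖q.2 - p.2‖ / M.rHist k with hb_def
  have ha0 : 0 ≤ a := by positivity
  have hb0 : 0 ≤ b := by positivity
  have hqa : ‖q.1 - p.1‖ = a * M.rOp k := by rw [ha_def, div_mul_cancel₀ _ hrOp.ne']
  have hqb : ‖q.2 - p.2‖ = b * M.rHist k := by rw [hb_def, div_mul_cancel₀ _ hrHist.ne']
  have haρ : a ≤ ρ₀ := le_of_mul_le_mul_right (by rw [← hqa]; exact hq1) hrOp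
  have hbρ : b ≤ ρ₀ := le_of_mul_le_mul_right (by rw [← hqb]; exact hq2) hrHist
  -- LEG 1: the operators, at the admissible history `p.2`
  have leg1 : ‖M.Out k q.1 p.2 X - M.Out k p.1 p.2 X‖ ≤ G * Real.exp (-(κ * C.d X)) / (1 - ρ₀) * a := by
    rcases ha0.eq_or_lt with hzero | hpos
    · have h0 : ‖q.1 - p.1‖ = 0 := by rw [hqa, ← hzero, zero_mul]
      rw [norm_eq_zero, sub_eq_zero] at h0
      rw [h0, sub_self, norm_zero, ← hzero, mul_zero]
    · have hne : (a : ℂ) ≠ 0 := Complex.ofReal_ne_zero.mpr hpos.ne'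
      set u : Op := (a : ℂ)⁻¹ • (q.1 - p.1) with hu_def
      have hu : ‖u‖ ≤ M.rOp k := by
        rw [hu_def, norm_smul, norm_inv, Complex.norm_real, Real.norm_eq_abs, abs_of_pos hpos, hqa,
          inv_mul_cancel_left₀ hpos.ne']
      obtain ⟨hdiff, hbd⟩ := hopF k g hg U p hp X hX p.2 (mem_closedBall_self hrHist.le) u hu
      have hend : p.1 + (a : ℂ) • u = q.1 := by
        rw [hu_def, smul_smul, mul_inv_cancel₀ hne, one_smul, add_sub_cancel]
      have key := norm_sub_le_of_unitDisc_near hdiff hbd ha0 hρ₀ haρ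
      beta_reduce at key
      rw [hend, zero_smul, add_zero] at key
      exact key
  -- LEG 2: the history, at the reached operators `q.1` (inside the operator ball since `ρ₀ < 1`)
  have ho : q.1 ∈ closedBall p.1 (M.rOp k) := by
    rw [mem_closedBall, dist_eq_norm, hqa]
    calc a * M.rOp k ≤ 1 * M.rOp k := mul_le_mul_of_nonneg_right (haρ.trans hρ₀.le) hrOp.le
      _ = M.rOp k := one_mul _
  have leg2 : ‖M.Out k q.1 q.2 X - M.Out k q.1 p.2 X‖ ≤ G * Real.exp (-(κ * C.d X)) / (1 - ρ₀) * b := by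
    rcases hb0.eq_or_lt with hzero | hpos
    · have h0 : ‖q.2 - p.2‖ = 0 := by rw [hqb, ← hzero, zero_mul]
      rw [norm_eq_zero, sub_eq_zero] at h0
      rw [h0, sub_self, norm_zero, ← hzero, mul_zero]
    · have hne : (b : ℂ) ≠ 0 := Complex.ofReal_ne_zero.mpr hpos.ne'
      set v : Hist := (b : ℂ)⁻¹ • (q.2 - p.2) with hv_def
      have hv : ‖v‖ ≤ M.rHist k := by
        rw [hv_def, norm_smul, norm_inv, Complex.norm_real, Real.norm_eq_abs, abs_of_pos hpos, hqb,
          inv_mul_cancel_left₀ hpos.ne']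
      obtain ⟨hdiff, hbd⟩ := hhistF k g hg U p hp X hX q.1 ho v hv
      have hend : p.2 + (b : ℂ) • v = q.2 := by
        rw [hv_def, smul_smul, mul_inv_cancel₀ hne, one_smul, add_sub_cancel]
      have key := norm_sub_le_of_unitDisc_near hdiff hbd hb0 hρ₀ hbρ
      beta_reduce at key
      rw [hend, zero_smul, add_zero] at key
      exact key
  calc ‖M.Out k q.1 q.2 X - M.Out k p.1 p.2 X‖
      ≤ ‖M.Out k q.1 q.2 X - M.Out k q.1 p.2 X‖ + ‖M.Out k q.1 p.2 X - M.Out k p.1 p.2 X‖ :=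
        norm_sub_le_norm_sub_add_norm_sub _ _ _
    _ ≤ G * Real.exp (-(κ * C.d X)) / (1 - ρ₀) * b + G * Real.exp (-(κ * C.d X)) / (1 - ρ₀) * a :=
        add_le_add leg2 leg1
    _ = G / (1 - ρ₀) * (a + b) * Real.exp (-(κ * C.d X)) := by ring

/-- JOINT ⟹ DATA-LIPSCHITZ (`Λ = G/(1 − ρ₀)`), by the two previous theorems. [folklore] -/
theorem dataLipschitz_of_outputEnvelope {W : Set (ℕ → ℝ)} {κ G ρ₀ : ℝ} (henv : M.OutputEnvelope W κ G) (hρ₀ : ρ₀ < 1) :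
    M.DataLipschitz W κ (G / (1 - ρ₀)) ρ₀ :=
  M.dataLipschitz_of_fibreEnvelopes (M.opFibreEnvelope_of_outputEnvelope henv) (M.histFibreEnvelope_of_outputEnvelope henv)
    hρ₀

/-- **THE STEP FROM THE DATA-LIPSCHITZ BOUND ALONE.**  The hypotheses of `recursiveRate_of_stepModel_near` with the output
envelope `OutputEnvelope κ G` REPLACED by `DataLipschitz κ Λ ρ₀` (+ `0 ≤ Λ`) and WITHOUT `ρ₀ < 1`: representation of the two
runs, admissibility of run B's data, the one-run decay bounds (levels `EA₀`, `E₀`), `OperatorRate δ θ`, `InsertionRate κ E₀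
δ′ θ`, `InsertionDamped κ c ω`, the near hypothesis `(δ + δ′)θ^{k₀} + c(EA₀ + E₀)ω/(1 − ω) ≤ ρ₀` and the first-scales bound
`EA₀ + E₀ ≤ Bθ^k (k < k₀)` ⟹ `RecursiveRate EA EB W κ θ ω (Λ(δ + δ′) + B) (Λc)`.  The proof is the §7 proof with the Cauchy
block replaced by the hypothesis: the recursion CONSUMES only the two-point bound in margin units; analyticity is one way to
supply it (`dataLipschitz_of_fibreEnvelopes`, `Λ = G/(1 − ρ₀)`). [folklore] -/
theorem recursiveRate_of_stepModel_lip {EA : Functional C C.BgA} {EB : Functional C C.BgB} {W : Set (ℕ → ℝ)}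
    {κ Λ EA₀ E₀ δ δ' θ c ω ρ₀ B : ℝ} {k₀ : ℕ} (hrA : M.RepresentsA EA W) (hrB : M.RepresentsB EB W)
    (hbase : M.InBase EB W) (hlip : M.DataLipschitz W κ Λ ρ₀) (hdA : DecayBound EA W EA₀ κ)
    (hdB : DecayBound EB W E₀ κ) (hop : M.OperatorRate W δ θ) (hins : M.InsertionRate W κ E₀ δ' θ)
    (hdamp : M.InsertionDamped W κ c ω) (hΛ : 0 ≤ Λ) (hδ : 0 ≤ δ + δ') (hθ : 0 ≤ θ) (hθ1 : θ ≤ 1) (hc : 0 ≤ c)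
    (hω : 0 ≤ ω) (hω1 : ω < 1) (hnear : (δ + δ') * θ ^ k₀ + c * (EA₀ + E₀) * (ω / (1 - ω)) ≤ ρ₀) (hB : 0 ≤ B)
    (hfirst : ∀ k < k₀, EA₀ + E₀ ≤ B * θ ^ k) :
    RecursiveRate EA EB W κ θ ω (Λ * (δ + δ') + B) (Λ * c) := by
  intro k D hD g hg U X hX
  -- the two data points
  set x₀ := M.opB g U k with hx₀
  set x₁ := M.opA g U k with hx₁
  set y₀ := M.insB g U k (tableB EB g U) with hy₀
  set y₁ := M.insA g U k (tableA EA g U) with hy₁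
  have hrOp := M.rOp_pos k
  have hrHist := M.rHist_pos k
  have hexp := Real.exp_pos (-(κ * C.d X))
  have hθk : 0 ≤ θ ^ k := pow_nonneg hθ k
  -- the one-run levels are nonnegative (read at the point at hand)
  have hEA₀ : 0 ≤ EA₀ := by
    by_contra hneg
    have : EA₀ * Real.exp (-(κ * C.d X)) < 0 := mul_neg_of_neg_of_pos (not_le.mp hneg) hexp
    linarith [abs_nonneg (EA g (C.transport U) X), hdA g hg (C.transport U) X]
  have hE₀ : 0 ≤ E₀ := by
    by_contra hneg
    have : E₀ * Real.exp (-(κ * C.d X)) < 0 := mul_neg_of_neg_of_pos (not_le.mp hneg) hexp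
    linarith [abs_nonneg (EB g U X), hdB g hg U X]
  -- the inherited levels, and the CAPPED levels `min (D j) (EA₀ + E₀)`
  set S := ∑ j ∈ range k, ω ^ (k - j) * D j with hS
  set S' := ∑ j ∈ range k, ω ^ (k - j) * min (D j) (EA₀ + E₀) with hS'
  have hD'0 : ∀ j < k, 0 ≤ min (D j) (EA₀ + E₀) := fun j hj => le_min (hD j hj).1 (add_nonneg hEA₀ hE₀)
  have hS'0 : 0 ≤ S' := sum_nonneg fun j hj => mul_nonneg (pow_nonneg hω _) (hD'0 j (mem_range.1 hj))
  have hS'S : S' ≤ S :=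
    sum_le_sum fun j hj => mul_le_mul_of_nonneg_left (min_le_left _ _) (pow_nonneg hω _)
  have hS'E : S' ≤ (EA₀ + E₀) * (ω / (1 - ω)) :=
    calc S' ≤ ∑ j ∈ range k, ω ^ (k - j) * (EA₀ + E₀) :=
          sum_le_sum fun j hj => mul_le_mul_of_nonneg_left (min_le_right _ _) (pow_nonneg hω _)
      _ = (EA₀ + E₀) * ∑ j ∈ range k, ω ^ (k - j) := by rw [mul_sum]; exact sum_congr rfl fun j _ => mul_comm _ _
      _ ≤ (EA₀ + E₀) * (ω / (1 - ω)) := mul_le_mul_of_nonneg_left (sum_pow_age_le hω hω1 k) (add_nonneg hEA₀ hE₀)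
  -- every earlier table discrepancy is bounded by the inherited level AND by the one-run levels
  have htab : ∀ Y, C.scale Y < k →
      |tableA EA g U Y - tableB EB g U Y| ≤ min (D (C.scale Y)) (EA₀ + E₀) * Real.exp (-(κ * C.d Y)) := by
    intro Y hY
    rw [min_mul_of_nonneg _ _ (Real.exp_pos _).le]
    refine le_min ((hD (C.scale Y) hY).2 g hg U Y rfl) ?_
    calc |tableA EA g U Y - tableB EB g U Y| ≤ |tableA EA g U Y| + |tableB EB g U Y| := abs_sub _ _
      _ ≤ EA₀ * Real.exp (-(κ * C.d Y)) + E₀ * Real.exp (-(κ * C.d Y)) := add_le_add (hdA g hg _ Y) (hdB g hg U Y)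
      _ = (EA₀ + E₀) * Real.exp (-(κ * C.d Y)) := by ring
  -- operator discrepancy in margin units (MI-1); history discrepancy from the CAPPED levels (MI-3a) + insertion rate
  have hxd : ‖x₁ - x₀‖ ≤ δ * θ ^ k * M.rOp k := hop k g hg U
  have hdamp' : ‖y₁ - M.insA g U k (tableB EB g U)‖ ≤ M.rHist k * (c * S') :=
    hdamp k g hg U (tableA EA g U) (tableB EB g U) (fun j => min (D j) (EA₀ + E₀)) hD'0 htab
  have hins' := hins k g hg U (tableB EB g U) (fun Y => hdB g hg U Y)
  have hyd : ‖y₁ - y₀‖ ≤ (c * S' + δ' * θ ^ k) * M.rHist k :=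
    calc ‖y₁ - y₀‖ ≤ ‖y₁ - M.insA g U k (tableB EB g U)‖ + ‖M.insA g U k (tableB EB g U) - y₀‖ :=
          norm_sub_le_norm_sub_add_norm_sub _ _ _
      _ ≤ M.rHist k * (c * S') + δ' * θ ^ k * M.rHist k := add_le_add hdamp' hins'
      _ = (c * S' + δ' * θ ^ k) * M.rHist k := by ring
  -- the relative displacement and its A-PRIORI budget
  set ρ := ‖x₁ - x₀‖ / M.rOp k + ‖y₁ - y₀‖ / M.rHist k with hρ_def
  have hρx : 0 ≤ ‖x₁ - x₀‖ / M.rOp k := by positivity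
  have hρy : 0 ≤ ‖y₁ - y₀‖ / M.rHist k := by positivity
  have hρβ : ρ ≤ (δ + δ') * θ ^ k + c * S' := by
    have h1 : ‖x₁ - x₀‖ / M.rOp k ≤ δ * θ ^ k := by rw [div_le_iff₀ hrOp]; exact hxd
    have h2 : ‖y₁ - y₀‖ / M.rHist k ≤ c * S' + δ' * θ ^ k := by rw [div_le_iff₀ hrHist]; exact hyd
    linarith
  have hρS : ρ ≤ (δ + δ') * θ ^ k + c * S := hρβ.trans (by nlinarith [mul_le_mul_of_nonneg_left hS'S hc])
  -- the two runs' outputs are the real parts of the step output at the two data points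
  have hdisc : disc EA EB g U X ≤ ‖M.Out k x₁ y₁ X - M.Out k x₀ y₀ X‖ := by
    have eA := hrA g hg U X
    have eB := hrB g hg U X
    rw [hX] at eA eB
    unfold disc
    rw [eA, eB, ← Complex.sub_re]
    exact Complex.abs_re_le_norm _
  -- bookkeeping of the history sum
  have hsum : ∑ j ∈ range k, Λ * c * ω ^ (k - j) * D j = Λ * c * S := by
    rw [hS, mul_sum]
    exact sum_congr rfl fun j _ => by ring
  have hS0 : 0 ≤ S := hS'0.trans hS'S
  by_cases hk : k < k₀
  · -- FIRST SCALES: the one-run bounds, absorbed by the constant B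
    calc disc EA EB g U X ≤ |EA g (C.transport U) X| + |EB g U X| := abs_sub _ _
      _ ≤ EA₀ * Real.exp (-(κ * C.d X)) + E₀ * Real.exp (-(κ * C.d X)) :=
          add_le_add (hdA g hg _ X) (hdB g hg U X)
      _ = (EA₀ + E₀) * Real.exp (-(κ * C.d X)) := by ring
      _ ≤ B * θ ^ k * Real.exp (-(κ * C.d X)) := mul_le_mul_of_nonneg_right (hfirst k hk) hexp.le
      _ ≤ ((Λ * (δ + δ') + B) * θ ^ k + ∑ j ∈ range k, Λ * c * ω ^ (k - j) * D j) * Real.exp (-(κ * C.d X)) := by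
          rw [hsum]
          apply mul_le_mul_of_nonneg_right _ hexp.le
          have h1 : 0 ≤ Λ * (δ + δ') * θ ^ k := mul_nonneg (mul_nonneg hΛ hδ) hθk
          have h2 : 0 ≤ Λ * c * S := mul_nonneg (mul_nonneg hΛ hc) hS0
          linarith
  · -- NEAR REGIME k ≥ k₀: each species is displaced by at most ρ₀ margins, and the Lipschitz bound applies
    push Not at hk
    have hθkk₀ : θ ^ k ≤ θ ^ k₀ := pow_le_pow_of_le_one hθ hθ1 hk
    have hρ1 : ρ ≤ ρ₀ :=
      calc ρ ≤ (δ + δ') * θ ^ k + c * S' := hρβ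
        _ ≤ (δ + δ') * θ ^ k₀ + c * ((EA₀ + E₀) * (ω / (1 - ω))) :=
            add_le_add (mul_le_mul_of_nonneg_left hθkk₀ hδ) (mul_le_mul_of_nonneg_left hS'E hc)
        _ = (δ + δ') * θ ^ k₀ + c * (EA₀ + E₀) * (ω / (1 - ω)) := by ring
        _ ≤ ρ₀ := hnear
    have hq1 : ‖x₁ - x₀‖ ≤ ρ₀ * M.rOp k := by
      have : ‖x₁ - x₀‖ / M.rOp k ≤ ρ₀ := (le_add_of_nonneg_right hρy).trans hρ1
      rwa [div_le_iff₀ hrOp] at this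
    have hq2 : ‖y₁ - y₀‖ ≤ ρ₀ * M.rHist k := by
      have : ‖y₁ - y₀‖ / M.rHist k ≤ ρ₀ := (le_add_of_nonneg_left hρx).trans hρ1
      rwa [div_le_iff₀ hrHist] at this
    have h2 : ‖M.Out k x₁ y₁ X - M.Out k x₀ y₀ X‖ ≤ Λ * ρ * Real.exp (-(κ * C.d X)) :=
      hlip k g hg U (M.dataB EB g U k) (hbase k g hg U) X hX (x₁, y₁) hq1 hq2
    calc disc EA EB g U X ≤ _ := hdisc
      _ ≤ Λ * ρ * Real.exp (-(κ * C.d X)) := h2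
      _ ≤ Λ * ((δ + δ') * θ ^ k + c * S) * Real.exp (-(κ * C.d X)) :=
          mul_le_mul_of_nonneg_right (mul_le_mul_of_nonneg_left hρS hΛ) hexp.le
      _ ≤ ((Λ * (δ + δ') + B) * θ ^ k + ∑ j ∈ range k, Λ * c * ω ^ (k - j) * D j) * Real.exp (-(κ * C.d X)) := by
          rw [hsum]
          apply mul_le_mul_of_nonneg_right _ hexp.le
          have h1 : 0 ≤ B * θ ^ k := mul_nonneg hB hθk
          linarith

/-- **NE5 AT ANY SLOWER RATE FROM THE DATA-LIPSCHITZ BOUND, printed age normalisation.**  Natural history gain `c` at damping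
`ω > 0` (`InsertionDampedNat`), inputs (`OperatorRate`, `InsertionRate`, the near hypothesis
`(δ + δ′)θ^{k₀} + c(EA₀ + E₀)/(1 − ω) ≤ ρ₀`, the first scales) at rate `θ`, output NE5 at every `θ′ ∈ [θ, 1]` with the
load-bearing smallness `ω + Λc < θ′`; constant `(Λ(δ + δ′) + B)(θ′ − ω)/(θ′ − (ω + Λc))`.  [analysis, module docstring NUMBERS
(e)] `Λc` is the Lipschitz modulus of the one-step output in the NEWEST previous action; on the Cauchy route `Λ = G/(1 − ρ₀)`
and `Λc ≤ K′ν` as in NUMBERS (d) — the census smallness S-ν′ is unchanged by this reformulation. [folklore] -/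
theorem ne5_at_of_stepModel_lip_nat {EA : Functional C C.BgA} {EB : Functional C C.BgB} {W : Set (ℕ → ℝ)}
    {κ Λ EA₀ E₀ δ δ' θ θ' c ω ρ₀ B : ℝ} {k₀ : ℕ} (hrA : M.RepresentsA EA W) (hrB : M.RepresentsB EB W)
    (hbase : M.InBase EB W) (hlip : M.DataLipschitz W κ Λ ρ₀) (hdA : DecayBound EA W EA₀ κ)
    (hdB : DecayBound EB W E₀ κ) (hop : M.OperatorRate W δ θ) (hins : M.InsertionRate W κ E₀ δ' θ)
    (hdamp : M.InsertionDampedNat W κ c ω) (hΛ : 0 ≤ Λ) (hδ : 0 ≤ δ + δ') (hθ : 0 ≤ θ) (hθθ' : θ ≤ θ')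
    (hθ'1 : θ' ≤ 1) (hc : 0 ≤ c) (hω : 0 < ω) (hnear : (δ + δ') * θ ^ k₀ + c * (EA₀ + E₀) / (1 - ω) ≤ ρ₀)
    (hB : 0 ≤ B) (hfirst : ∀ k < k₀, EA₀ + E₀ ≤ B * θ ^ k) (hsmall : ω + Λ * c < θ') :
    NE5 EA EB W κ θ' ((Λ * (δ + δ') + B) * (θ' - ω) / (θ' - (ω + Λ * c))) := by
  have hΛc : 0 ≤ Λ * c := mul_nonneg hΛ hc
  have hω1 : ω < 1 := by linarith
  have h1 : (1 + Λ * (c / ω)) * ω = ω + Λ * c := by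
    rw [add_mul, one_mul, mul_assoc Λ, div_mul_cancel₀ c hω.ne']
  have h2 : c / ω * (EA₀ + E₀) * (ω / (1 - ω)) = c * (EA₀ + E₀) / (1 - ω) := by
    rw [← mul_div_assoc, div_mul_eq_mul_div, div_mul_cancel₀ _ hω.ne']
  have hrec := M.recursiveRate_of_stepModel_lip hrA hrB hbase hlip hdA hdB hop hins (M.insertionDamped_of_nat hdamp hω)
    hΛ hδ hθ (hθθ'.trans hθ'1) (div_nonneg hc hω.le) hω.le hω1 (by rw [h2]; exact hnear) hB hfirst
  have key := ne5_at_of_recursiveRate (add_nonneg (mul_nonneg hΛ hδ) hB) (mul_nonneg hΛ (div_nonneg hc hω.le)) hω.le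
    hθ hθθ' (by rw [h1]; exact hsmall) hrec
  rwa [h1] at key

/-- **NE5 AT ANY SLOWER RATE WITH EVERY WALL IN ITS MOST PRIMITIVE TYPED FORM**: the two FIBRE envelopes (G-ne5p1-1″) in place
of the joint envelope, the structural insertion shapes `InsAffine ∧ InsBlind ∧ InsHomog` + the displayed single-scale term
`InsScaleBound κ E₁ c ω` (G-ne5p1-3a″) in place of the damped-Lipschitz insertion, and the two rates `OperatorRate δ θ` (MI-1),
`InsertionRate κ E₀ δ′ θ` (G-ne5p1-4); `Λ = G/(1 − ρ₀)`, smallness `ω + Gc/(1 − ρ₀) < θ′`, constant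
`(G(δ + δ′)/(1 − ρ₀) + B)(θ′ − ω)/(θ′ − (ω + Gc/(1 − ρ₀)))` (the formula of `ne5_at_of_stepModel_near_nat`). [folklore] -/
theorem ne5_at_of_stepModel_fibre_scale_nat {EA : Functional C C.BgA} {EB : Functional C C.BgB} {W : Set (ℕ → ℝ)}
    {κ G EA₀ E₀ E₁ δ δ' θ θ' c ω ρ₀ B : ℝ} {k₀ : ℕ} (hrA : M.RepresentsA EA W) (hrB : M.RepresentsB EB W)
    (hbase : M.InBase EB W) (hopF : M.OpFibreEnvelope W κ G) (hhistF : M.HistFibreEnvelope W κ G)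
    (hdA : DecayBound EA W EA₀ κ) (hdB : DecayBound EB W E₀ κ) (hop : M.OperatorRate W δ θ)
    (hins : M.InsertionRate W κ E₀ δ' θ) (haff : M.InsAffine W) (hblind : M.InsBlind W) (hhom : M.InsHomog W)
    (hunit : M.InsScaleBound W κ E₁ c ω) (hE₁ : 0 < E₁) (hG : 0 ≤ G) (hδ : 0 ≤ δ + δ') (hθ : 0 ≤ θ) (hθθ' : θ ≤ θ')
    (hθ'1 : θ' ≤ 1) (hc : 0 ≤ c) (hω : 0 < ω) (hρ₀ : ρ₀ < 1)
    (hnear : (δ + δ') * θ ^ k₀ + c * (EA₀ + E₀) / (1 - ω) ≤ ρ₀) (hB : 0 ≤ B) (hfirst : ∀ k < k₀, EA₀ + E₀ ≤ B * θ ^ k)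
    (hsmall : ω + G / (1 - ρ₀) * c < θ') :
    NE5 EA EB W κ θ' ((G / (1 - ρ₀) * (δ + δ') + B) * (θ' - ω) / (θ' - (ω + G / (1 - ρ₀) * c))) :=
  M.ne5_at_of_stepModel_lip_nat hrA hrB hbase (M.dataLipschitz_of_fibreEnvelopes hopF hhistF hρ₀) hdA hdB hop hins
    (M.insertionDampedNat_of_affine haff (M.sizeDampedNat_of_scaleBound haff hblind hhom hunit hE₁))
    (div_nonneg hG (by linarith)) hδ hθ hθθ' hθ'1 hc hω hnear hB hfirst hsmall

end StepModel

end FibreResolution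

/-! ## §12 (file v5, ADDITIVE) The toy along fibres: the exact Lipschitz modulus against Cauchy's -/

section ToyFibre

/-- Toy: the operator fibre envelope with `G = 3` (from the joint one). [folklore] -/
theorem toy_opFibreEnvelope : toyModel.OpFibreEnvelope Set.univ 0 3 :=
  toyModel.opFibreEnvelope_of_outputEnvelope toy_outputEnvelope

/-- Toy: the history fibre envelope with `G = 3`. [folklore] -/
theorem toy_histFibreEnvelope : toyModel.HistFibreEnvelope Set.univ 0 3 :=
  toyModel.histFibreEnvelope_of_outputEnvelope toy_outputEnvelope

/-- Toy: CAUCHY's modulus — fibrewise analyticity with envelope `3` yields `DataLipschitz` with `Λ = 3/(1 − ρ₀)` for every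
reach `ρ₀ < 1` (`= 6` at `ρ₀ = 1/2`). [folklore] -/
theorem toy_dataLipschitz_cauchy {ρ₀ : ℝ} (hρ₀ : ρ₀ < 1) : toyModel.DataLipschitz Set.univ 0 (3 / (1 - ρ₀)) ρ₀ :=
  toyModel.dataLipschitz_of_fibreEnvelopes toy_opFibreEnvelope toy_histFibreEnvelope hρ₀

/-- Toy: the EXACT modulus — `Out(o, h) = o + h` is `DataLipschitz` with `Λ = 1` (unit margins) for EVERY reach `ρ₀`, no
near regime needed. [folklore] -/
theorem toy_dataLipschitz (ρ₀ : ℝ) : toyModel.DataLipschitz Set.univ 0 1 ρ₀ := by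
  intro k g _ U p _ X _ q _ _
  show ‖(q.1 + q.2) - (p.1 + p.2)‖ ≤ 1 * (‖q.1 - p.1‖ / 1 + ‖q.2 - p.2‖ / 1) * Real.exp (-(0 * toyCarriers.d X))
  rw [zero_mul, neg_zero, Real.exp_zero, mul_one, one_mul, div_one, div_one,
    show (q.1 + q.2) - (p.1 + p.2) = (q.1 - p.1) + (q.2 - p.2) by ring]
  exact norm_add_le _ _

/-- **The toy NE5 from the EXACT modulus**: `Λ = 1`, reach `ρ₀ = 2` (so `k₀ = 0`, `B = 0`: the near hypothesis
`1 + (1/64)·6/(1 − 1/64) ≤ 2` holds from the first scale), `δ = 1`, `δ′ = 0`, `θ = θ′ = 1/2`, natural gain `c = 1/64`,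
`ω = 1/64`; smallness `1/64 + 1/64 < 1/2`; constant `(31/64)/(30/64) = 31/30` — against `558/25` of the Cauchy route
(`toy_ne5Data_near`, `Λ = 6`) and the true supremum `sup_k |E_A(k) − E_B(k)|/2^{−k} = 32/31` (`toyRate`). [folklore] -/
theorem toy_ne5Data_lip : NE5 toyEA₂ toyEB (Set.univ : Set (ℕ → ℝ)) 0 (1 / 2)
    ((1 * (1 + 0) + 0) * (1 / 2 - 1 / 64) / (1 / 2 - (1 / 64 + 1 * (1 / 64)))) :=
  toyModel.ne5_at_of_stepModel_lip_nat (ρ₀ := 2) (B := 0) (k₀ := 0) toy_representsA toy_representsB toy_inBase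
    (toy_dataLipschitz 2) toy_decayA toy_decayB toy_operatorRate toy_insertionRate toy_insertionDampedNat (by norm_num)
    (by norm_num) (by norm_num) le_rfl (by norm_num) (by norm_num) (by norm_num) (by norm_num) le_rfl
    (fun k hk => absurd hk (Nat.not_lt_zero k)) (by norm_num)

/-- The exact-modulus toy constant in lowest terms, and its comparison with the true supremum `32/31`. [folklore] -/
example : ((1 * (1 + 0) + 0) * (1 / 2 - 1 / 64) / (1 / 2 - (1 / 64 + 1 * (1 / 64))) : ℝ) = 31 / 30 ∧
    (32 / 31 : ℝ) < 31 / 30 := by norm_num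

/-- The true ratio `|E_A(k) − E_B(k)|/θ^k = 32/31 − (1/31)(1/32)^k` of the toy stays below the exact-modulus constant (and
tends to `32/31`). [folklore] -/
theorem toyRate_div_pow (k : ℕ) : toyRate k / (1 / 2 : ℝ) ^ k = 32 / 31 - 1 / 31 * (1 / 32 : ℝ) ^ k := by
  have h2 : (1 / 2 : ℝ) ^ k ≠ 0 := pow_ne_zero _ (by norm_num)
  rw [div_eq_iff h2, toyRate, show (1 / 64 : ℝ) = 1 / 32 * (1 / 2) by norm_num, mul_pow]
  ring

/-- **The FIBRE chain is jointly satisfiable and produces NE5 at a slower rate**: fibre envelopes `G = 3`, reach `ρ₀ = 1/2`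
(`Λ = 6` by Cauchy), structural insertion with the single-scale term at reference level `E₁ = 3`, inputs at rate `1/2`, NE5
delivered at rate `2/3` (`k₀ = 2`, `B = 12`; smallness `1/64 + 6/64 < 2/3`; constant `18·(125/192)/(107/192) = 2250/107`).
[folklore] -/
theorem toy_ne5Data_fibre_at : NE5 toyEA₂ toyEB (Set.univ : Set (ℕ → ℝ)) 0 (2 / 3)
    ((3 / (1 - 1 / 2) * (1 + 0) + 12) * (2 / 3 - 1 / 64) / (2 / 3 - (1 / 64 + 3 / (1 - 1 / 2) * (1 / 64)))) :=
  toyModel.ne5_at_of_stepModel_fibre_scale_nat (ρ₀ := 1 / 2) (B := 12) (k₀ := 2) toy_representsA toy_representsB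
    toy_inBase toy_opFibreEnvelope toy_histFibreEnvelope toy_decayA toy_decayB toy_operatorRate toy_insertionRate
    toy_insAffine toy_insBlind toy_insHomog (toy_insScaleBound (by norm_num)) (by norm_num) (by norm_num) (by norm_num)
    (by norm_num) (by norm_num) (by norm_num) (by norm_num) (by norm_num) (by norm_num) (by norm_num) (by norm_num)
    (fun k hk => by interval_cases k <;> norm_num) (by norm_num)

/-- The fibre-chain toy constant in lowest terms. [folklore] -/
example : ((3 / (1 - 1 / 2) * (1 + 0) + 12) * (2 / 3 - 1 / 64) / (2 / 3 - (1 / 64 + 3 / (1 - 1 / 2) * (1 / 64))) : ℝ) =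
    2250 / 107 := by norm_num

end ToyFibre

end Literature.MathematicalPhysics.QuantumFieldTheory.Balaban1983to89.T4InputCauchyRateData

end
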